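import Literature.Combinatorics.Additive.HamidouneCriticalPairAbelian

/-!
# The `2`-atoms of sets with small sumset in finite abelian groups (Hamidoune–Serra–Zémor 2008,
# §§2–5): non-subgroup `2`-atoms are Sidon-like, the surjectivity lemma, `κ₂ ≥ 2|A| − 3` for a
# generating Sidon-like `3`-set, the Fainting Lemma, THEOREM 21 for `m = 0`
# (= Hamidoune 2000 Theorem 7.1 = survey Theorem 24 with `μ = 0`): for `κ₂(S) = |S| ≤ |G| − 7`
# every `2`-atom through `0` is a subgroup or a pair — THEOREM 21 FOR EVERY DEFECT `m ≤ 4`: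
# for `κ₂(S) ≤ |S| + m`, `|S| + C(m+4, 2) < |G|`, every `2`-atom through `0` is a subgroup or a
# pair — COROLLARY 22 (order condition ⇒ all `2`-atoms are pairs), THEOREM 14 (Kemperman's
# structure theorem, isoperimetric version), COROLLARY 8 (Chowla's theorem in abelian groups) and
# COROLLARY 7 (a `1`-atom through `0` is generated by its intersection with `S`)

Topic `Literature/Combinatorics/Additive`.  Cell `mm-stpp` (D-0046), seat `mm-stpp-lit` (gen 15);
continuation of `IsoperimetricMethod.lean` / `HamidouneCriticalPairAbelian.lean` (imported:
`conn`, `IsFragment`, `IsAtom`, the intersection property `IsAtom.eq_of_le_card_inter`,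
`IsAtom.exists_addSubgroup_of_vadd_eq`, `layer_step`, `two_mul_sum_range_tsub_le`, and the finset
avatar `apFinset 0 d (addOrderOf d)` of `⟨d⟩` with its API).  Everything here is PROVED
(0 `sorry`, 0 named facts), for FINITE ABELIAN groups in additive notation.  These are the tools
of the "fainting technique" by which [HamidouneSerraZemor2008, Theorem 21] describes the `2`-atoms
of not-too-large sets (`κ₂(S) − |S| = m ≤ 4`, `|S| < |G| − C(m+4, 2)` ⇒ every `2`-atom `∋ 0` is a
subgroup or has two elements); the case `m = 0` of that theorem is Hamidoune's Theorem 7.1 (Acta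
Arith. 2000) / Case 2 of the survey's Theorem 24, the one piece of the `2`-atom dichotomy that
`IsoperimetricMethod.lean` records as not formalized — and it IS formalized here
(`IsAtom.exists_addSubgroup_or_card_eq_two_of_conn_eq`), completing the dichotomy "`μ(S) ≤ 0` ⇒
every `2`-atom `∋ 0` is a subgroup or a pair" at every order
(`IsAtom.exists_addSubgroup_or_card_eq_two_of_conn_le'`).

## Source (read at the page this session)

Y. O. Hamidoune, O. Serra, G. Zémor, *On the critical pair theory in abelian groups: beyond
Chowla's theorem*, Combinatorica 28 (2008) 441–467 = arXiv:math/0603478 [HamidouneSerraZemor2008]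
— held as `paper:arxiv-math_0603478` (LaTeX source, 17 chunks), §§2–5 read in full (chunks
p0005–p0010 of the held text):

* §2 **Corollary 9** (p0005: "Let `0 ∈ S` be a `k`-separable subset of a finite abelian group `G`.
  Let `A` be a `k`-atom of `S` such that `0 ∈ A`, and suppose that `p ≥ k` where `p` is the
  smallest prime divisor of `|G|`.  Then either `A` is a subgroup of `G` or `|A ∩ (x+A)| ≤ k − 1`
  for every `x ∈ G`, `x ≠ 0`.  In particular a `2`-atom of a `2`-separable set is either a subgroup
  or a Sidon set.") — the case `k = 2` (no condition on `|G|`):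
  `IsAtom.card_inter_vadd_le_one_of_forall_ne`.
* §2 **Lemma 4** (p0005: "Let `A` be a `k`-atom and suppose that `|A| > k`.  Then, for each `a ∈ A`
  and `s ∈ S` we have `(A ∖ {a}) + S = A + S = A + (S ∖ {s})`") — the first equality for `k = 2`:
  `IsAtom.erase_add_eq`.
* §2 **Lemma 10** (p0005: "Let `0 ∈ S` be a generating set of a finite abelian group `G` of
  cardinality `|S| ≥ 3`.  Assume that `|(S + g) ∩ S| ≤ 2` for all `g ∈ G ∖ {0}`.  Then
  `κ₁(S) = |S| − 1`.") — lower-bound form `card_add_card_le_card_add_succ_of_weakSidon`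
  (`|X + S| ≥ |X| + |S| − 1` for nonempty `X` with `|X + S| ≤ |G| − 1`), PROVED as printed via a
  subgroup `1`-atom (`exists_addSubgroup_isAtom_one`).
* §2 **Lemma 11** (p0006: "Let `0 ∈ S` be a subset of a finite abelian group with `|S| ≥ 3`.  If
  `S` is a Sidon set then `κ₂(S) = 2|S| − 3`" — in `G = ⟨S⟩`) — the lower bound `κ₂(S) ≥ 2|S| − 3`:
  for `|S| = 3`, `card_add_three_le_card_add_of_sidonLike` (`|X + A| ≥ |X| + 3` for every
  `2`-admissible `X` when `A ∋ 0` is a generating Sidon-like `3`-set), and for any `|S| ≥ 3`,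
  `card_add_two_mul_le_card_add_of_sidonLike` (`|X + A| ≥ |X| + 2|A| − 3`), PROVED as printed (a
  `2`-atom `B ∋ 0` of `A` has `|B| ≥ 3`, is a subgroup or Sidon-like by Corollary 9, three
  translates of `A` inside `A + B` give `|B| ≥ |A| + 1 ≥ 4`, a Sidon-like `B` is refuted by three
  translates of `B`, a subgroup `B` by four translates of `A`
  (`four_mul_card_le_card_union_vadd_four`)); with the count of differences of a Sidon-like set
  `card_mul_card_sub_one_lt_card_of_forall_sub_mem` (`|T| ≥ |A|(|A|−1) + 1` for `T ⊇ A − A`).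
* §4 **Lemma 17** (p0008, commutation of the layers `N_i(X,Y) = (X + iY) ∖ (X + (i−1)Y)`:
  "If `N_r(X,Y) − Y* ⊂ N_{r−1}(X,Y)` for some `r ≥ 1`, then `N_i(X,Y) − Y* ⊂ N_{i−1}(X,Y)` for all
  `i ≥ r`") — this is `layer_step` of `IsoperimetricMethod.lean`; **Lemma 19 (The Fainting
  Lemma)** (p0008: "Let `X, Y ⊂ G` with `0 ∈ X ∩ Y` and set `m = |X+Y| − |X| − |Y|`.  Assume that
  `Y` generates `G` and that (i) `3 ≤ |Y| ≤ m + 3` and `κ₁(Y* − y) = |Y*| − 1 ≥ 1` for some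
  `y ∈ Y*`. (ii) `X + Y = X + (Y ∖ {z})` for each `z ∈ Y` and `N₂(X,Y) − Y* ⊂ N₁(X,Y)`.  Then
  `|X| ≥ |G| − C(m+4, 2)`.") — the case `|Y| = 3`: `fainting_three`, PROVED as printed (with
  `Y = {0, a, b}`, `y = a`, `Y* − y = {0, b − a}`: `X + i(Y − a) = X + i{0, b − a}` exhausts `G`, so
  `X + ⟨b − a⟩ = G`; a layer `N_{i+1} ≠ ∅` cannot be `(b − a)`-periodic since `N_i ⊇ N_{i+1} − Y*`
  would then contain a whole `⟨b − a⟩`-coset off `X`; hence `|N_{i+1}| + 1 ≤ |N_i|`, `|N₁| = m + 3`,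
  and `|G| ≤ |X| + Σ_{j} (m + 3 − j) = |X| + C(m+4,2)`); transported to the subgroup `⟨A⟩` of an
  ambient group as `fainting_three_of_subset_closure` (and Lemma 11 as
  `card_add_three_le_card_add_of_subset_closure`).  The GENERAL case `3 ≤ |Y| ≤ m + 3`: `fainting`,
  PROVED as printed, with hypothesis (i) taken in the form its proof uses — for a subgroup `H`
  containing `U = y − Y*` (in print `H = ⟨U⟩`), every nonempty `Z` inside one `H`-coset has
  `|Z + U| ≥ min(|H|, |Z| + |Y| − 2)` (which is `κ₁(Y* − y) = |Y*| − 1` in `⟨Y* − y⟩`, i.e. Lemma 10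
  there) — and the layer count `|N_{i+1}| + |Y| − 2 ≤ |N_i|` obtained from the coset decomposition of
  `N_{i+1}` modulo `H` and `X + H = G`; the final estimate `Σ_i (|Y| + m − i(|Y|−2))⁺ ≤ C(m+4,2)`
  is done by comparing with the case `|Y| = 3` termwise from the third layer on.
* §5 **Theorem 21** (p0009: "Let `G` be a finite abelian group and let `0 ∈ S` be a generating
  `2`-separable subset of `G` such that `|S| ≥ 3` and `κ₂(S) − |S| = m ≤ 4`.  Let `A` be a
  `2`-atom of `S` containing `0`.  If `|S| < |G| − C(m+4, 2)` then either `|A| = 2` or `A` is a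
  subgroup of `G`.") — the case `m = 0`: `IsAtom.exists_addSubgroup_or_card_eq_two_of_conn_eq`
  (`0 ∈ S`, `κ₂(S) = |S|`, `|S| + 7 ≤ |G|`, `A ∋ 0` a `2`-atom ⇒ `A` is a subgroup or `|A| = 2`),
  PROVED as printed (p0009–0010; for `m = 0` one has `|A| ≤ 3` by Corollary 12 = Hamidoune
  2000 Theorem 6.2, the generating case is the survey's Theorem 24 Case 1 =
  `IsAtom.card_eq_two_of_closure_eq_top`, and the non-generating case is the printed
  decomposition of `S` modulo `Q = ⟨A⟩`: `|S_c| ≥ 2` (Lemma 4), `δ(c) = |Q| − |S_c + A|`,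
  `Σ_c (|S_c + A| − |S_c|) = 3`, the `W`-bound from Lemma 11 in `Q`, a single coset `c₀` with
  `δ(c₀) = Σ δ ≥ 4`, Case 1 `S + Q ≠ G` (then `Q` is `2`-admissible, `Σ δ ≥ |Q| − 3`, `|Q| ≥ 7`,
  `|S_{c₀} + A| ≤ 3`, absurd) and Case 2 `S + Q = G` (the Fainting Lemma in `Q`)), with the coset
  toolkit `filter_add_eq_filter_add`, `card_add_eq_sum_card_filter_add`, `filter_add_subset_vadd`,
  `card_add_eq_card_image_mul`, `card_add_add_card_le_of_ne_univ`,
  `card_eq_of_add_eq_of_closure_eq`, `seven_le_card_of_forall_sub_mem`; this is also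
  [Hamidoune2000, §7, Theorem 7.1] ("Let `B` be a subset of a finite abelian group such that
  `0 ∈ B`, and `|B| ≤ |G| − 7` … If `κ₂(B) = |B|`, then either `H` is a subgroup or `|H| = 2`",
  whose printed proof goes through Proposition 5.3 (11) instead) and Case 2 of
  [Hamidoune2008, §8, Theorem 24]; the all-orders dichotomy for `μ ≤ 0` is
  `IsAtom.exists_addSubgroup_or_card_eq_two_of_conn_le'`.  THE GENERAL CASE `m ≤ 4`:
  `IsAtom.exists_addSubgroup_or_card_eq_two_of_conn_le_add` (`0 ∈ S`, `κ₂(S) ≤ |S| + m`, `m ≤ 4`,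
  `|S| + C(m+4,2) < |G|`, `A ∋ 0` a `2`-atom ⇒ `A` is a subgroup or `|A| = 2`), PROVED as printed
  (p0009–0010: `|A| ≤ m + 3`, Sidon-like; generating `A`: the Fainting Lemma; otherwise the
  `U/V/W` decomposition modulo `Q = ⟨A⟩` with `Σ f = |A| + m`, `f ≥ |A| − 1` on `V` (Lemma 10 in
  `Q`, `card_add_card_le_succ_of_subset_closure`), `f ≥ 2|A| − 3` on `W` (Lemma 11 in `Q`,
  `card_add_two_mul_le_card_add_of_subset_closure`), `w ≤ 2`, `v ≤ 3`; Case 1 `S + Q ≠ G`: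
  `Σ δ ≥ |Q| − |A| ≥ 4` (differences count), `w ≥ 1`, `v ≤ 2`, `δ(W) > δ(i)` by `|S_i| + m_i ≥ 3`
  (**Lemma 20**, `two_mul_card_add_le_three_mul_card`, when `|A| = 3`), so `w = 2`, `|A| = 3`,
  `v = 0`, `m_1 + m_2 ≤ 1`, and the Fainting Lemma for the piece with `m_i = 0`; Case 2 `S + Q = G`:
  `v + δ(W) ≥ C(m+4,2) + 1 − |A| − m ≥ 4`, `w = 1` refuted by the Fainting Lemma for `S_1`
  (sub-cases `m_1 = m` / `m_1 < m`), `w = 2` by the two Fainting bounds against `C(m+4,2)`), with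
  the transports `fainting_hyp_of_sidonLike` (hypothesis (i) from Lemma 10 in `⟨a − A*⟩`) and
  `fainting_of_subset_closure` (the Fainting Lemma in `⟨A⟩`, `|A| ≥ 4`), and its PAIR FORM
  `exists_addSubgroup_or_exists_card_vadd_sdiff_le` (**`|A + B| ≤ |A| + |B| + m`, `m ≤ 4`,
  `|A| ≥ 2`, `|A + B| ≤ |G| − 2`, `|B| + C(m+4,2) < |G|` ⇒ some subgroup `K`, `|K| ≥ 2`, has
  `|K + B| ≤ min(|G| − 2, |K| + |B| + m)`, or some `d ≠ 0` has `|(d + B) ∖ B| ≤ m + 2`** — the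
  composite-order counterpart of `exists_card_vadd_sdiff_le_of_card_add_le`); **Lemma 13**
  (`IsAtom.exists_addOrderOf_le_conn`: a subgroup `2`-atom of size `≥ 3` forces some `s ∈ S*` of
  order `≤ κ₂(S)`, given `κ₂(S) ≥ 1`) and **Corollary 22**
  (`IsAtom.card_eq_two_of_forall_le_addOrderOf`: `0 ∈ S` generating, `κ₂(S) ≤ |S| + m`, `m ≤ 4`,
  `|S| + C(m+4,2) < |G|`, every `s ∈ S*` of order `≥ |S| + m + 1` ⇒ every `2`-atom of `S` has
  cardinality `2`); **Theorem 14** (`isAP_or_vadd_erase_eq_of_forall_card_le_addOrderOf`: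
  `0 ∈ S` generating `2`-separable, `κ₂(S) ≤ |S| − 1`, every `s ∈ S*` of order `≥ |S|` ⇒ `S` is
  an arithmetic progression or `S ∖ {0}` is `d`-periodic for some `d ≠ 0` — Kemperman's structure
  theorem in isoperimetric form under the weak Chowla condition) and **Corollary 8**
  (`min_le_card_add_of_forall_le_addOrderOf`: `0 ∈ S` generating, every `s ∈ S*` of order
  `≥ |S| − 1` ⇒ `|X + S| ≥ min(|G|, |X| + |S| − 1)` for every nonempty `X` — Chowla's theorem
  for abelian groups) and **Corollary 7** (`IsAtom.exists_addSubgroup_eq_closure_inter`: a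
  `1`-atom `A ∋ 0` is the subgroup `⟨S ∩ A⟩`, and `|A| ∣ κ₁(S)`); the EXPLICIT STRUCTURE
  corollary `exists_addSubgroup_or_eq_periodic_union_apFinset` (Theorem 21's pair form chained
  with [Hamidoune2000, Lemma 6.1]: subgroup `K` with `|K + B| ≤ min(|G| − 2, |K| + |B| + m)`, or
  `B` = its `⟨d⟩`-periodic part ⊔ at most `m + 2` arithmetic progressions of difference `d`) and
  the transfer of progressions `isAP_of_isAP_of_card_add_le` (`⟨r⟩ = G`, `S` an `r`-progression
  with `|S| ≥ 2`, `|T + S| ≤ |T| + |S| − 1 < |G|` ⇒ `T` an `r`-progression; the "easy" step of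
  Proposition 15), and **Proposition 15 in the aperiodic case `Q = {0}`**
  (`eq_singleton_or_isAP_of_card_add_le_of_forall_card_le_addOrderOf`: `0 ∈ S` generating with
  `S ∖ {0}` invariant under no non-zero translation, `0 ∈ T`, `|T + S| ≤ |T| + |S| − 1 ≤ |G| − 2`,
  every `s ∈ S*` of order `≥ |S|` ⇒ `T = {0}` or `S`, `T` are arithmetic progressions with a
  common difference); **Lemma 4 for every `k`** (`IsAtom.erase_add_eq_of_lt_card`,
  `IsAtom.add_erase_eq_of_lt_card`: a `k`-atom `A` with `|A| > k` has `(A ∖ a) + S = A + S =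
  A + (S ∖ s)`) and Theorem 21 for an ARBITRARY `2`-atom
  (`IsAtom.exists_addSubgroup_vadd_or_card_eq_two`: every `2`-atom is a coset of a subgroup or a
  pair); **Corollary 9 for every `k`** (`IsAtom.card_inter_vadd_lt_of_forall_ne`: a `k`-atom
  `A ∋ 0` that is not a subgroup has `|A ∩ (x + A)| < k` for `x ≠ 0`, when every non-zero element
  has order `≥ k`; with `IsAtom.exists_addSubgroup_of_vadd_eq_of_le_addOrderOf`: a periodic
  `k`-atom through `0` with period of order `≥ k` is a subgroup).  PAIR FORMS (translate `0` into `B`;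
  the other set `A` witnesses `2`-admissibility): `exists_isAP_or_exists_addSubgroup_of_card_add_lt`
  (**`|A + B| ≤ |A| + |B| − 1 ≤ …`, `|A| ≥ 2`, `|A + B| ≤ |G| − 2`, `2|B| ≤ |G|` ⇒ `B` is an
  arithmetic progression or some subgroup `K`, `|K| ≥ 2`, has `|K + B| ≤ min(|G| − 2, |K| + |B| − 1)`**
  — Hamidoune 2000 Theorem 6.6 in pair form) and
  `exists_addSubgroup_or_exists_card_vadd_sdiff_le_two` (**`|A + B| ≤ |A| + |B|`, `|A| ≥ 2`,
  `|A + B| ≤ |G| − 2`, `|B| ≤ |G| − 7` ⇒ some subgroup `K`, `|K| ≥ 2`, has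
  `|K + B| ≤ min(|G| − 2, |K| + |B|)`, or some `d ≠ 0` has `|(d + B) ∖ B| ≤ 2`** — the
  composite-order counterpart of `exists_card_vadd_sdiff_le_two_of_card_add_eq`).

## Deviations from print

"Sidon set" is carried as the translate condition `∀ x ≠ 0, |A ∩ (x + A)| ≤ 1` (which is what the
proofs use; for `|A| = 3` it is equivalent to the printed "no two pairs have the same sum" only up
to the harmless case `2a = 2b`, which the proofs never exclude nor need).  The paper computes
`κ_k(S)` inside `⟨S⟩`; here the ambient group is `G` and "generating" is the explicit hypothesis
`AddSubgroup.closure A = ⊤` where the printed proof needs it (Lemma 11, the Fainting Lemma).  In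
the Fainting Lemma for `|Y| = 3` hypothesis (i) is automatic (`κ₁` of the `2`-set `{0, b − a}` in
`⟨b − a⟩`) and is replaced by what its proof uses: a nonempty `(b − a)`-invariant set contains a
`⟨b − a⟩`-coset; hypothesis (ii) is taken as `X + Y = X + {a, b}` (the case `z = 0`, the only one
the proof uses) together with the layer inclusion `N₂ − Y* ⊆ X + Y` (from which `⊆ N₁` follows).
Lemma 11 is vendored only for `|S| = 3` and as the inequality `κ₂ ≥ 3` (the printed equality's
other half is the trivial upper bound), which is the instance Theorem 21 uses for `|A| = 3`.
Theorem 21 is vendored for `m = 0` only, without the printed hypotheses "`S` generating" and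
"`|S| ≥ 3`" (not used for `m = 0`); in its proof the printed `V`-bound (`κ₁(A) = |A| − 1`,
Lemma 10) is replaced by the observation that a piece `S_c` with `S_c + A = S_c` is a whole
`Q`-coset, which suffices for `m = 0`; "`|Q| − |A| ≥ 4` … by exhaustive search" is the count of
the `7` distinct differences of a Sidon-like `3`-set; the subgroup `Q = ⟨A⟩` is handled through
its finset and the pull-back `X ↦ {x : Q // ↑x ∈ X}` (as a finset of the subtype `↥Q`), where
`card_add_three_le_card_add_of_sidonLike` and `fainting_three` are applied.  For general `m ≤ 4`
the defect is carried as an upper bound `κ₂(S) ≤ |S| + m` (equivalent to the printed statement,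
`C(m'+4,2)` being monotone), the printed "`S` generating, `|S| ≥ 3`" are dropped (unused), and
the final numerology in Case 2, `w = 2` is routed as `δ_1 + δ_2 ≤ 6 + 3(m_1 + m_2) ≤ 3m − 3 <
3m − 2 ≤ C(m+4,2) − 2 − m` instead of the printed "`≥ 21 > 16`" (same ingredients).
Lemma 13 as printed uses `|A| ≤ κ₂(S)`, valid only when `κ₂(S) ≥ 1` (it fails for `S` inside a
subgroup atom, `κ₂(S) = 0`); we carry `1 ≤ κ₂(S)` as a hypothesis and derive it from "`S`
generating" in Corollary 22.  Corollary 22 is stated for `0 ≤ m ≤ 4` (its `m = −1` case is the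
`m = 0` case up to the size bound).  Theorem 14's "`S ∖ {0}` is periodic" is rendered as
`d + (S ∖ {0}) = S ∖ {0}` for a non-zero `d` (periodicity under `⟨d⟩ ≠ 0`), and its coset
count is re-routed through [Hamidoune2000, Lemma 6.1]
(`exists_eq_filter_union_apFinset_of_card_vadd_sdiff_eq_one`); Corollary 8 is proved without
Corollary 7 (only "the `1`-atom through `0` is a subgroup" is used) and states the displayed
inequality rather than "`κ₁(S) = |S| − 1`".  Corollary 7's "`0 ∈ S ≠ ⟨S⟩`" is replaced
by the existence of the `1`-atom (all it is used for), and its proof (cited to [HCAY] in the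
source) is ours: `⟨S ∩ A⟩` is a `1`-fragment inside the atom.  Proposition 15 is formalized
only for a trivial stabilizer `Q = {0}` (the general case passes to `G/Q`; not attempted), and
Corollary 16 not at all.
Census-silent Literature shelf: no row, bracket, threshold or verdict word of the cell moves; no `ω`.
-/

namespace Literature.Combinatorics.Additive

open Finset
open scoped Pointwise

namespace Isoperimetric

variable {G : Type*} [AddCommGroup G] [Fintype G] [DecidableEq G]
variable {B : Finset G}

/-! ### Corollary 9 (`k = 2`): a `2`-atom through `0` is a subgroup or Sidon-like -/

/-- **[HamidouneSerraZemor2008, Corollary 9], case `k = 2`:** a `2`-atom `A ∋ 0` of `B ∋ 0` which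
is not (the underlying set of) a subgroup meets each of its translates `x + A`, `x ≠ 0`, in at
most one point ("`A` is a Sidon set").  Proof as printed: `x + A` is again a `2`-atom, so
`2 ≤ |A ∩ (x + A)| < |A|` is excluded by the intersection property, and `A = x + A` would make
`A` periodic, hence a subgroup. [cite: HamidouneSerraZemor2008, §2, Corollary 9] -/
theorem IsAtom.card_inter_vadd_le_one_of_forall_ne (h0 : (0 : G) ∈ B) {A : Finset G}
    (hA : IsAtom 2 B A) (h0A : (0 : G) ∈ A) (hnot : ∀ K : AddSubgroup G, (K : Set G) ≠ A)
    {x : G} (hx : x ≠ 0) : #(A ∩ (x +ᵥ A)) ≤ 1 := by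
  classical
  by_contra hlt
  have heq : A = x +ᵥ A := hA.eq_of_le_card_inter h0 (hA.vadd x) (by omega)
  obtain ⟨K, hK⟩ := hA.exists_addSubgroup_of_vadd_eq h0 h0A hx heq.symm
  exact hnot K hK

omit [Fintype G] in
/-- Two distinct translates of a Sidon-like set meet in at most one point.
[cite: HamidouneSerraZemor2008, §2 (before Corollary 9: "In particular |S ∩ (S+x)| ≤ 1 for
each x")] -/
theorem card_inter_vadd_vadd_le_one {A : Finset G}
    (hsid : ∀ x : G, x ≠ 0 → #(A ∩ (x +ᵥ A)) ≤ 1) {u v : G} (huv : u ≠ v) :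
    #((u +ᵥ A) ∩ (v +ᵥ A)) ≤ 1 := by
  have e : v = u + (v - u) := by abel
  rw [e, ← vadd_vadd, ← vadd_finset_inter, card_vadd_finset]
  exact hsid _ (sub_ne_zero.2 huv.symm)

omit [Fintype G] in
/-- Inclusion–exclusion lower bound for three sets:
`|X| + |Y| + |Z| ≤ |X ∪ Y ∪ Z| + |X ∩ Y| + |X ∩ Z| + |Y ∩ Z|`. [folklore] -/
private theorem card_add_card_add_card_le_union_three {α : Type*} [DecidableEq α]
    (X Y Z : Finset α) :
    #X + #Y + #Z ≤ #(X ∪ Y ∪ Z) + #(X ∩ Y) + #(X ∩ Z) + #(Y ∩ Z) := by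
  have h1 := card_union_add_card_inter X Y
  have h2 := card_union_add_card_inter (X ∪ Y) Z
  have h3 : #((X ∪ Y) ∩ Z) ≤ #(X ∩ Z) + #(Y ∩ Z) := by
    rw [union_inter_distrib_right]
    exact card_union_le _ _
  omega

omit [Fintype G] in
/-- Three translates of a Sidon-like set cover at least `3|A| − 3` points.
[cite: HamidouneSerraZemor2008, §2 (proof of Lemma 11: "|S + A| = |∪_{a ∈ A}(S + a)| ≥
|S| + (|S| − 1) + (|S| − 2)")] -/
theorem three_mul_card_le_card_union_vadd_three {A : Finset G}
    (hsid : ∀ x : G, x ≠ 0 → #(A ∩ (x +ᵥ A)) ≤ 1) {u v w : G} (huv : u ≠ v) (huw : u ≠ w)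
    (hvw : v ≠ w) : 3 * #A ≤ #((u +ᵥ A) ∪ (v +ᵥ A) ∪ (w +ᵥ A)) + 3 := by
  have h := card_add_card_add_card_le_union_three (u +ᵥ A) (v +ᵥ A) (w +ᵥ A)
  have h1 := card_inter_vadd_vadd_le_one hsid huv
  have h2 := card_inter_vadd_vadd_le_one hsid huw
  have h3 := card_inter_vadd_vadd_le_one hsid hvw
  rw [card_vadd_finset, card_vadd_finset, card_vadd_finset] at h
  omega

/-! ### Lemma 4 (`k = 2`): the surjectivity lemma -/

/-- **[HamidouneSerraZemor2008, Lemma 4], case `k = 2`:** if `A` is a `2`-atom of `B ∋ 0` with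
`|A| > 2`, then `(A ∖ {a}) + B = A + B` for every `a ∈ A` (no element of `A + B` has a unique
representation).  Proof as printed: otherwise `A ∖ {a}` would be a smaller `2`-fragment.
[cite: HamidouneSerraZemor2008, §2, Lemma 4] [cite: Hamidoune2000, §3 (Lemma 3.2, context)] -/
theorem IsAtom.erase_add_eq (h0 : (0 : G) ∈ B) {A : Finset G} (hA : IsAtom 2 B A)
    (h3 : 3 ≤ #A) {a : G} (ha : a ∈ A) : A.erase a + B = A + B := by
  classical
  have hAa := hA.1.1
  unfold IsAdm at hAa
  have hfrag := hA.1.2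
  have hsub : A.erase a + B ⊆ A + B := add_subset_add_right (erase_subset a A)
  by_contra hne
  have hlt : #(A.erase a + B) < #(A + B) := card_lt_card (hsub.ssubset_of_ne hne)
  have hcardE : #(A.erase a) = #A - 1 := card_erase_of_mem ha
  have hEB := card_le_card hsub
  have hadm : IsAdm 2 B (A.erase a) := ⟨by rw [hcardE]; omega, by omega⟩
  have hκ := conn_le hadm
  have hXB := card_le_card_add h0 (A.erase a)
  have hAB := card_le_card_add h0 A
  have hfragE : IsFragment 2 B (A.erase a) := ⟨hadm, by rw [hcardE] at hκ ⊢; omega⟩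
  have := hA.2 _ hfragE
  omega

/-- For a `2`-atom `A ∋ 0` with `|A| ≥ 3`: `A + B = (A ∖ {0}) + B`, so every `x ∈ A + B` is
`a + b` with `a ∈ A ∖ {0}`; in particular a piece `B'` of `B` with `B' + A ⊆ B' + (A ∖ {0})` … — the
form used coset-wise in [HamidouneSerraZemor2008, Theorem 21] ("Lemma 4 implies
`S_i + A = S_i + A*`, so that `|S_i| ≥ 2`"). [cite: HamidouneSerraZemor2008, §2, Lemma 4 and §5
(proof of Theorem 21)] -/
theorem IsAtom.add_eq_erase_zero_add (h0 : (0 : G) ∈ B) {A : Finset G} (hA : IsAtom 2 B A)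
    (h3 : 3 ≤ #A) (h0A : (0 : G) ∈ A) : A + B = A.erase 0 + B :=
  (hA.erase_add_eq h0 h3 h0A).symm

/-! ### Lemma 11 for `|S| = 3`: a generating Sidon-like `3`-set has `κ₂ ≥ 3` -/

/-- **[HamidouneSerraZemor2008, Lemma 11], the case `|S| = 3`, lower bound:** if `A ∋ 0` is a
`3`-element Sidon-like set generating `G`, then every `X` with `|X| ≥ 2` and `|X + A| ≤ |G| − 2`
has `|X + A| ≥ |X| + 3` (i.e. `κ₂(A) ≥ 2|A| − 3 = 3`).  Proof as printed: otherwise `κ₂(A) ≤ 2`;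
a `2`-atom `B ∋ 0` of `A` has `|B| ≥ 3` (two translates of `A` already have `5 > |B| + 2`
points), `|B| ≥ 4` (three translates of `A` have `≥ 6` points), and `B` is Sidon-like or a
subgroup (Corollary 9): three translates of a Sidon-like `B` have `≥ 3|B| − 3 > |B| + 2` points;
a proper subgroup `B ∌ A` has `A + B ⊇ B ⊔ (α + B)`, `2|B| > |B| + 2`; and `A ⊆ B` would force
`B = G`. [cite: HamidouneSerraZemor2008, §2, Lemma 11 and Corollary 9] -/
theorem card_add_three_le_card_add_of_sidonLike {A : Finset G} (h0A : (0 : G) ∈ A)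
    (hA3 : #A = 3) (hsid : ∀ x : G, x ≠ 0 → #(A ∩ (x +ᵥ A)) ≤ 1)
    (hgen : AddSubgroup.closure (A : Set G) = ⊤) {X : Finset G} (hX2 : 2 ≤ #X)
    (hXA : #(X + A) + 2 ≤ Fintype.card G) : #X + 3 ≤ #(X + A) := by
  classical
  by_contra hlt
  push Not at hlt
  have hadm : IsAdm 2 A X := ⟨hX2, hXA⟩
  have hκ : conn 2 A ≤ 2 := by
    have := conn_le hadm
    have := card_le_card_add h0A X
    omega
  obtain ⟨B₀, hB₀⟩ := exists_isAtom ⟨X, hadm⟩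
  have hB₀a := hB₀.1.1
  unfold IsAdm at hB₀a
  obtain ⟨b₀, hb₀⟩ : B₀.Nonempty := card_pos.1 (by omega)
  obtain ⟨B, hB, h0B⟩ : ∃ B : Finset G, IsAtom 2 A B ∧ (0 : G) ∈ B :=
    ⟨-b₀ +ᵥ B₀, hB₀.vadd (-b₀), mem_vadd_finset.2 ⟨b₀, hb₀, by rw [vadd_eq_add, neg_add_cancel]⟩⟩
  have hBa := hB.1.1
  unfold IsAdm at hBa
  have hBf := hB.1.2
  have hBAB := card_le_card_add h0A B
  have hBA2 : #(B + A) ≤ #B + 2 := by omega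
  -- translates of `A` by elements of `B` lie in `A + B = B + A`
  have htr : ∀ u ∈ B, u +ᵥ A ⊆ B + A := fun u hu y hy => by
    obtain ⟨z, hz, rfl⟩ := mem_vadd_finset.1 hy
    exact mem_add.2 ⟨u, hu, z, hz, rfl⟩
  -- `|B| ≥ 3`
  have hB3 : 3 ≤ #B := by
    by_contra hB2
    have hB2' : #B = 2 := by omega
    obtain ⟨u, v, huv, hBuv⟩ := card_eq_two.1 hB2'
    have hu : u ∈ B := by rw [hBuv]; simp
    have hv : v ∈ B := by rw [hBuv]; simp
    have hsub : (u +ᵥ A) ∪ (v +ᵥ A) ⊆ B + A := union_subset (htr u hu) (htr v hv)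
    have h1 := card_le_card hsub
    have h2 := card_union_add_card_inter (u +ᵥ A) (v +ᵥ A)
    have h3 := card_inter_vadd_vadd_le_one hsid huv
    rw [card_vadd_finset, card_vadd_finset] at h2
    omega
  -- `|B| ≥ 4`
  obtain ⟨u, hu, v, hv, w, hw, huv, huw, hvw⟩ := two_lt_card.1 (by omega : 2 < #B)
  have hB4 : 4 ≤ #B := by
    have hsub : (u +ᵥ A) ∪ (v +ᵥ A) ∪ (w +ᵥ A) ⊆ B + A :=
      union_subset (union_subset (htr u hu) (htr v hv)) (htr w hw)
    have h1 := card_le_card hsub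
    have h2 := three_mul_card_le_card_union_vadd_three hsid huv huw hvw
    omega
  by_cases hK : ∃ K : AddSubgroup G, (K : Set G) = B
  · -- `B` is a subgroup
    obtain ⟨K, hK⟩ := hK
    by_cases hAB : A ⊆ B
    · -- then `B = G`, contradicting admissibility
      have hKtop : K = ⊤ := by
        rw [eq_top_iff, ← hgen, AddSubgroup.closure_le, hK]
        exact_mod_cast hAB
      have hBuniv : B = univ := by
        rw [← coe_eq_univ, ← hK, hKtop]; rfl
      have : #(B + A) = Fintype.card G := by
        apply le_antisymm (card_le_univ _)
        rw [← card_univ, ← hBuniv]; exact hBAB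
      omega
    · obtain ⟨α, hαA, hαB⟩ := not_subset.1 hAB
      have hdisj : Disjoint B (α +ᵥ B) := by
        rw [disjoint_left]
        rintro y hyB hyα
        obtain ⟨z, hz, rfl⟩ := mem_vadd_finset.1 hyα
        apply hαB
        have hzK : z ∈ K := by rw [← SetLike.mem_coe, hK]; exact hz
        have hyK : α + z ∈ K := by
          rw [← SetLike.mem_coe, hK]; exact hyB
        have : α = (α + z) - z := by abel
        rw [← mem_coe, ← hK, SetLike.mem_coe, this]
        exact K.sub_mem hyK hzK
      have hsub : B ∪ (α +ᵥ B) ⊆ B + A := by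
        refine union_subset (fun y hy => mem_add.2 ⟨y, hy, 0, h0A, add_zero y⟩) fun y hy => ?_
        obtain ⟨z, hz, rfl⟩ := mem_vadd_finset.1 hy
        exact mem_add.2 ⟨z, hz, α, hαA, by rw [vadd_eq_add, add_comm]⟩
      have h1 := card_le_card hsub
      have h2 : #(B ∪ (α +ᵥ B)) = #B + #B := by
        rw [card_union_of_disjoint hdisj, card_vadd_finset]
      omega
  · -- `B` is Sidon-like: three translates of `B` by the elements of `A`
    push Not at hK
    have hsidB : ∀ x : G, x ≠ 0 → #(B ∩ (x +ᵥ B)) ≤ 1 := fun x hx =>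
      hB.card_inter_vadd_le_one_of_forall_ne h0A h0B hK hx
    obtain ⟨x, y, z, hxy, hxz, hyz, hAxyz⟩ := card_eq_three.1 hA3
    have htr' : ∀ s ∈ A, s +ᵥ B ⊆ B + A := fun s hs t ht => by
      obtain ⟨r, hr, rfl⟩ := mem_vadd_finset.1 ht
      exact mem_add.2 ⟨r, hr, s, hs, by rw [vadd_eq_add, add_comm]⟩
    have hx : x ∈ A := by rw [hAxyz]; simp
    have hy : y ∈ A := by rw [hAxyz]; simp
    have hz : z ∈ A := by rw [hAxyz]; simp
    have hsub : (x +ᵥ B) ∪ (y +ᵥ B) ∪ (z +ᵥ B) ⊆ B + A :=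
      union_subset (union_subset (htr' x hx) (htr' y hy)) (htr' z hz)
    have h1 := card_le_card hsub
    have h2 := three_mul_card_le_card_union_vadd_three hsidB hxy hxz hyz
    omega

/-! ### The Fainting Lemma for `|Y| = 3` -/

/-- A set stable under `+ Y` for a generating `Y ∋ 0` is everything: if `T ≠ ∅` and `T + Y = T`
with `AddSubgroup.closure Y = ⊤`, then `T = G`. [cite: HamidouneSerraZemor2008, §4 (proof of
Lemma 19: "since 0 ∈ Y generates G, we have G = X + nY")] -/
theorem eq_univ_of_add_eq_of_closure_eq_top {T Y : Finset G} (hT : T.Nonempty)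
    (hgen : AddSubgroup.closure (Y : Set G) = ⊤) (hTY : T + Y = T) : T = univ := by
  classical
  have hstab : ∀ y ∈ Y, y +ᵥ T = T := by
    intro y hy
    apply eq_of_subset_of_card_le _ (by rw [card_vadd_finset])
    intro t ht
    obtain ⟨s, hs, rfl⟩ := mem_vadd_finset.1 ht
    rw [← hTY, vadd_eq_add, add_comm y s]
    exact add_mem_add hs hy
  have hle : AddSubgroup.closure (Y : Set G) ≤ AddAction.stabilizer G T := by
    rw [AddSubgroup.closure_le]
    intro y hy
    rw [SetLike.mem_coe, AddAction.mem_stabilizer_iff]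
    exact hstab y hy
  rw [hgen, top_le_iff] at hle
  obtain ⟨t, ht⟩ := hT
  apply eq_univ_of_forall
  intro g
  have hg : (g - t) +ᵥ T = T := by
    have : g - t ∈ AddAction.stabilizer G T := by rw [hle]; exact AddSubgroup.mem_top _
    exact AddAction.mem_stabilizer_iff.1 this
  rw [← hg]
  exact mem_vadd_finset.2 ⟨t, ht, by rw [vadd_eq_add, sub_add_cancel]⟩

/-- **[HamidouneSerraZemor2008, Lemma 19 (the Fainting Lemma)], case `|Y| = 3`.**  Let
`Y = {0, a, b}` (`a, b ≠ 0`; `a ≠ b` is then forced) generate `G`, `0 ∈ X`,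
`|X + Y| = |X| + 3 + m`, and assume
(ii): `X + Y = X + {a, b}` and the layer inclusion `N₂(X,Y) − Y* ⊆ X + Y`
(`N₂ = (X + 2Y) ∖ (X + Y)`, `Y* = Y ∖ {0} = {a, b}`).  Then
`|G| ≤ |X| + (m+3)(m+4)/2 = |X| + C(m+4, 2)`.  (Hypothesis (i) of the printed lemma is automatic
for `|Y| = 3`.)  These hypotheses hold when `Y` is a `2`-atom `∋ 0` of `X` of size `3` which is not
a subgroup (Lemma 18 = Lemma 4 + `IsAtom.add_neg_mem_sdiff_of_mem_sdiff`).
[cite: HamidouneSerraZemor2008, §4, Lemma 19 (and Lemmas 17, 18)] -/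
theorem fainting_three {X : Finset G} {a b : G} (h0X : (0 : G) ∈ X) (ha : a ≠ 0) (hb : b ≠ 0)
    (hgen : AddSubgroup.closure (({0, a, b} : Finset G) : Set G) = ⊤) {m : ℕ}
    (hm : #(X + {0, a, b}) = #X + 3 + m) (hii : X + {0, a, b} = X + {a, b})
    (hN : ∀ z ∈ (X + {0, a, b} + {0, a, b}) \ (X + {0, a, b}),
      ∀ h ∈ ({0, a, b} : Finset G).erase 0, z + -h ∈ X + {0, a, b}) :
    Fintype.card G ≤ #X + (m + 3) * (m + 4) / 2 := by
  classical
  set Y : Finset G := {0, a, b} with hYdef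
  have h0Y : (0 : G) ∈ Y := by rw [hYdef]; simp
  have hYe : Y.erase 0 = {a, b} := by
    rw [hYdef, erase_insert_eq_erase, erase_eq_of_notMem]
    simp only [mem_insert, mem_singleton, not_or]
    exact ⟨ha.symm, hb.symm⟩
  have haY : a ∈ Y.erase 0 := by rw [hYe]; simp
  have hbY : b ∈ Y.erase 0 := by rw [hYe]; simp
  set d : G := b - a with hd
  set Kf := apFinset (0 : G) d (addOrderOf d) with hKf
  have hK0 : (0 : G) ∈ Kf := by simpa using nsmul_mem_apFinset_zero_addOrderOf d 0
  have hKd : d ∈ Kf := by simpa using nsmul_mem_apFinset_zero_addOrderOf d 1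
  have hKK : d +ᵥ Kf = Kf := by
    apply eq_of_subset_of_card_le _ (by rw [card_vadd_finset])
    intro x hx
    obtain ⟨k, hk, rfl⟩ := mem_vadd_finset.1 hx
    exact add_mem_apFinset_zero_addOrderOf hKd hk
  have hKneg : ∀ k ∈ Kf, -k ∈ Kf := by
    intro k hk
    have hk' := hk
    rw [hKf, mem_apFinset] at hk'
    obtain ⟨i, -, hik⟩ := hk'
    rw [zero_add] at hik
    have : -k = 0 + (addOrderOf d - 1) • k := by
      rw [zero_add]
      have h1 : (addOrderOf d - 1) • k + k = 0 := by
        rw [← succ_nsmul, Nat.sub_add_cancel (addOrderOf_pos d)]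
        rw [← hik, ← mul_nsmul', addOrderOf_dvd_iff_nsmul_eq_zero.1 (dvd_mul_right _ _)]
      exact neg_eq_of_add_eq_zero_left h1
    rw [this, ← hik, ← mul_nsmul', zero_add]
    exact nsmul_mem_apFinset_zero_addOrderOf d _
  -- the cumulative layers `T i = X + iY`
  obtain ⟨T, hT0, hTs⟩ : ∃ T : ℕ → Finset G, T 0 = X ∧ ∀ n, T (n + 1) = T n + Y :=
    ⟨fun n => Nat.rec X (fun _ Z => Z + Y) n, rfl, fun _ => rfl⟩
  have hT1 : T 1 = X + Y := by rw [hTs, hT0]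
  have hT2 : T 2 = X + Y + Y := by rw [hTs, hT1]
  have hmono : ∀ n, T n ⊆ T (n + 1) := fun n => by rw [hTs]; exact subset_add_left _ h0Y
  have hXsub : ∀ n, X ⊆ T n := by
    intro n
    induction n with
    | zero => rw [hT0]
    | succ n ih => exact ih.trans (hmono n)
  have hTne : ∀ n, (T n).Nonempty := fun n => ⟨0, hXsub n h0X⟩
  -- a layer which is not everything grows (`Y` generates `G`)
  have hgrow : ∀ n, T n ≠ univ → #(T n) + 1 ≤ #(T (n + 1)) := by
    intro n hn
    by_contra hlt
    have heq : T (n + 1) = T n := (eq_of_subset_of_card_le (hmono n) (by omega)).symm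
    rw [hTs] at heq
    exact hn (eq_univ_of_add_eq_of_closure_eq_top (hTne n) hgen heq)
  have hbig : ∀ n, T n = univ ∨ #X + n ≤ #(T n) := by
    intro n
    induction n with
    | zero => right; rw [hT0]; simp
    | succ n ih =>
      by_cases hn : T n = univ
      · left
        exact eq_univ_of_forall fun x => hmono n (hn ▸ mem_univ x)
      · rcases ih with h | h
        · exact absurd h hn
        · right; have := hgrow n hn; omega
  have hX1 : 1 ≤ #X := card_pos.2 ⟨0, h0X⟩
  have hTu : T (Fintype.card G) = univ := by
    rcases hbig (Fintype.card G) with h | h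
    · exact h
    · have := card_le_univ (T (Fintype.card G))
      omega
  -- `X + ⟨d⟩ = G`: with `Z = X + Kf`, `Z + Y = {a} + Z`, hence `T i ⊆ {i•a} + Z`
  set Z := X + Kf with hZ
  have hab2 : ({a, b} : Finset G) = {a} + {0, d} := by
    rw [singleton_add, vadd_finset_insert, vadd_finset_singleton, vadd_eq_add, vadd_eq_add,
      add_zero, hd, add_sub_cancel]
  have hdK : ({0, d} : Finset G) + Kf = Kf := by
    apply Subset.antisymm
    · intro x hx
      obtain ⟨e, he, k, hk, rfl⟩ := mem_add.1 hx
      rw [mem_insert, mem_singleton] at he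
      rcases he with rfl | rfl
      · rwa [zero_add]
      · exact add_mem_apFinset_zero_addOrderOf hKd hk
    · intro k hk
      exact mem_add.2 ⟨0, by simp, k, hk, zero_add k⟩
  have hZY : Z + Y = {a} + Z := by
    rw [hZ, add_right_comm, hii, hab2]
    rw [show X + ({a} + {0, d}) + Kf = {a} + (X + (({0, d} : Finset G) + Kf)) by abel, hdK]
  have hstep : ∀ i, T i ⊆ {i • a} + Z := by
    intro i
    induction i with
    | zero =>
      rw [zero_nsmul, hT0]
      intro x hx
      exact mem_add.2 ⟨0, mem_singleton_self 0, x, mem_add.2 ⟨x, hx, 0, hK0, add_zero x⟩,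
        zero_add x⟩
    | succ i ih =>
      rw [hTs]
      refine (add_subset_add_right ih).trans ?_
      rw [add_assoc, hZY, ← add_assoc, singleton_add_singleton, succ_nsmul]
  have hZu : Z = univ := by
    have h1 := hstep (Fintype.card G)
    rw [hTu] at h1
    have h2 : #({Fintype.card G • a} + Z) = #Z := by
      rw [singleton_add, card_vadd_finset]
    have h3 := card_le_card h1
    rw [h2, card_univ] at h3
    exact eq_univ_of_card _ (le_antisymm (card_le_univ _) h3)
  -- (1) the layer inclusion `(T (i+1) ∖ T i) − Y* ⊆ T i` for `i ≥ 1`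
  have hP : ∀ i, 1 ≤ i → ∀ z ∈ T (i + 1) \ T i, ∀ h ∈ Y.erase 0, z + -h ∈ T i := by
    intro i hi
    induction i with
    | zero => omega
    | succ i ih =>
      rcases Nat.eq_zero_or_pos i with rfl | hipos
      · intro z hz h hh
        have e1 : T (0 + 1) = X + Y := hT1
        have e2 : T (0 + 1 + 1) = X + Y + Y := hT2
        rw [e1, e2] at hz
        rw [e1]
        exact hN z hz h hh
      · have ih' := ih hipos
        rw [hTs i] at ih'
        intro z hz h hh
        rw [hTs (i + 1), hTs i] at hz
        rw [hTs i]
        exact layer_step ih' z hz h hh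
  -- (2) the layer sizes decrease: `|N_{i+2}| + 1 ≤ |N_{i+1}|` while `N_{i+2} ≠ ∅`
  obtain ⟨e, he⟩ : ∃ e : ℕ → ℕ, ∀ i, e i = #(T (i + 1)) - #(T i) := ⟨_, fun _ => rfl⟩
  have hecard : ∀ i, e i = #(T (i + 1) \ T i) := fun i => by
    rw [he, card_sdiff_of_subset (hmono i)]
  have hdec : ∀ i, e (i + 1) ≠ 0 → e (i + 1) + 1 ≤ e i := by
    intro i hi
    rw [hecard] at hi
    set N := T (i + 1 + 1) \ T (i + 1) with hNdef
    obtain ⟨n₀, hn₀⟩ : N.Nonempty := card_pos.1 (Nat.pos_of_ne_zero hi)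
    have hback : ∀ z ∈ N, ∀ h ∈ Y.erase 0, z + -h ∈ T (i + 1) \ T i := by
      intro z hz h hh
      have h1 := hP (i + 1) (by omega) z hz h hh
      refine mem_sdiff.2 ⟨h1, fun h2 => ?_⟩
      rw [hNdef, mem_sdiff] at hz
      apply hz.2
      rw [hTs]
      have ee : z = (z + -h) + h := by abel
      rw [ee]
      exact add_mem_add h2 (mem_erase.1 hh).2
    set M := N ∪ (-d +ᵥ N) with hMdef
    have hM : M ⊆ a +ᵥ (T (i + 1) \ T i) := by
      intro z hz
      rw [hMdef, mem_union] at hz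
      rcases hz with hz | hz
      · exact mem_vadd_finset.2 ⟨z + -a, hback z hz a haY, by rw [vadd_eq_add]; abel⟩
      · obtain ⟨w, hw, rfl⟩ := mem_vadd_finset.1 hz
        refine mem_vadd_finset.2 ⟨w + -b, hback w hw b hbY, ?_⟩
        rw [vadd_eq_add, vadd_eq_add, hd]; abel
    have hMcard : #M ≤ e i := by
      have := card_le_card hM
      rwa [card_vadd_finset, ← hecard] at this
    have hNM : #N + 1 ≤ #M := by
      by_contra hle
      push Not at hle
      have hMN : M = N :=
        (eq_of_subset_of_card_le subset_union_left (by change #M ≤ #N; omega)).symm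
      have hper' : -d +ᵥ N = N := by
        apply eq_of_subset_of_card_le _ (by rw [card_vadd_finset])
        have : -d +ᵥ N ⊆ M := subset_union_right
        rwa [hMN] at this
      have hper : d +ᵥ N = N := by
        nth_rewrite 1 [← hper']
        rw [vadd_vadd, add_neg_cancel, zero_vadd]
      -- `X + Kf = G` gives `x ∈ X`, `k ∈ Kf` with `x + k = n₀ - a`; then `n₀ - k ∈ N` lands in `X`
      have hx : n₀ + -a ∈ Z := by rw [hZu]; exact mem_univ _
      obtain ⟨x, hxX, k, hk, hxk⟩ := mem_add.1 hx
      have hnegk := hKneg k hk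
      rw [hKf, mem_apFinset] at hnegk
      obtain ⟨j, -, hj⟩ := hnegk
      rw [zero_add] at hj
      have hzN : n₀ + -k ∈ N := by
        rw [← hj]
        exact (mem_iff_add_nsmul_mem_of_vadd_eq hper n₀ j).1 hn₀
      have h1 := hback _ hzN a haY
      rw [mem_sdiff] at h1
      apply h1.2
      have ee : n₀ + -k + -a = x := by
        have : x = n₀ + -a + -k := by rw [← hxk]; abel
        rw [this]; abel
      rw [ee]
      exact hXsub i hxX
    have hN' : e (i + 1) = #N := by rw [hecard]
    omega
  -- (3) counting
  have htel : ∀ L, #(T L) = #X + ∑ i ∈ range L, e i := by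
    intro L
    induction L with
    | zero => rw [hT0]; simp
    | succ L ih =>
      rw [sum_range_succ, ← add_assoc, ← ih, he]
      have := card_le_card (hmono L)
      omega
  have he0 : e 0 = m + 3 := by
    rw [he, show (0 : ℕ) + 1 = 1 from rfl, hT1, hT0, hm]
    omega
  have hebound : ∀ i, e i ≤ m + 3 - i := by
    intro i
    induction i with
    | zero => rw [he0]; omega
    | succ i ih =>
      by_cases h : e (i + 1) = 0
      · rw [h]; exact Nat.zero_le _
      · have := hdec i h
        omega
  have hsum : 2 * ∑ i ∈ range (Fintype.card G), e i ≤ (m + 3) * (m + 4) := by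
    have h1 : ∑ i ∈ range (Fintype.card G), e i ≤ ∑ i ∈ range (Fintype.card G), (m + 3 - i) :=
      sum_le_sum fun i _ => hebound i
    have h2 := two_mul_sum_range_tsub_le (m + 3) (Fintype.card G)
    rw [show m + 3 + 1 = m + 4 by ring] at h2
    have h3 : 2 * ∑ i ∈ range (Fintype.card G), (m + 3 - i) ≤ (m + 3) * (m + 4) := by
      have := Nat.zero_le ((m + 3 - Fintype.card G) * (m + 3 - Fintype.card G + 1))
      omega
    omega
  have hfin := htel (Fintype.card G)
  rw [hTu, card_univ] at hfin
  have heven : (m + 3) * (m + 4) / 2 * 2 = (m + 3) * (m + 4) :=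
    Nat.div_mul_cancel (Nat.even_mul_succ_self (m + 3)).two_dvd
  omega

/-! ### Decomposition modulo a subgroup -/

omit [Fintype G] in
/-- Adding a set `A ⊆ Q` acts coset-wise: the piece of `S + A` in the coset `c` is
`(piece of S in c) + A`. [cite: HamidouneSerraZemor2008, §2 (decomposition of a subset modulo a
subgroup, before Lemma 11) and §5 (proof of Theorem 21: "the decomposition of S + A modulo Q")] -/
theorem filter_add_eq_filter_add (Q : AddSubgroup G) [DecidableEq (G ⧸ Q)] (S A : Finset G) (hA : (A : Set G) ⊆ Q)
    (c : G ⧸ Q) :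
    (S + A).filter (fun x : G => (x : G ⧸ Q) = c) = S.filter (fun s : G => (s : G ⧸ Q) = c) + A := by
  ext x
  simp only [mem_filter, mem_add]
  constructor
  · rintro ⟨⟨s, hs, a, ha, rfl⟩, hc⟩
    refine ⟨s, ⟨hs, ?_⟩, a, ha, rfl⟩
    rw [← hc, QuotientAddGroup.mk_add, (QuotientAddGroup.eq_zero_iff a).2 (hA ha), add_zero]
  · rintro ⟨s, ⟨hs, hc⟩, a, ha, rfl⟩
    refine ⟨⟨s, hs, a, ha, rfl⟩, ?_⟩
    rw [QuotientAddGroup.mk_add, (QuotientAddGroup.eq_zero_iff a).2 (hA ha), add_zero, hc]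

omit [Fintype G] in
/-- `|S + A| = Σ_c |S_c + A|` over the cosets `c` met by `S`, for `A ⊆ Q`.
[cite: HamidouneSerraZemor2008, §5 (proof of Theorem 21, display (|S|+|A|+m))] -/
theorem card_add_eq_sum_card_filter_add (Q : AddSubgroup G) [DecidableEq (G ⧸ Q)] (S A : Finset G)
    (hA : (A : Set G) ⊆ Q) :
    #(S + A) = ∑ c ∈ S.image (fun s : G => (s : G ⧸ Q)),
      #(S.filter (fun s : G => (s : G ⧸ Q) = c) + A) := by
  rw [card_eq_sum_card_fiberwise (f := fun x : G => (x : G ⧸ Q)) (t := S.image fun s : G => (s : G ⧸ Q))]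
  · exact sum_congr rfl fun c _ => by rw [filter_add_eq_filter_add Q S A hA c]
  · intro x hx
    rw [mem_coe, mem_add] at hx
    obtain ⟨s, hs, a, ha, rfl⟩ := hx
    simp only [mem_coe, mem_image]
    refine ⟨s, hs, ?_⟩
    rw [QuotientAddGroup.mk_add, (QuotientAddGroup.eq_zero_iff a).2 (hA ha), add_zero]

omit [Fintype G] in
/-- A piece `S_c + A` (`A ⊆ Q`, `S_c ≠ ∅` inside the coset `c`) lies in that coset, which has `|Q|`
elements: `|S_c + A| ≤ |Q|`, with `Q` given by the finset `Qf`. [cite: HamidouneSerraZemor2008,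
§5 (proof of Theorem 21: δ(i) = |Q| − |S_i + A| ≥ 0)] -/
theorem filter_add_subset_vadd (Q : AddSubgroup G) [DecidableEq (G ⧸ Q)] (Qf : Finset G) (hQf : ∀ g, g ∈ Qf ↔ g ∈ Q)
    (S A : Finset G) (hA : (A : Set G) ⊆ Q) {c : G ⧸ Q} {s₀ : G} (hs₀ : (s₀ : G ⧸ Q) = c) :
    S.filter (fun s : G => (s : G ⧸ Q) = c) + A ⊆ s₀ +ᵥ Qf := by
  intro x hx
  obtain ⟨s, hs, a, ha, rfl⟩ := mem_add.1 hx
  rw [mem_filter] at hs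
  refine mem_vadd_finset.2 ⟨-s₀ + (s + a), (hQf _).2 ?_, by rw [vadd_eq_add]; abel⟩
  have h1 : -s₀ + s ∈ Q := QuotientAddGroup.eq.1 (hs₀.trans hs.2.symm)
  have := Q.add_mem h1 (hA ha)
  rwa [add_assoc] at this

omit [Fintype G] in
/-- `S + Q` is the union of the `Q`-cosets met by `S`: `|S + Q| = (#cosets met) · |Q|`.
[cite: HamidouneSerraZemor2008, §5 (proof of Theorem 21: δ(I) = |S + Q| − |S + A|)] -/
theorem card_add_eq_card_image_mul (Q : AddSubgroup G) [DecidableEq (G ⧸ Q)] (Qf : Finset G)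
    (hQf : ∀ g, g ∈ Qf ↔ g ∈ Q) (S : Finset G) :
    #(S + Qf) = #(S.image fun s : G => (s : G ⧸ Q)) * #Qf := by
  classical
  have hQfQ : (Qf : Set G) ⊆ Q := fun g hg => (hQf g).1 hg
  rw [card_add_eq_sum_card_filter_add Q S Qf hQfQ, sum_const_nat]
  intro c hc
  obtain ⟨s₀, hs₀S, hs₀⟩ := mem_image.1 hc
  apply le_antisymm
  · have := card_le_card (filter_add_subset_vadd Q Qf hQf S Qf hQfQ hs₀)
    rwa [card_vadd_finset] at this
  · have hsub : s₀ +ᵥ Qf ⊆ S.filter (fun s : G => (s : G ⧸ Q) = c) + Qf := by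
      intro x hx
      obtain ⟨q, hq, rfl⟩ := mem_vadd_finset.1 hx
      exact mem_add.2 ⟨s₀, mem_filter.2 ⟨hs₀S, hs₀⟩, q, hq, rfl⟩
    have := card_le_card hsub
    rwa [card_vadd_finset] at this

/-- If `S + Q ≠ G` then `S + Q` misses a whole coset: `|S + Q| + |Q| ≤ |G|`.
[cite: HamidouneSerraZemor2008, §5 (proof of Theorem 21, Case 1)] [cite: Hamidoune2000, §6
(proof of Proposition 6.5: "G ∖ (B + K) is a union of K-cosets")] -/
theorem card_add_add_card_le_of_ne_univ (Q : AddSubgroup G) (Qf : Finset G)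
    (hQf : ∀ g, g ∈ Qf ↔ g ∈ Q) (S : Finset G) (hne : S + Qf ≠ univ) :
    #(S + Qf) + #Qf ≤ Fintype.card G := by
  classical
  obtain ⟨x, hx⟩ : ∃ x, x ∉ S + Qf := by
    by_contra h
    push Not at h
    exact hne (eq_univ_of_forall h)
  have hdisj : Disjoint (S + Qf) (x +ᵥ Qf) := by
    rw [disjoint_left]
    rintro y hy hyx
    obtain ⟨s, hs, q, hq, rfl⟩ := mem_add.1 hy
    obtain ⟨q', hq', he⟩ := mem_vadd_finset.1 hyx
    apply hx
    rw [vadd_eq_add] at he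
    refine mem_add.2 ⟨s, hs, q - q', (hQf _).2 (Q.sub_mem ((hQf q).1 hq) ((hQf q').1 hq')), ?_⟩
    have : x = s + q - q' := by rw [← he]; abel
    rw [this]; abel
  have := card_le_univ (S + Qf ∪ (x +ᵥ Qf))
  rwa [card_union_of_disjoint hdisj, card_vadd_finset] at this

omit [Fintype G] in
/-- A nonempty piece `P` inside one `Q`-coset which is stable under a set `A` generating `Q`
(`P + A = P`, `AddSubgroup.closure A = Q`) is the whole coset: `|P| = |Q|`.
[cite: HamidouneSerraZemor2008, §5 (proof of Theorem 21: the cosets i ∈ U)] -/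
theorem card_eq_of_add_eq_of_closure_eq (Q : AddSubgroup G) (Qf : Finset G)
    (hQf : ∀ g, g ∈ Qf ↔ g ∈ Q) {A P : Finset G} (hgen : AddSubgroup.closure (A : Set G) = Q)
    {s₀ : G} (hs₀ : s₀ ∈ P) (hP : P ⊆ s₀ +ᵥ Qf) (hPA : P + A = P) : #P = #Qf := by
  classical
  have hstab : ∀ y ∈ A, y +ᵥ P = P := by
    intro y hy
    apply eq_of_subset_of_card_le _ (by rw [card_vadd_finset])
    intro t ht
    obtain ⟨s, hs, rfl⟩ := mem_vadd_finset.1 ht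
    rw [← hPA, vadd_eq_add, add_comm y s]
    exact add_mem_add hs hy
  have hle : Q ≤ AddAction.stabilizer G P := by
    rw [← hgen, AddSubgroup.closure_le]
    intro y hy
    rw [SetLike.mem_coe, AddAction.mem_stabilizer_iff]
    exact hstab y hy
  apply le_antisymm
  · have := card_le_card hP; rwa [card_vadd_finset] at this
  · have hsub : s₀ +ᵥ Qf ⊆ P := by
      intro x hx
      obtain ⟨q, hq, rfl⟩ := mem_vadd_finset.1 hx
      have hq' : q +ᵥ P = P := AddAction.mem_stabilizer_iff.1 (hle ((hQf q).1 hq))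
      rw [← hq', vadd_eq_add, add_comm]
      exact mem_vadd_finset.2 ⟨s₀, hs₀, rfl⟩
    have := card_le_card hsub; rwa [card_vadd_finset] at this

omit [Fintype G] in
/-- A Sidon-like `3`-set has `7` distinct differences: any `T` containing all `α − β`
(`α, β ∈ A`) has `|T| ≥ 7` (so `|⟨A⟩| ≥ 7`). [cite: HamidouneSerraZemor2008, §5 (proof of
Theorem 21: "Since A is a Sidon set we have |Q| − |A| ≥ 4")] -/
theorem seven_le_card_of_forall_sub_mem {A : Finset G} (hA3 : #A = 3)
    (hsid : ∀ x : G, x ≠ 0 → #(A ∩ (x +ᵥ A)) ≤ 1) {T : Finset G}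
    (hT : ∀ α ∈ A, ∀ β ∈ A, α - β ∈ T) : 7 ≤ #T := by
  classical
  obtain ⟨x, y, z, hxy, hxz, hyz, hA⟩ := card_eq_three.1 hA3
  have hx : x ∈ A := by rw [hA]; simp
  have hy : y ∈ A := by rw [hA]; simp
  have hz : z ∈ A := by rw [hA]; simp
  -- `D α` = the non-zero differences `α - β`, `β ∈ A`
  set D : G → Finset G := fun α => (A.image (α - ·)).erase 0 with hD
  have hDcard : ∀ α ∈ A, #(D α) = 2 := by
    intro α hα
    simp only [hD]
    rw [card_erase_of_mem (mem_image.2 ⟨α, hα, sub_self α⟩),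
      card_image_of_injective _ sub_right_injective, hA3]
  have hDdisj : ∀ α ∈ A, ∀ β ∈ A, α ≠ β → Disjoint (D α) (D β) := by
    intro α hα β hβ hαβ
    rw [disjoint_left]
    intro u hu hu'
    simp only [hD, mem_erase, mem_image] at hu hu'
    obtain ⟨hu0, γ, hγ, hγu⟩ := hu
    obtain ⟨-, γ', hγ', hγ'u⟩ := hu'
    have e : α - γ = β - γ' := hγu.trans hγ'u.symm
    have hαγ : α ≠ γ := fun h => hu0 (by rw [← hγu, h, sub_self])
    have h2 : ({α, γ} : Finset G) ⊆ A ∩ ((α - β) +ᵥ A) := by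
      intro v hv
      rw [mem_insert, mem_singleton] at hv
      rw [mem_inter]
      rcases hv with rfl | rfl
      · exact ⟨hα, mem_vadd_finset.2 ⟨β, hβ, by rw [vadd_eq_add, sub_add_cancel]⟩⟩
      · refine ⟨hγ, mem_vadd_finset.2 ⟨γ', hγ', ?_⟩⟩
        rw [vadd_eq_add]
        calc α - β + γ' = (α - v) - (β - γ') + v := by abel
          _ = v := by rw [e, sub_self, zero_add]
    have h3 := card_le_card h2
    rw [card_pair hαγ] at h3
    have h4 := hsid (α - β) (sub_ne_zero.2 hαβ)
    omega
  have h0D : ∀ α, (0 : G) ∉ D α := fun α => by simp [hD]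
  have hDT : ∀ α ∈ A, D α ⊆ T := by
    intro α hα u hu
    simp only [hD, mem_erase, mem_image] at hu
    obtain ⟨-, γ, hγ, rfl⟩ := hu
    exact hT α hα γ hγ
  have hsub : {0} ∪ D x ∪ D y ∪ D z ⊆ T :=
    union_subset (union_subset (union_subset
      (singleton_subset_iff.2 (by simpa using hT x hx x hx)) (hDT x hx)) (hDT y hy)) (hDT z hz)
  have h1 : Disjoint ({0} : Finset G) (D x) := disjoint_singleton_left.2 (h0D x)
  have h2 : Disjoint ({0} ∪ D x) (D y) :=
    disjoint_union_left.2 ⟨disjoint_singleton_left.2 (h0D y), hDdisj x hx y hy hxy⟩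
  have h3 : Disjoint ({0} ∪ D x ∪ D y) (D z) :=
    disjoint_union_left.2 ⟨disjoint_union_left.2 ⟨disjoint_singleton_left.2 (h0D z),
      hDdisj x hx z hz hxz⟩, hDdisj y hy z hz hyz⟩
  have := card_le_card hsub
  rw [card_union_of_disjoint h3, card_union_of_disjoint h2, card_union_of_disjoint h1,
    card_singleton, hDcard x hx, hDcard y hy, hDcard z hz] at this
  omega

/-! ### Transport to the subgroup generated by `A` -/

omit [Fintype G] in
/-- Pull-back of a finset `X ⊆ Q` to the subgroup `Q`, pushed forward again, is `X`. [folklore] -/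
private theorem image_subtype_filter_eq (Q : AddSubgroup G) [Fintype ↥Q] (X : Finset G)
    (hX : ∀ g ∈ X, g ∈ Q) :
    ((univ : Finset ↥Q).filter (fun x : ↥Q => (x : G) ∈ X)).image Q.subtype = X := by
  ext g
  simp only [mem_image, mem_filter, mem_univ, true_and, AddSubgroup.coe_subtype]
  constructor
  · rintro ⟨x, hx, rfl⟩; exact hx
  · intro hg; exact ⟨⟨g, hX g hg⟩, hg, rfl⟩

omit [Fintype G] in
/-- The pull-back preserves cardinality. [folklore] -/
private theorem card_filter_subtype_eq (Q : AddSubgroup G) [Fintype ↥Q] (X : Finset G)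
    (hX : ∀ g ∈ X, g ∈ Q) : #((univ : Finset ↥Q).filter (fun x : ↥Q => (x : G) ∈ X)) = #X := by
  conv_rhs => rw [← image_subtype_filter_eq Q X hX]
  rw [card_image_of_injective _ Q.subtype_injective]

omit [Fintype G] in
/-- The pull-back commutes with sums. [folklore] -/
private theorem filter_subtype_add (Q : AddSubgroup G) [Fintype ↥Q] (X Y : Finset G)
    (hX : ∀ g ∈ X, g ∈ Q) (hY : ∀ g ∈ Y, g ∈ Q) :
    (univ : Finset ↥Q).filter (fun x : ↥Q => (x : G) ∈ X + Y) =
      (univ : Finset ↥Q).filter (fun x : ↥Q => (x : G) ∈ X) +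
        (univ : Finset ↥Q).filter (fun x : ↥Q => (x : G) ∈ Y) := by
  have hXY : ∀ g ∈ X + Y, g ∈ Q := by
    intro g hg
    obtain ⟨x, hx, y, hy, rfl⟩ := mem_add.1 hg
    exact Q.add_mem (hX x hx) (hY y hy)
  apply image_injective Q.subtype_injective
  rw [image_add, image_subtype_filter_eq Q _ hXY, image_subtype_filter_eq Q _ hX,
    image_subtype_filter_eq Q _ hY]

omit [Fintype G] in
/-- The pull-back commutes with set difference. [folklore] -/
private theorem filter_subtype_sdiff (Q : AddSubgroup G) [Fintype ↥Q] (X Y : Finset G) :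
    (univ : Finset ↥Q).filter (fun x : ↥Q => (x : G) ∈ X \ Y) =
      (univ : Finset ↥Q).filter (fun x : ↥Q => (x : G) ∈ X) \
        (univ : Finset ↥Q).filter (fun x : ↥Q => (x : G) ∈ Y) := by
  ext x
  simp only [mem_filter, mem_univ, true_and, mem_sdiff]

omit [Fintype G] in
/-- The pull-back of a Sidon-like set is Sidon-like. [folklore] -/
private theorem sidonLike_filter_subtype (Q : AddSubgroup G) [Fintype ↥Q] {A : Finset G}
    (hsid : ∀ x : G, x ≠ 0 → #(A ∩ (x +ᵥ A)) ≤ 1) (x : ↥Q) (hx : x ≠ 0) :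
    #((univ : Finset ↥Q).filter (fun y : ↥Q => (y : G) ∈ A) ∩
      (x +ᵥ (univ : Finset ↥Q).filter (fun y : ↥Q => (y : G) ∈ A))) ≤ 1 := by
  have hx' : (x : G) ≠ 0 := fun h => hx (Subtype.ext h)
  refine le_trans ?_ (hsid (x : G) hx')
  rw [← card_image_of_injective _ Q.subtype_injective]
  refine card_le_card fun g hg => ?_
  simp only [mem_image, mem_inter, mem_filter, mem_univ, true_and, mem_vadd_finset,
    AddSubgroup.coe_subtype] at hg
  obtain ⟨y, ⟨hyA, z, hzA, rfl⟩, rfl⟩ := hg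
  rw [mem_inter]
  exact ⟨hyA, mem_vadd_finset.2 ⟨(z : G), hzA, by simp [vadd_eq_add]⟩⟩

/-- **Lemma 11 (|A| = 3) inside the subgroup `⟨A⟩`:** for a Sidon-like `3`-set `A ∋ 0` and a set
`P ⊆ ⟨A⟩` with `|P| ≥ 2` and `|P + A| ≤ |⟨A⟩| − 2`, `|P + A| ≥ |P| + 3` (the printed
`κ₂(A) = 2|A| − 3` computed in `⟨A⟩`, transported to the ambient group).
[cite: HamidouneSerraZemor2008, §2, Lemma 11; §5 (proof of Theorem 21: "we have
|S_i + A| − |S_i| ≥ 2|A| − 3 for i ∈ W")] -/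
theorem card_add_three_le_card_add_of_subset_closure {A P : Finset G} (h0A : (0 : G) ∈ A)
    (hA3 : #A = 3) (hsid : ∀ x : G, x ≠ 0 → #(A ∩ (x +ᵥ A)) ≤ 1)
    (hP : ∀ g ∈ P, g ∈ AddSubgroup.closure (A : Set G)) (hP2 : 2 ≤ #P)
    (hPA : #(P + A) + 2 ≤ Nat.card (AddSubgroup.closure (A : Set G))) :
    #P + 3 ≤ #(P + A) := by
  classical
  haveI : Fintype ↥(AddSubgroup.closure (A : Set G)) := Fintype.ofFinite _
  have hAQ : ∀ g ∈ A, g ∈ AddSubgroup.closure (A : Set G) :=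
    fun g hg => AddSubgroup.subset_closure hg
  have hPAQ : ∀ g ∈ P + A, g ∈ AddSubgroup.closure (A : Set G) := by
    intro g hg
    obtain ⟨x, hx, y, hy, rfl⟩ := mem_add.1 hg
    exact AddSubgroup.add_mem _ (hP x hx) (hAQ y hy)
  set Q := AddSubgroup.closure (A : Set G) with hQ
  set A' : Finset ↥Q := univ.filter (fun x : ↥Q => (x : G) ∈ A) with hA'
  set P' : Finset ↥Q := univ.filter (fun x : ↥Q => (x : G) ∈ P) with hP'
  have h0A' : (0 : ↥Q) ∈ A' := by rw [hA', mem_filter]; exact ⟨mem_univ _, h0A⟩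
  have hA3' : #A' = 3 := by rw [hA', card_filter_subtype_eq Q A hAQ, hA3]
  have hsid' : ∀ x : ↥Q, x ≠ 0 → #(A' ∩ (x +ᵥ A')) ≤ 1 := sidonLike_filter_subtype Q hsid
  have hgen' : AddSubgroup.closure (A' : Set ↥Q) = ⊤ := by
    have e : (A' : Set ↥Q) = Subtype.val ⁻¹' (A : Set G) := by
      ext x; simp [hA']
    rw [e]
    exact AddSubgroup.closure_closure_coe_preimage
  have hP2' : 2 ≤ #P' := by rw [hP', card_filter_subtype_eq Q P hP]; exact hP2
  have hcardQ : Fintype.card ↥Q = Nat.card ↥Q := (Nat.card_eq_fintype_card).symm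
  have hsum : P' + A' = univ.filter (fun x : ↥Q => (x : G) ∈ P + A) := by
    rw [hP', hA', filter_subtype_add Q P A hP hAQ]
  have hPA' : #(P' + A') + 2 ≤ Fintype.card ↥Q := by
    rw [hsum, card_filter_subtype_eq Q _ hPAQ, hcardQ]; exact hPA
  have := card_add_three_le_card_add_of_sidonLike h0A' hA3' hsid' hgen' hP2' hPA'
  rwa [hsum, card_filter_subtype_eq Q _ hPAQ, hP', card_filter_subtype_eq Q P hP] at this

/-- **The Fainting Lemma (|Y| = 3) inside the subgroup `⟨A⟩`:** for `A = {0, a, b}` and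
`0 ∈ P ⊆ ⟨A⟩` with `|P + A| = |P| + 3 + m`, `P + A = P + {a, b}` and the layer inclusion
`N₂(P, A) − A* ⊆ P + A`, one has `|⟨A⟩| ≤ |P| + (m+3)(m+4)/2` (`fainting_three` in `⟨A⟩`,
transported to the ambient group). [cite: HamidouneSerraZemor2008, §4, Lemma 19; §5 (proof of
Theorem 21: "the Fainting Lemma applied to S₁ and A")] -/
theorem fainting_three_of_subset_closure {A P : Finset G} {a b : G} (ha : a ≠ 0) (hb : b ≠ 0)
    (hAeq : A = {0, a, b}) (h0P : (0 : G) ∈ P)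
    (hP : ∀ g ∈ P, g ∈ AddSubgroup.closure (A : Set G)) {m : ℕ}
    (hm : #(P + A) = #P + 3 + m) (hii : P + A = P + A.erase 0)
    (hN : ∀ z ∈ (P + A + A) \ (P + A), ∀ h ∈ A.erase 0, z + -h ∈ P + A) :
    Nat.card (AddSubgroup.closure (A : Set G)) ≤ #P + (m + 3) * (m + 4) / 2 := by
  classical
  haveI : Fintype ↥(AddSubgroup.closure (A : Set G)) := Fintype.ofFinite _
  have hAQ : ∀ g ∈ A, g ∈ AddSubgroup.closure (A : Set G) :=
    fun g hg => AddSubgroup.subset_closure hg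
  have hAeQ : ∀ g ∈ A.erase 0, g ∈ AddSubgroup.closure (A : Set G) :=
    fun g hg => hAQ g (mem_of_mem_erase hg)
  have hPAQ : ∀ g ∈ P + A, g ∈ AddSubgroup.closure (A : Set G) := by
    intro g hg
    obtain ⟨x, hx, y, hy, rfl⟩ := mem_add.1 hg
    exact AddSubgroup.add_mem _ (hP x hx) (hAQ y hy)
  have hPAAQ : ∀ g ∈ P + A + A, g ∈ AddSubgroup.closure (A : Set G) := by
    intro g hg
    obtain ⟨x, hx, y, hy, rfl⟩ := mem_add.1 hg
    exact AddSubgroup.add_mem _ (hPAQ x hx) (hAQ y hy)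
  set Q := AddSubgroup.closure (A : Set G) with hQ
  have haQ : a ∈ Q := hAQ a (by rw [hAeq]; simp)
  have hbQ : b ∈ Q := hAQ b (by rw [hAeq]; simp)
  set a' : ↥Q := ⟨a, haQ⟩ with ha'
  set b' : ↥Q := ⟨b, hbQ⟩ with hb'
  have ha'0 : a' ≠ 0 := fun h => ha (by rw [Subtype.ext_iff] at h; exact h)
  have hb'0 : b' ≠ 0 := fun h => hb (by rw [Subtype.ext_iff] at h; exact h)
  set A' : Finset ↥Q := univ.filter (fun x : ↥Q => (x : G) ∈ A) with hA'
  set P' : Finset ↥Q := univ.filter (fun x : ↥Q => (x : G) ∈ P) with hP'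
  have hA'eq : A' = {0, a', b'} := by
    ext x
    simp only [hA', mem_filter, mem_univ, true_and, hAeq, mem_insert, mem_singleton,
      Subtype.ext_iff]
    rfl
  have hA'e : A'.erase 0 = univ.filter (fun x : ↥Q => (x : G) ∈ A.erase 0) := by
    ext x
    simp only [mem_erase, hA', mem_filter, mem_univ, true_and, ne_eq, Subtype.ext_iff]
    rfl
  have hgen' : AddSubgroup.closure (({0, a', b'} : Finset ↥Q) : Set ↥Q) = ⊤ := by
    rw [← hA'eq]
    have e : (A' : Set ↥Q) = Subtype.val ⁻¹' (A : Set G) := by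
      ext x; simp [hA']
    rw [e]
    exact AddSubgroup.closure_closure_coe_preimage
  have h0P' : (0 : ↥Q) ∈ P' := by rw [hP', mem_filter]; exact ⟨mem_univ _, h0P⟩
  have hcardQ : Fintype.card ↥Q = Nat.card ↥Q := (Nat.card_eq_fintype_card).symm
  have hsum : P' + A' = univ.filter (fun x : ↥Q => (x : G) ∈ P + A) := by
    rw [hP', hA', filter_subtype_add Q P A hP hAQ]
  have hsum2 : P' + A' + A' = univ.filter (fun x : ↥Q => (x : G) ∈ P + A + A) := by
    rw [hsum, hA', filter_subtype_add Q (P + A) A hPAQ hAQ]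
  have hm' : #(P' + {0, a', b'}) = #P' + 3 + m := by
    rw [← hA'eq, hsum, card_filter_subtype_eq Q _ hPAQ, hP', card_filter_subtype_eq Q P hP, hm]
  have hii' : P' + {0, a', b'} = P' + {a', b'} := by
    have e1 : ({a', b'} : Finset ↥Q) = A'.erase 0 := by
      rw [hA'eq, erase_insert_eq_erase, erase_eq_of_notMem]
      simp only [mem_insert, mem_singleton, not_or]
      exact ⟨ha'0.symm, hb'0.symm⟩
    rw [← hA'eq, e1, hsum, hii, hA'e, hP', filter_subtype_add Q P (A.erase 0) hP hAeQ]
  have hN' : ∀ z ∈ (P' + {0, a', b'} + {0, a', b'}) \ (P' + {0, a', b'}),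
      ∀ h ∈ ({0, a', b'} : Finset ↥Q).erase 0, z + -h ∈ P' + {0, a', b'} := by
    rw [← hA'eq, hsum2, hsum, ← filter_subtype_sdiff, hA'e]
    intro z hz h hh
    rw [mem_filter] at hz hh ⊢
    refine ⟨mem_univ _, ?_⟩
    have := hN (z : G) hz.2 (h : G) hh.2
    simpa using this
  have := fainting_three h0P' ha'0 hb'0 hgen' hm' hii' hN'
  rwa [hP', card_filter_subtype_eq Q P hP, hcardQ] at this

/-! ### Theorem 21 for `m = 0`: the last corner of the `2`-atom dichotomy -/

/-- **[HamidouneSerraZemor2008, Theorem 21] for `m = 0` = Hamidoune's Theorem 7.1 (Acta Arith.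
2000) = survey Theorem 24 with `μ = 0`, in EVERY finite abelian group:** if `0 ∈ S`,
`κ₂(S) = |S|` and `|S| ≤ |G| − 7`, then every `2`-atom `A ∋ 0` of `S` is (the underlying set of)
a subgroup or has exactly two elements.  Printed statements: Theorem 21: "Let `G` be a finite
abelian group and let `0 ∈ S` be a generating `2`-separable subset of `G` such that `|S| ≥ 3`
and `κ₂(S) − |S| = m ≤ 4`.  Let `A` be a `2`-atom of `S` containing `0`.  If
`|S| < |G| − C(m+4, 2)` then either `|A| = 2` or `A` is a subgroup of `G`."; Theorem 7.1: "Let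
`B` be a subset of a finite abelian group such that `0 ∈ B`, and `|B| ≤ |G| − 7` … Let `H` be a
`2`-atom … such that `0 ∈ H`.  If `κ₂(B) = |B|`, then either `H` is a subgroup or `|H| = 2`."
Proof as printed in [HamidouneSerraZemor2008] for `m = 0` (where `|A| ≤ 3` by Corollary 12 /
`IsAtom.card_eq_two_or_three_of_conn_le`, so only `|A| = 3` is at stake): if `A` generates `G`,
the Fainting Lemma — here `IsAtom.card_eq_two_of_closure_eq_top` (survey Theorem 24, Case 1);
otherwise `A` generates a proper `Q`, `S = ⊔ S_c` modulo `Q`, `|S + A| = Σ |S_c + A| = |S| + 3`,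
`|S_c| ≥ 2` (Lemma 4), cosets with `δ(c) = |Q| − |S_c + A| ≥ 2` have `|S_c + A| − |S_c| ≥ 3`
(Lemma 11 in `Q`), cosets with `δ(c) ≥ 1` have `|S_c + A| > |S_c|` (a piece stable under `A` is a
whole coset), so a single coset `c₀` carries `δ(c₀) = Σ δ ≥ 4` (Case 1 `S + Q ≠ G`:
`Σ δ = |S + Q| − |S + A| ≥ |Q| − 3 ≥ 4` as `Q` is `2`-admissible and `|Q| ≥ 7`; Case 2
`S + Q = G`: `Σ δ = |G| − |S| − 3 ≥ 4`) and `|S_{c₀} + A| = |S_{c₀}| + 3`; in Case 1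
`|S_{c₀} + A| ≤ 3` is absurd, in Case 2 the Fainting Lemma in `Q` gives `|Q| ≤ |S_{c₀}| + 6 <
|S_{c₀}| + 3 + δ(c₀) = |Q|`.  The hypotheses "`S` generating" and "`|S| ≥ 3`" of Theorem 21 are not
needed for `m = 0` (as in Theorem 7.1). [cite: HamidouneSerraZemor2008, §5, Theorem 21 (case
m = 0)] [cite: Hamidoune2000, §7, Theorem 7.1] [cite: Hamidoune2008, §8, Theorem 24 (μ = 0)] -/
theorem IsAtom.exists_addSubgroup_or_card_eq_two_of_conn_eq {S : Finset G} (h0 : (0 : G) ∈ S)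
    (hS7 : #S + 7 ≤ Fintype.card G) (hκ : conn 2 S = #S) {A : Finset G} (hA : IsAtom 2 S A)
    (h0A : (0 : G) ∈ A) : (∃ K : AddSubgroup G, (K : Set G) = A) ∨ #A = 2 := by
  classical
  by_contra hcon
  rw [not_or, not_exists] at hcon
  obtain ⟨hnot, hA2⟩ := hcon
  have hAa := hA.1.1
  unfold IsAdm at hAa
  have hAf := hA.1.2
  -- `|A| = 3`
  have hA3 : #A = 3 := by
    rcases hA.card_eq_two_or_three_of_conn_le h0 hκ.le h0A hnot with h | ⟨h, -⟩
    · exact absurd h hA2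
    · exact h
  have hASc : #(A + S) = #S + 3 := by
    have := card_le_card_add h0 A
    omega
  -- `|S| ≥ 2`
  have hS2 : 2 ≤ #S := by
    by_contra hS1
    have hS : S = {0} := by
      apply eq_of_subset_of_card_le (singleton_subset_iff.2 h0) (by rw [card_singleton]; omega)
        |>.symm
    have : #(A + S) = #A := by rw [hS, singleton_zero, add_zero]
    have := card_pos.2 ⟨0, h0⟩
    omega
  -- `A` does not generate `G` (Case 1 of the survey, done in `IsoperimetricMethod`)
  have hQtop : AddSubgroup.closure (A : Set G) ≠ ⊤ := by
    intro htop
    exact hA2 (hA.card_eq_two_of_closure_eq_top h0 hS2 hκ.le (fun _ => by omega) h0A htop)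
  -- `A = {0, a, b}` is Sidon-like, `A + S = A* + S`, layer inclusion
  have hsid : ∀ x : G, x ≠ 0 → #(A ∩ (x +ᵥ A)) ≤ 1 := fun x hx =>
    hA.card_inter_vadd_le_one_of_forall_ne h0 h0A hnot hx
  obtain ⟨a, b, ha, hb, hAeq⟩ : ∃ a b : G, a ≠ 0 ∧ b ≠ 0 ∧ A = {0, a, b} := by
    obtain ⟨x, y, z, hxy, hxz, hyz, hxyz⟩ := card_eq_three.1 hA3
    have h0A' := h0A
    rw [hxyz, mem_insert, mem_insert, mem_singleton] at h0A'
    rcases h0A' with h | h | h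
    · exact ⟨y, z, fun e => hxy (h.symm.trans e.symm), fun e => hxz (h.symm.trans e.symm),
        by rw [hxyz, h]⟩
    · refine ⟨x, z, fun e => hxy (e.trans h), fun e => hyz (h.symm.trans e.symm), ?_⟩
      rw [hxyz, ← h]
      exact insert_comm _ _ _
    · refine ⟨x, y, fun e => hxz (e.trans h), fun e => hyz (e.trans h), ?_⟩
      rw [hxyz, ← h]
      ext v; simp only [mem_insert, mem_singleton]; tauto
  have hAe : A.erase 0 = {a, b} := by
    rw [hAeq, erase_insert_eq_erase, erase_eq_of_notMem]
    simp only [mem_insert, mem_singleton, not_or]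
    exact ⟨ha.symm, hb.symm⟩
  set Q := AddSubgroup.closure (A : Set G) with hQ
  have hAQ : (A : Set G) ⊆ Q := AddSubgroup.subset_closure
  have hAQ' : ∀ g ∈ A, g ∈ Q := fun g hg => hAQ hg
  have hAeQ : ((A.erase 0 : Finset G) : Set G) ⊆ Q := fun g hg =>
    hAQ (mem_coe.2 (mem_of_mem_erase (mem_coe.1 hg)))
  have hSA : S + A = S + A.erase 0 := by
    rw [add_comm S A, add_comm S, hA.add_eq_erase_zero_add h0 hA3.ge h0A]
  have hN1 : ∀ z ∈ (A + S + A) \ (A + S), ∀ h ∈ A.erase 0, z + -h ∈ (A + S) \ S :=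
    fun z hz h hh => hA.add_neg_mem_sdiff_of_mem_sdiff h0 h0A hz hh
  -- the finset `Qf` of `Q`, `|Qf| = |Q| ≥ 7`
  haveI : Fintype ↥Q := Fintype.ofFinite _
  set Qf : Finset G := (univ : Finset ↥Q).image (fun x : ↥Q => (x : G)) with hQfdef
  have hQf : ∀ g, g ∈ Qf ↔ g ∈ Q := fun g => by
    rw [hQfdef, mem_image]
    constructor
    · rintro ⟨x, -, rfl⟩; exact x.2
    · intro hg; exact ⟨⟨g, hg⟩, mem_univ _, rfl⟩
  have hQfcard : #Qf = Nat.card ↥Q := by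
    rw [hQfdef, card_image_of_injective _ Subtype.val_injective, card_univ,
      Nat.card_eq_fintype_card]
  have hq7 : 7 ≤ #Qf := seven_le_card_of_forall_sub_mem hA3 hsid
    (fun α hα β hβ => (hQf _).2 (Q.sub_mem (hAQ' α hα) (hAQ' β hβ)))
  -- decomposition of `S` modulo `Q`
  set I : Finset (G ⧸ Q) := S.image (fun s : G => (s : G ⧸ Q)) with hI
  set pc : G ⧸ Q → Finset G := fun c => S.filter (fun s : G => (s : G ⧸ Q) = c) with hpc
  have hpc_ne : ∀ c ∈ I, ∃ s₀ ∈ S, (s₀ : G ⧸ Q) = c ∧ s₀ ∈ pc c := by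
    intro c hc
    obtain ⟨s₀, hs₀, rfl⟩ := mem_image.1 hc
    exact ⟨s₀, hs₀, rfl, mem_filter.2 ⟨hs₀, rfl⟩⟩
  have hpcS : ∀ c, pc c ⊆ S := fun c => filter_subset _ _
  have hsumA : #(S + A) = ∑ c ∈ I, #(pc c + A) := card_add_eq_sum_card_filter_add Q S A hAQ
  have hsumS : #S = ∑ c ∈ I, #(pc c) :=
    card_eq_sum_card_fiberwise fun s hs => mem_image_of_mem _ hs
  have hpc_le : ∀ c, #(pc c) ≤ #(pc c + A) := fun c => card_le_card_add h0A _
  have hle_q : ∀ c ∈ I, #(pc c + A) ≤ #Qf := by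
    intro c hc
    obtain ⟨s₀, -, hs₀, -⟩ := hpc_ne c hc
    have := card_le_card (filter_add_subset_vadd Q Qf hQf S A hAQ hs₀)
    rwa [card_vadd_finset] at this
  have hSQ : #(S + Qf) = #I * #Qf := card_add_eq_card_image_mul Q Qf hQf S
  have hSA3 : #(S + A) = #S + 3 := by rw [add_comm]; exact hASc
  -- the excess `f c = |S_c + A| − |S_c|` sums to `3`, the defect `δ c = |Q| − |S_c + A|`
  have hsum_f : ∑ c ∈ I, (#(pc c + A) - #(pc c)) = 3 := by
    have e : ∑ c ∈ I, #(pc c + A) = ∑ c ∈ I, #(pc c) + ∑ c ∈ I, (#(pc c + A) - #(pc c)) := by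
      rw [← sum_add_distrib]
      exact sum_congr rfl fun c _ => by have := hpc_le c; omega
    omega
  have hsum_δ : ∑ c ∈ I, (#Qf - #(pc c + A)) + #(S + A) = #(S + Qf) := by
    rw [hSQ, hsumA]
    have e : ∑ c ∈ I, (#Qf - #(pc c + A)) + ∑ c ∈ I, #(pc c + A) = ∑ c ∈ I, #Qf := by
      rw [← sum_add_distrib]
      exact sum_congr rfl fun c hc => by have := hle_q c hc; omega
    rw [e, sum_const, smul_eq_mul]
  -- `|S_c| ≥ 2` (Lemma 4 coset-wise)
  have hpc2 : ∀ c ∈ I, 2 ≤ #(pc c) := by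
    intro c hc
    obtain ⟨s₀, hs₀S, hs₀, hs₀pc⟩ := hpc_ne c hc
    by_contra hlt
    have h1 : #(pc c) = 1 := by
      have := card_pos.2 ⟨s₀, hs₀pc⟩; omega
    obtain ⟨s, hs⟩ := card_eq_one.1 h1
    have e1 : pc c + A = pc c + A.erase 0 := by
      rw [hpc]
      rw [← filter_add_eq_filter_add Q S A hAQ c, ← filter_add_eq_filter_add Q S (A.erase 0) hAeQ c,
        hSA]
    rw [hs, hAe, hAeq] at e1
    have : s ∈ ({s} : Finset G) + ({0, a, b} : Finset G) :=
      mem_add.2 ⟨s, mem_singleton_self s, 0, by simp, add_zero s⟩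
    rw [e1, singleton_add, mem_vadd_finset] at this
    obtain ⟨y, hy, hsy⟩ := this
    rw [mem_insert, mem_singleton] at hy
    rw [vadd_eq_add] at hsy
    rcases hy with rfl | rfl
    · exact ha (add_eq_left.1 hsy)
    · exact hb (add_eq_left.1 hsy)
  -- a piece with zero excess is a whole coset (zero defect)
  have hfull : ∀ c ∈ I, #(pc c + A) - #(pc c) = 0 → #Qf - #(pc c + A) = 0 := by
    intro c hc hf
    obtain ⟨s₀, hs₀S, hs₀, hs₀pc⟩ := hpc_ne c hc
    have hsub := filter_add_subset_vadd Q Qf hQf S A hAQ hs₀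
    have heq : pc c + A = pc c :=
      (eq_of_subset_of_card_le (subset_add_left _ h0A) (by have := hpc_le c; omega)).symm
    have hP : pc c ⊆ s₀ +ᵥ Qf := (subset_add_left _ h0A).trans hsub
    have := card_eq_of_add_eq_of_closure_eq Q Qf hQf rfl hs₀pc hP heq
    rw [heq, this]; simp
  -- W-bound (Lemma 11 in `Q`) for a piece
  have hW : ∀ c ∈ I, #(pc c + A) + 2 ≤ #Qf → #(pc c) + 3 ≤ #(pc c + A) := by
    intro c hc hδ
    obtain ⟨s₀, hs₀S, hs₀, hs₀pc⟩ := hpc_ne c hc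
    set P := -s₀ +ᵥ pc c with hP
    have hPQ : ∀ g ∈ P, g ∈ Q := by
      intro g hg
      obtain ⟨s, hs, rfl⟩ := mem_vadd_finset.1 hg
      rw [hpc, mem_filter] at hs
      exact QuotientAddGroup.eq.1 (hs₀.trans hs.2.symm)
    have hPA : P + A = -s₀ +ᵥ (pc c + A) := by
      rw [hP, ← singleton_add, ← singleton_add, add_assoc]
    have hPc : #P = #(pc c) := card_vadd_finset _ _
    have hPAc : #(P + A) = #(pc c + A) := by rw [hPA, card_vadd_finset]
    have := card_add_three_le_card_add_of_subset_closure h0A hA3 hsid hPQ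
      (by rw [hPc]; exact hpc2 c hc) (by rw [hPAc, ← hQfcard]; exact hδ)
    rwa [hPc, hPAc] at this
  -- Σ δ ≥ 4 in both cases, and the admissibility consequence in Case 1
  have hδ4 : 4 ≤ ∑ c ∈ I, (#Qf - #(pc c + A)) ∧
      (S + Qf ≠ univ → #Qf ≤ ∑ c ∈ I, (#Qf - #(pc c + A)) + 3) := by
    by_cases huniv : S + Qf = univ
    · refine ⟨?_, fun h => absurd huniv h⟩
      rw [huniv, card_univ] at hsum_δ
      omega
    · have hle := card_add_add_card_le_of_ne_univ Q Qf hQf S huniv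
      have hadm : IsAdm 2 S Qf := ⟨by omega, by rw [add_comm Qf S]; omega⟩
      have hκQ := conn_le hadm
      rw [add_comm Qf S] at hκQ
      have := card_le_card_add h0 Qf
      rw [add_comm Qf S] at this
      exact ⟨by omega, fun _ => by omega⟩
  obtain ⟨hδ4', hcase1⟩ := hδ4
  -- some coset has defect `≥ 2`
  obtain ⟨c₀, hc₀I, hc₀⟩ : ∃ c₀ ∈ I, 2 ≤ #Qf - #(pc c₀ + A) := by
    by_contra hno
    push Not at hno
    have : ∑ c ∈ I, (#Qf - #(pc c + A)) ≤ ∑ c ∈ I, (#(pc c + A) - #(pc c)) := by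
      apply sum_le_sum
      intro c hc
      have h1 := hno c hc
      by_cases hz : #(pc c + A) - #(pc c) = 0
      · rw [hfull c hc hz, hz]
      · omega
    omega
  -- its excess is `≥ 3`, hence `= 3`, all other excesses vanish, all other defects vanish
  have hW₀ := hW c₀ hc₀I (by have := hle_q c₀ hc₀I; omega)
  have hothers : ∀ c ∈ I, c ≠ c₀ → #(pc c + A) - #(pc c) = 0 := by
    intro c hc hcc
    have hsplit := add_sum_erase I (fun c => #(pc c + A) - #(pc c)) hc₀I
    have hsplit2 := add_sum_erase (I.erase c₀) (fun c => #(pc c + A) - #(pc c))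
      (mem_erase.2 ⟨hcc, hc⟩)
    have := hpc_le c₀
    omega
  have hf₀ : #(pc c₀ + A) = #(pc c₀) + 3 := by
    have hsplit := add_sum_erase I (fun c => #(pc c + A) - #(pc c)) hc₀I
    have hz : ∑ c ∈ I.erase c₀, (#(pc c + A) - #(pc c)) = 0 :=
      sum_eq_zero fun c hc => hothers c (mem_of_mem_erase hc) (ne_of_mem_erase hc)
    have := hpc_le c₀
    omega
  have hδ₀ : ∑ c ∈ I, (#Qf - #(pc c + A)) = #Qf - #(pc c₀ + A) := by
    rw [← add_sum_erase I _ hc₀I, sum_eq_zero fun c hc =>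
      hfull c (mem_of_mem_erase hc) (hothers c (mem_of_mem_erase hc) (ne_of_mem_erase hc)),
      add_zero]
  have hq₀ := hle_q c₀ hc₀I
  have hpc₀2 := hpc2 c₀ hc₀I
  by_cases huniv : S + Qf = univ
  · -- Case 2: the Fainting Lemma in `Q` for the piece `S_{c₀}`
    have h4 : 4 ≤ #Qf - #(pc c₀ + A) := by rw [← hδ₀]; exact hδ4'
    obtain ⟨s₀, hs₀S, hs₀, hs₀pc⟩ := hpc_ne c₀ hc₀I
    set P := -s₀ +ᵥ pc c₀ with hP
    have hPQ : ∀ g ∈ P, g ∈ Q := by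
      intro g hg
      obtain ⟨s, hs, rfl⟩ := mem_vadd_finset.1 hg
      rw [hpc, mem_filter] at hs
      exact QuotientAddGroup.eq.1 (hs₀.trans hs.2.symm)
    have h0P : (0 : G) ∈ P := mem_vadd_finset.2 ⟨s₀, hs₀pc, by rw [vadd_eq_add, neg_add_cancel]⟩
    have hPA : P + A = -s₀ +ᵥ (pc c₀ + A) := by
      rw [hP, ← singleton_add, ← singleton_add, add_assoc]
    have hPAe : P + A.erase 0 = -s₀ +ᵥ (pc c₀ + A.erase 0) := by
      rw [hP, ← singleton_add, ← singleton_add, add_assoc]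
    have hPAA : P + A + A = -s₀ +ᵥ (pc c₀ + A + A) := by
      rw [hPA, ← singleton_add, ← singleton_add, add_assoc]
    have hPc : #P = #(pc c₀) := card_vadd_finset _ _
    have hPAc : #(P + A) = #(pc c₀ + A) := by rw [hPA, card_vadd_finset]
    have hpcA : pc c₀ + A = (S + A).filter (fun x : G => (x : G ⧸ Q) = c₀) := by
      rw [hpc, filter_add_eq_filter_add Q S A hAQ c₀]
    have hii : P + A = P + A.erase 0 := by
      rw [hPA, hPAe, hpcA, hSA, ← filter_add_eq_filter_add Q S (A.erase 0) hAeQ c₀]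
    have hN : ∀ z ∈ (P + A + A) \ (P + A), ∀ h ∈ A.erase 0, z + -h ∈ P + A := by
      intro z hz h hh
      rw [hPAA, hPA, ← vadd_finset_sdiff, mem_vadd_finset] at hz
      obtain ⟨w, hw, rfl⟩ := hz
      rw [mem_sdiff] at hw
      have hhQ : h ∈ Q := hAeQ hh
      -- `w ∈ (A + S + A) ∖ (A + S)`: it lies in the coset `c₀`
      have hwQ : (w : G ⧸ Q) = c₀ := by
        obtain ⟨u, hu, α, hα, rfl⟩ := mem_add.1 hw.1
        rw [hpcA, mem_filter] at hu
        rw [QuotientAddGroup.mk_add, (QuotientAddGroup.eq_zero_iff α).2 (hAQ' α hα), add_zero]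
        exact hu.2
      have hw' : w ∈ (A + S + A) \ (A + S) := by
        rw [mem_sdiff]
        refine ⟨?_, fun hwAS => hw.2 ?_⟩
        · have : pc c₀ + A + A ⊆ A + S + A := by
            rw [add_comm A S]
            exact add_subset_add_right (add_subset_add_right (hpcS c₀))
          exact this hw.1
        · rw [hpcA, mem_filter]
          exact ⟨by rwa [add_comm] at hwAS, hwQ⟩
      have h1 := hN1 w hw' h hh
      rw [mem_sdiff] at h1
      have h2 : w + -h ∈ pc c₀ + A := by
        rw [hpcA, mem_filter]
        refine ⟨by rw [add_comm S A]; exact h1.1, ?_⟩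
        rw [QuotientAddGroup.mk_add, QuotientAddGroup.mk_neg,
          (QuotientAddGroup.eq_zero_iff h).2 hhQ, neg_zero, add_zero, hwQ]
      rw [hPA]
      exact mem_vadd_finset.2 ⟨w + -h, h2, by rw [vadd_eq_add, vadd_eq_add]; abel⟩
    have hm : #(P + A) = #P + 3 + 0 := by rw [hPAc, hPc, hf₀]
    have := fainting_three_of_subset_closure ha hb hAeq h0P hPQ hm hii hN
    rw [hPc, ← hQfcard] at this
    omega
  · -- Case 1: `|S_{c₀} + A| ≤ 3`
    have := hcase1 huniv
    rw [hδ₀] at this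
    omega

/-- **The `2`-atom dichotomy for defect `μ ≤ 0` in every finite abelian group (survey
Theorem 24, all cases):** if `0 ∈ S`, `κ₂(S) ≤ |S|`, and `|S| ≤ |G| − 7` in case `κ₂(S) = |S|`,
then every `2`-atom `A ∋ 0` of `S` is (the underlying set of) a subgroup or has exactly two
elements — Corollary 6.3 of Hamidoune 2000 (`IsAtom.exists_addSubgroup_or_card_eq_two`) for
`κ₂(S) < |S|` and Theorem 21 (`m = 0`) / Theorem 7.1
(`IsAtom.exists_addSubgroup_or_card_eq_two_of_conn_eq`) for `κ₂(S) = |S|`.  The survey states it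
for `S` generating; that hypothesis is not needed. [cite: Hamidoune2008, §8, Theorem 24]
[cite: Hamidoune2000, §6 Corollary 6.3, §7 Theorem 7.1] [cite: HamidouneSerraZemor2008, §5,
Theorem 21] -/
theorem IsAtom.exists_addSubgroup_or_card_eq_two_of_conn_le' {S : Finset G} (h0 : (0 : G) ∈ S)
    (hμ : conn 2 S ≤ #S) (hS7 : conn 2 S = #S → #S + 7 ≤ Fintype.card G) {A : Finset G}
    (hA : IsAtom 2 S A) (h0A : (0 : G) ∈ A) : (∃ K : AddSubgroup G, (K : Set G) = A) ∨ #A = 2 := by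
  rcases Nat.lt_or_ge (conn 2 S) #S with hlt | hge
  · exact hA.exists_addSubgroup_or_card_eq_two h0 h0A (by omega)
  · have heq : conn 2 S = #S := le_antisymm hμ hge
    exact hA.exists_addSubgroup_or_card_eq_two_of_conn_eq h0 (hS7 heq) heq h0A

/-! ### Pair forms: one below / one at the Cauchy–Davenport count in a finite abelian group -/

omit [Fintype G] in
/-- Translating `B` does not change `|A + B|`. [folklore] -/
private theorem card_add_vadd (A B : Finset G) (c : G) : #(A + (c +ᵥ B)) = #(A + B) := by
  rw [← singleton_add, add_left_comm, singleton_add, card_vadd_finset]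

/-- **Pairs one below the Cauchy–Davenport count, composite order (Hamidoune 2000 Theorem 6.6 in
pair form):** if `A, B ⊆ G` (finite abelian), `|A| ≥ 2`, `|B| ≥ 1`, `2|B| ≤ |G|`,
`|A + B| ≤ |A| + |B| − 1` and `|A + B| ≤ |G| − 2`, then `B` is an arithmetic progression with a
non-zero difference, or some subgroup `K` (with its finset `Kf`, `|Kf| ≥ 2`) has
`|Kf + B| ≤ |G| − 2` and `|Kf + B| ≤ |Kf| + |B| − 1`.  (Theorem 6.6 applied to `B − b₀ ∋ 0`, whose
alternative (i) is refuted by `A`; everything is translation invariant.)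
[cite: Hamidoune2000, §6, Theorem 6.6] -/
theorem exists_isAP_or_exists_addSubgroup_of_card_add_lt {A B : Finset G} (hB : B.Nonempty)
    (hBn : 2 * #B ≤ Fintype.card G) (hA2 : 2 ≤ #A) (hAB : #(A + B) + 1 ≤ #A + #B)
    (hABn : #(A + B) + 2 ≤ Fintype.card G) :
    (∃ d : G, d ≠ 0 ∧ IsAP B d) ∨
    (∃ K : AddSubgroup G, ∃ Kf : Finset G, (K : Set G) = Kf ∧ 2 ≤ #Kf ∧
        #(Kf + B) + 2 ≤ Fintype.card G ∧ #(Kf + B) + 1 ≤ #Kf + #B) := by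
  classical
  obtain ⟨b₀, hb₀⟩ := hB
  set B' := -b₀ +ᵥ B with hB'
  have h0 : (0 : G) ∈ B' := mem_vadd_finset.2 ⟨b₀, hb₀, by rw [vadd_eq_add, neg_add_cancel]⟩
  have hcB : #B' = #B := card_vadd_finset _ _
  rcases forall_min_le_card_add_or_isAP_or_exists_addSubgroup h0 (by rw [hcB]; exact hBn) with
    hall | ⟨d, hd, hAP⟩ | ⟨K, Kf, hK, hK2, hKn, hKB⟩
  · have h1 := hall A hA2
    rw [hB', card_add_vadd, hcB] at h1
    exfalso
    rcases Nat.lt_or_ge (#A + #B) (Fintype.card G - 1) with h | h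
    · rw [min_eq_right h.le] at h1; omega
    · rw [min_eq_left h] at h1; omega
  · exact Or.inl ⟨d, hd, (isAP_vadd_iff (-b₀)).1 hAP⟩
  · refine Or.inr ⟨K, Kf, hK, hK2, ?_, ?_⟩
    · rwa [hB', card_add_vadd] at hKn
    · rwa [hB', card_add_vadd, hcB] at hKB

/-- **Pairs at the Cauchy–Davenport count, composite order (the `2`-atom dichotomy in pair
form):** if `A, B ⊆ G` (finite abelian), `|A| ≥ 2`, `|B| ≥ 1`, `|A + B| ≤ |A| + |B|`,
`|A + B| ≤ |G| − 2` and `|B| ≤ |G| − 7`, then EITHER some subgroup `K` (with its finset `H`,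
`|H| ≥ 2`) has `|H + B| ≤ |H| + |B|` and `|H + B| ≤ |G| − 2` (so `B` nearly fills few `K`-cosets),
OR some `d ≠ 0` has `|(d + B) ∖ B| ≤ 2`, i.e. (Lemma 6.1, `eq_filter_union_biUnion_apFinset`) `B`
is its `⟨d⟩`-periodic part plus at most two `d`-progressions.  (Translate `0` into `B`;
`κ₂(B) ≤ |A + B| − |A| ≤ |B|`; a `2`-atom `H ∋ 0` is a subgroup or a pair `{0, d}` by
`IsAtom.exists_addSubgroup_or_card_eq_two_of_conn_le'`, and a pair atom has
`|(d + B) ∖ B| + |B| = κ₂(B) + 2` by `IsAtom.exists_eq_pair_of_card_eq_two`.)  This is the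
composite-order counterpart of `exists_card_vadd_sdiff_le_two_of_card_add_eq` (`ℤ/pℤ`).
[cite: HamidouneSerraZemor2008, §5, Theorem 21 (m = 0)] [cite: Hamidoune2000, §6 Corollary 6.3,
§7 Theorem 7.1] [cite: Hamidoune2008, §8, Theorem 24] -/
theorem exists_addSubgroup_or_exists_card_vadd_sdiff_le_two {A B : Finset G} (hB : B.Nonempty)
    (hA2 : 2 ≤ #A) (hAB : #(A + B) ≤ #A + #B) (hABn : #(A + B) + 2 ≤ Fintype.card G)
    (hB7 : #B + 7 ≤ Fintype.card G) :
    (∃ K : AddSubgroup G, ∃ H : Finset G, (K : Set G) = H ∧ 2 ≤ #H ∧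
        #(H + B) + 2 ≤ Fintype.card G ∧ #(H + B) ≤ #H + #B) ∨
    (∃ d : G, d ≠ 0 ∧ #((d +ᵥ B) \ B) ≤ 2) := by
  classical
  obtain ⟨b₀, hb₀⟩ := hB
  set B' := -b₀ +ᵥ B with hB'
  have h0 : (0 : G) ∈ B' := mem_vadd_finset.2 ⟨b₀, hb₀, by rw [vadd_eq_add, neg_add_cancel]⟩
  have hcB : #B' = #B := card_vadd_finset _ _
  have hAB' : #(A + B') = #(A + B) := by rw [hB', card_add_vadd]
  have hadm : IsAdm 2 B' A := ⟨hA2, by rw [hAB']; exact hABn⟩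
  have hκ : conn 2 B' ≤ #B' := by
    have := conn_le hadm
    have := card_le_card_add h0 A
    omega
  obtain ⟨H₀, hH₀⟩ := exists_isAtom ⟨A, hadm⟩
  have hH₀a := hH₀.1.1
  unfold IsAdm at hH₀a
  obtain ⟨h₀, hh₀⟩ : H₀.Nonempty := card_pos.1 (by omega)
  obtain ⟨H, hH, h0H⟩ : ∃ H : Finset G, IsAtom 2 B' H ∧ (0 : G) ∈ H :=
    ⟨-h₀ +ᵥ H₀, hH₀.vadd (-h₀), mem_vadd_finset.2 ⟨h₀, hh₀, by rw [vadd_eq_add, neg_add_cancel]⟩⟩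
  have hHa := hH.1.1
  unfold IsAdm at hHa
  have hHf := hH.1.2
  rcases hH.exists_addSubgroup_or_card_eq_two_of_conn_le' h0 hκ (fun _ => by rw [hcB]; exact hB7)
    h0H with ⟨K, hK⟩ | hH2
  · refine Or.inl ⟨K, H, hK, hHa.1, ?_, ?_⟩
    · have := hHa.2
      rwa [hB', card_add_vadd] at this
    · have h1 := card_le_card_add h0 H
      have h2 : #(H + B') = #(H + B) := by rw [hB', card_add_vadd]
      omega
  · obtain ⟨d, hd, -, hcount⟩ := hH.exists_eq_pair_of_card_eq_two h0 h0H hH2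
    refine Or.inr ⟨d, hd, ?_⟩
    have e : (d +ᵥ B') \ B' = -b₀ +ᵥ ((d +ᵥ B) \ B) := by
      rw [hB', vadd_finset_sdiff, vadd_vadd, vadd_vadd, add_comm]
    rw [e, card_vadd_finset] at hcount
    omega

/-! ### Lemma 10: `κ₁ = |S| − 1` for generating weakly-Sidon sets -/

/-- **[HamidouneSerraZemor2008, Lemma 10]:** "Let `0 ∈ S` be a generating set of a finite abelian
group `G` of cardinality `|S| ≥ 3`.  Assume that `|(S + g) ∩ S| ≤ 2` for all `g ∈ G ∖ {0}`.  Then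
`κ₁(S) = |S| − 1`.  In particular `κ₁(X) = |X| − 1` if `X` is a Sidon set containing `0`." — in the
lower-bound form `|X + S| ≥ |X| + |S| − 1` for every nonempty `X` with `|X + S| ≤ |G| − 1` (the
upper bound `κ₁(S) ≤ |S| − 1` is witnessed by `X = {0}`).  Proof as printed: otherwise a `1`-atom
`A ∋ 0` is a non-null subgroup with `κ₁(S)` at least `|A|` (here: `S ⊄ A` gives a second
`A`-coset inside `S + A`), and for `a ∈ A ∖ 0`, `|S| + |A| − 2 ≥ |S + A| ≥ |S ∪ (S + a)| ≥ 2|S| − 2`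
forces `|S| ≤ |A| ≤ κ₁(S)`. [cite: HamidouneSerraZemor2008, §2, Lemma 10] -/
theorem card_add_card_le_card_add_succ_of_weakSidon {S : Finset G} (h0 : (0 : G) ∈ S)
    (hS3 : 3 ≤ #S) (hsid2 : ∀ g : G, g ≠ 0 → #(S ∩ (g +ᵥ S)) ≤ 2)
    (hgen : AddSubgroup.closure (S : Set G) = ⊤) {X : Finset G} (hX : X.Nonempty)
    (hXS : #(X + S) + 1 ≤ Fintype.card G) : #X + #S ≤ #(X + S) + 1 := by
  classical
  by_contra hlt
  push Not at hlt
  have hadm : IsAdm 1 S X := ⟨hX.card_pos, hXS⟩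
  have hκ : conn 1 S + 2 ≤ #S := by
    have := conn_le hadm
    have := card_le_card_add h0 X
    omega
  obtain ⟨A, hA, h0A, K, hK⟩ := exists_addSubgroup_isAtom_one h0 ⟨X, hadm⟩
  have hAa := hA.1.1
  unfold IsAdm at hAa
  have hAf := hA.1.2
  have hSA := card_le_card_add h0 A
  -- `S ⊄ A`, hence `κ₁(S) ≥ |A|`
  have hSnot : ¬ S ⊆ A := by
    intro hSA'
    have hKtop : K = ⊤ := by
      rw [eq_top_iff, ← hgen, AddSubgroup.closure_le, hK]
      exact_mod_cast hSA'
    have hAu : A = univ := by rw [← coe_eq_univ, ← hK, hKtop]; rfl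
    have : #(A + S) = Fintype.card G :=
      le_antisymm (card_le_univ _) (by rw [← card_univ, ← hAu]; exact hSA)
    omega
  obtain ⟨s, hsS, hsA⟩ := not_subset.1 hSnot
  have hdisj : Disjoint A (s +ᵥ A) := by
    rw [disjoint_left]
    rintro y hyA hys
    obtain ⟨z, hz, rfl⟩ := mem_vadd_finset.1 hys
    apply hsA
    have hzK : z ∈ K := by rw [← SetLike.mem_coe, hK]; exact hz
    have hyK : s + z ∈ K := by rw [← SetLike.mem_coe, hK]; exact hyA
    have e : s = (s + z) - z := by abel
    rw [← mem_coe, ← hK, SetLike.mem_coe, e]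
    exact K.sub_mem hyK hzK
  have hsub : A ∪ (s +ᵥ A) ⊆ A + S := by
    refine union_subset (subset_add_left _ h0) fun y hy => ?_
    obtain ⟨z, hz, rfl⟩ := mem_vadd_finset.1 hy
    exact mem_add.2 ⟨z, hz, s, hsS, by rw [vadd_eq_add, add_comm]⟩
  have h2A : #A + #A ≤ #(A + S) := by
    have := card_le_card hsub
    rwa [card_union_of_disjoint hdisj, card_vadd_finset] at this
  -- `|A| ≥ 2`, pick `a ∈ A ∖ 0`: `|A + S| ≥ |S ∪ (a + S)| ≥ 2|S| − 2`
  have hA2 : 2 ≤ #A := by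
    by_contra hA1
    have hA1' : A = {0} :=
      (eq_of_subset_of_card_le (singleton_subset_iff.2 h0A) (by rw [card_singleton]; omega)).symm
    have : #(A + S) = #S := by rw [hA1', singleton_zero, zero_add]
    omega
  obtain ⟨a, ha, ha0⟩ : ∃ a ∈ A, a ≠ 0 := by
    by_contra h
    push Not at h
    have : A ⊆ {0} := fun x hx => mem_singleton.2 (h x hx)
    have := card_le_card this
    rw [card_singleton] at this
    omega
  have hsub2 : S ∪ (a +ᵥ S) ⊆ A + S := by
    refine union_subset ?_ fun y hy => ?_
    · intro y hy; exact mem_add.2 ⟨0, h0A, y, hy, zero_add y⟩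
    · obtain ⟨z, hz, rfl⟩ := mem_vadd_finset.1 hy
      exact mem_add.2 ⟨a, ha, z, hz, rfl⟩
  have h2S : #S + #S ≤ #(A + S) + 2 := by
    have h1 := card_le_card hsub2
    have h2 := card_union_add_card_inter S (a +ᵥ S)
    have h3 := hsid2 a ha0
    rw [card_vadd_finset] at h2
    omega
  omega

/-! ### Lemma 11 for `|S| ≥ 3`: a generating Sidon-like set has `κ₂ ≥ 2|S| − 3` -/

omit [Fintype G] in
/-- Four translates of a Sidon-like set cover at least `4|A| − 6` points.
[cite: HamidouneSerraZemor2008, §2 (proof of Lemma 11: "|S + A| ≥ |S| + (|S| − 1) + (|S| − 2) +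
(|S| − 3)")] -/
theorem four_mul_card_le_card_union_vadd_four {A : Finset G}
    (hsid : ∀ x : G, x ≠ 0 → #(A ∩ (x +ᵥ A)) ≤ 1) {u v w t : G} (huv : u ≠ v) (huw : u ≠ w)
    (hvw : v ≠ w) (hut : u ≠ t) (hvt : v ≠ t) (hwt : w ≠ t) :
    4 * #A ≤ #((u +ᵥ A) ∪ (v +ᵥ A) ∪ (w +ᵥ A) ∪ (t +ᵥ A)) + 6 := by
  have h3 := three_mul_card_le_card_union_vadd_three hsid huv huw hvw
  have hU := card_union_add_card_inter ((u +ᵥ A) ∪ (v +ᵥ A) ∪ (w +ᵥ A)) (t +ᵥ A)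
  have hI : #(((u +ᵥ A) ∪ (v +ᵥ A) ∪ (w +ᵥ A)) ∩ (t +ᵥ A)) ≤ 3 := by
    rw [union_inter_distrib_right, union_inter_distrib_right]
    have h1 := card_inter_vadd_vadd_le_one hsid hut
    have h2 := card_inter_vadd_vadd_le_one hsid hvt
    have h4 := card_inter_vadd_vadd_le_one hsid hwt
    have := card_union_le ((u +ᵥ A) ∩ (t +ᵥ A) ∪ (v +ᵥ A) ∩ (t +ᵥ A)) ((w +ᵥ A) ∩ (t +ᵥ A))
    have := card_union_le ((u +ᵥ A) ∩ (t +ᵥ A)) ((v +ᵥ A) ∩ (t +ᵥ A))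
    omega
  rw [card_vadd_finset] at hU
  omega

/-- **[HamidouneSerraZemor2008, Lemma 11], lower bound, any `|S| ≥ 3`:** if `A ∋ 0` is a
Sidon-like set with `|A| ≥ 3` generating `G`, then every `X` with `|X| ≥ 2` and `|X + A| ≤ |G| − 2`
has `|X + A| ≥ |X| + 2|A| − 3` (i.e. `κ₂(A) ≥ 2|A| − 3`; the case `|A| = 3` is
`card_add_three_le_card_add_of_sidonLike`).  Proof as printed: otherwise `κ₂(A) ≤ 2|A| − 4`; a
`2`-atom `B ∋ 0` of `A` has `|B| ≥ 3`, hence (three translates of `A`) `|B| ≥ |A| + 1 ≥ 4`, and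
`B` is a subgroup or Sidon-like (Corollary 9): a Sidon-like `B` gives `|A + B| ≥ 3|B| − 3`, too
big; a proper subgroup `B ∌ A` gives `κ₂ ≥ |B|`, so `|B| ≤ 2|A| − 4`, while four translates of `A`
give `|A + B| ≥ 4|A| − 6`, too big. [cite: HamidouneSerraZemor2008, §2, Lemma 11 and Corollary 9] -/
theorem card_add_two_mul_le_card_add_of_sidonLike {A : Finset G} (h0A : (0 : G) ∈ A)
    (hA3 : 3 ≤ #A) (hsid : ∀ x : G, x ≠ 0 → #(A ∩ (x +ᵥ A)) ≤ 1)
    (hgen : AddSubgroup.closure (A : Set G) = ⊤) {X : Finset G} (hX2 : 2 ≤ #X)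
    (hXA : #(X + A) + 2 ≤ Fintype.card G) : #X + 2 * #A ≤ #(X + A) + 3 := by
  classical
  by_contra hlt
  push Not at hlt
  have hadm : IsAdm 2 A X := ⟨hX2, hXA⟩
  have hκ : conn 2 A + 4 ≤ 2 * #A := by
    have := conn_le hadm
    have := card_le_card_add h0A X
    omega
  obtain ⟨B₀, hB₀⟩ := exists_isAtom ⟨X, hadm⟩
  have hB₀a := hB₀.1.1
  unfold IsAdm at hB₀a
  obtain ⟨b₀, hb₀⟩ : B₀.Nonempty := card_pos.1 (by omega)
  obtain ⟨B, hB, h0B⟩ : ∃ B : Finset G, IsAtom 2 A B ∧ (0 : G) ∈ B :=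
    ⟨-b₀ +ᵥ B₀, hB₀.vadd (-b₀), mem_vadd_finset.2 ⟨b₀, hb₀, by rw [vadd_eq_add, neg_add_cancel]⟩⟩
  have hBa := hB.1.1
  unfold IsAdm at hBa
  have hBf := hB.1.2
  have hBAB := card_le_card_add h0A B
  have hBA : #(B + A) + 4 ≤ #B + 2 * #A := by omega
  have htr : ∀ u ∈ B, u +ᵥ A ⊆ B + A := fun u hu y hy => by
    obtain ⟨z, hz, rfl⟩ := mem_vadd_finset.1 hy
    exact mem_add.2 ⟨u, hu, z, hz, rfl⟩
  -- `|B| ≥ 3`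
  have hB3 : 3 ≤ #B := by
    by_contra hB2
    have hB2' : #B = 2 := by omega
    obtain ⟨u, v, huv, hBuv⟩ := card_eq_two.1 hB2'
    have hu : u ∈ B := by rw [hBuv]; simp
    have hv : v ∈ B := by rw [hBuv]; simp
    have h1 := card_le_card (union_subset (htr u hu) (htr v hv))
    have h2 := card_union_add_card_inter (u +ᵥ A) (v +ᵥ A)
    have h3 := card_inter_vadd_vadd_le_one hsid huv
    rw [card_vadd_finset, card_vadd_finset] at h2
    omega
  -- `|B| ≥ |A| + 1 ≥ 4`
  obtain ⟨u, hu, v, hv, w, hw, huv, huw, hvw⟩ := two_lt_card.1 (by omega : 2 < #B)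
  have hB4 : #A + 1 ≤ #B := by
    have h1 := card_le_card (union_subset (union_subset (htr u hu) (htr v hv)) (htr w hw))
    have h2 := three_mul_card_le_card_union_vadd_three hsid huv huw hvw
    omega
  by_cases hK : ∃ K : AddSubgroup G, (K : Set G) = B
  · obtain ⟨K, hK⟩ := hK
    by_cases hAB : A ⊆ B
    · have hKtop : K = ⊤ := by
        rw [eq_top_iff, ← hgen, AddSubgroup.closure_le, hK]
        exact_mod_cast hAB
      have hBuniv : B = univ := by rw [← coe_eq_univ, ← hK, hKtop]; rfl
      have : #(B + A) = Fintype.card G := by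
        apply le_antisymm (card_le_univ _)
        rw [← card_univ, ← hBuniv]; exact hBAB
      omega
    · obtain ⟨α, hαA, hαB⟩ := not_subset.1 hAB
      have hdisj : Disjoint B (α +ᵥ B) := by
        rw [disjoint_left]
        rintro y hyB hyα
        obtain ⟨z, hz, rfl⟩ := mem_vadd_finset.1 hyα
        apply hαB
        have hzK : z ∈ K := by rw [← SetLike.mem_coe, hK]; exact hz
        have hyK : α + z ∈ K := by rw [← SetLike.mem_coe, hK]; exact hyB
        have e : α = (α + z) - z := by abel
        rw [← mem_coe, ← hK, SetLike.mem_coe, e]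
        exact K.sub_mem hyK hzK
      have hsub : B ∪ (α +ᵥ B) ⊆ B + A := by
        refine union_subset (fun y hy => mem_add.2 ⟨y, hy, 0, h0A, add_zero y⟩) fun y hy => ?_
        obtain ⟨z, hz, rfl⟩ := mem_vadd_finset.1 hy
        exact mem_add.2 ⟨z, hz, α, hαA, by rw [vadd_eq_add, add_comm]⟩
      have h1 := card_le_card hsub
      have h2 : #(B ∪ (α +ᵥ B)) = #B + #B := by
        rw [card_union_of_disjoint hdisj, card_vadd_finset]
      -- `|B| ≤ 2|A| − 4`; four translates of `A` by elements of `B`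
      have hB4' : 4 ≤ #B := by omega
      obtain ⟨t, ht, htuvw⟩ : ∃ t ∈ B, t ∉ ({u, v, w} : Finset G) :=
        exists_mem_notMem_of_card_lt_card (lt_of_le_of_lt card_le_three (by omega))
      simp only [mem_insert, mem_singleton, not_or] at htuvw
      obtain ⟨htu, htv, htw⟩ := htuvw
      have h5 := card_le_card (union_subset (union_subset (union_subset (htr u hu) (htr v hv))
        (htr w hw)) (htr t ht))
      have h6 := four_mul_card_le_card_union_vadd_four hsid huv huw hvw (fun e => htu e.symm)
        (fun e => htv e.symm) (fun e => htw e.symm)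
      omega
  · push Not at hK
    have hsidB : ∀ x : G, x ≠ 0 → #(B ∩ (x +ᵥ B)) ≤ 1 := fun x hx =>
      hB.card_inter_vadd_le_one_of_forall_ne h0A h0B hK hx
    obtain ⟨x, hx, y, hy, z, hz, hxy, hxz, hyz⟩ := two_lt_card.1 (by omega : 2 < #A)
    have htr' : ∀ s ∈ A, s +ᵥ B ⊆ B + A := fun s hs r hr => by
      obtain ⟨q, hq, rfl⟩ := mem_vadd_finset.1 hr
      exact mem_add.2 ⟨q, hq, s, hs, by rw [vadd_eq_add, add_comm]⟩
    have h1 := card_le_card (union_subset (union_subset (htr' x hx) (htr' y hy)) (htr' z hz))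
    have h2 := three_mul_card_le_card_union_vadd_three hsidB hxy hxz hyz
    omega

/-! ### The number of differences of a Sidon-like set -/

omit [Fintype G] in
/-- A Sidon-like set has `|A|(|A| − 1) + 1` distinct differences: any `T` containing all `α − β`
(`α, β ∈ A`) has `|T| ≥ |A|(|A| − 1) + 1` (so `|⟨A⟩| ≥ |A|(|A|−1) + 1 ≥ |A| + 4` when `|A| ≥ 3`).
[cite: HamidouneSerraZemor2008, §5 (proof of Theorem 21: "Since A is a Sidon set we have
|Q| − |A| ≥ 4 (for example use |Q| ≥ |A|(|A|+1)/2 …)")] -/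
theorem card_mul_card_sub_one_lt_card_of_forall_sub_mem {A : Finset G}
    (hsid : ∀ x : G, x ≠ 0 → #(A ∩ (x +ᵥ A)) ≤ 1) {T : Finset G}
    (hT : ∀ α ∈ A, ∀ β ∈ A, α - β ∈ T) (hA : A.Nonempty) : #A * (#A - 1) + 1 ≤ #T := by
  classical
  set D : G → Finset G := fun α => (A.image (α - ·)).erase 0 with hD
  have hDcard : ∀ α ∈ A, #(D α) = #A - 1 := by
    intro α hα
    simp only [hD]
    rw [card_erase_of_mem (mem_image.2 ⟨α, hα, sub_self α⟩),
      card_image_of_injective _ sub_right_injective]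
  have hDdisj : ∀ α ∈ A, ∀ β ∈ A, α ≠ β → Disjoint (D α) (D β) := by
    intro α hα β hβ hαβ
    rw [disjoint_left]
    intro u hu hu'
    simp only [hD, mem_erase, mem_image] at hu hu'
    obtain ⟨hu0, γ, hγ, hγu⟩ := hu
    obtain ⟨-, γ', hγ', hγ'u⟩ := hu'
    have e : α - γ = β - γ' := hγu.trans hγ'u.symm
    have hαγ : α ≠ γ := fun h => hu0 (by rw [← hγu, h, sub_self])
    have h2 : ({α, γ} : Finset G) ⊆ A ∩ ((α - β) +ᵥ A) := by
      intro v hv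
      rw [mem_insert, mem_singleton] at hv
      rw [mem_inter]
      rcases hv with rfl | rfl
      · exact ⟨hα, mem_vadd_finset.2 ⟨β, hβ, by rw [vadd_eq_add, sub_add_cancel]⟩⟩
      · refine ⟨hγ, mem_vadd_finset.2 ⟨γ', hγ', ?_⟩⟩
        rw [vadd_eq_add]
        calc α - β + γ' = (α - v) - (β - γ') + v := by abel
          _ = v := by rw [e, sub_self, zero_add]
    have h3 := card_le_card h2
    rw [card_pair hαγ] at h3
    have h4 := hsid (α - β) (sub_ne_zero.2 hαβ)
    omega
  have h0D : ∀ α, (0 : G) ∉ D α := fun α => by simp [hD]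
  have hsub : {0} ∪ A.biUnion D ⊆ T := by
    refine union_subset (singleton_subset_iff.2 ?_) fun u hu => ?_
    · obtain ⟨α, hα⟩ := hA
      simpa using hT α hα α hα
    · rw [mem_biUnion] at hu
      obtain ⟨α, hα, hu⟩ := hu
      simp only [hD, mem_erase, mem_image] at hu
      obtain ⟨-, γ, hγ, rfl⟩ := hu
      exact hT α hα γ hγ
  have hdisj0 : Disjoint ({0} : Finset G) (A.biUnion D) := by
    rw [disjoint_singleton_left, mem_biUnion]
    rintro ⟨α, -, h⟩
    exact h0D α h
  have := card_le_card hsub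
  rw [card_union_of_disjoint hdisj0, card_singleton,
    card_biUnion (fun α hα β hβ hαβ => hDdisj α hα β hβ hαβ), sum_congr rfl hDcard, sum_const,
    smul_eq_mul] at this
  omega

/-! ### The Fainting Lemma for general `|Y|` -/

/-- **[HamidouneSerraZemor2008, Lemma 19 (the Fainting Lemma)], general `|Y|`.**  Let `X, Y ⊆ G`
with `0 ∈ X ∩ Y`, `|X + Y| = |X| + |Y| + m`, `Y` generating `G`, `3 ≤ |Y| ≤ m + 3`; let
`y ∈ Y* = Y ∖ {0}` and put `U = y − Y*` (`∋ 0`); let `H ⊇ U` be a subgroup (given with its finset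
`Hf`; in print `H = ⟨U⟩`).  Assume (i) in the form its proof uses: every nonempty `Z` inside one
`H`-coset has `|Z + U| ≥ min(|H|, |Z| + |Y| − 2)` (this is "`κ₁(Y* − y) = |Y*| − 1`" in `H`, cf.
Lemma 10), and
(ii): `X + Y = X + Y*` together with the layer inclusion `N₂(X,Y) − Y* ⊆ X + Y`.  Then
`|G| ≤ |X| + (m+3)(m+4)/2 = |X| + C(m+4, 2)`.  Proof as printed: `X + i(Y − y) = X + i(Y* − y)`
exhausts `G`, so `X + H = G`; if a layer `N_{i+1} ≠ ∅` had `|N_{i+1} + U| < |N_{i+1}| + |Y*| − 1`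
then by (i) coset-wise `N_{i+1} + U` would be a union of `H`-cosets, and `N_i ⊇ (N_{i+1} + U) − y`
would contain a whole coset, off `X` — impossible as `X + H = G`; hence
`|N_{i+1}| + |Y| − 2 ≤ |N_{i+1} + U| ≤ |N_i|`, and summing the layers
`|G| ≤ |X| + Σ_i (|Y| + m − i(|Y| − 2))⁺ ≤ |X| + C(m+4,2)` (maximal for `|Y| = 3`).
[cite: HamidouneSerraZemor2008, §4, Lemma 19 (with Lemmas 17, 18)] -/
theorem fainting (H : AddSubgroup G) (Hf : Finset G) (hHf : ∀ g, g ∈ Hf ↔ g ∈ H)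
    {X Y : Finset G} (h0X : (0 : G) ∈ X) (h0Y : (0 : G) ∈ Y)
    (hgen : AddSubgroup.closure (Y : Set G) = ⊤) {m : ℕ} (hY3 : 3 ≤ #Y) (hYm : #Y ≤ m + 3)
    (hm : #(X + Y) = #X + #Y + m) {y : G} (hy : y ∈ Y.erase 0)
    (hUH : ∀ z ∈ Y.erase 0, y - z ∈ H)
    (hi : ∀ Z : Finset G, Z.Nonempty → (∀ z ∈ Z, ∀ z' ∈ Z, z - z' ∈ H) →
      min #Hf (#Z + #Y - 2) ≤ #(Z + (Y.erase 0).image (y - ·)))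
    (hii : X + Y = X + Y.erase 0)
    (hN : ∀ z ∈ (X + Y + Y) \ (X + Y), ∀ h ∈ Y.erase 0, z + -h ∈ X + Y) :
    Fintype.card G ≤ #X + (m + 3) * (m + 4) / 2 := by
  classical
  set k := #Y with hk
  set U : Finset G := (Y.erase 0).image (y - ·) with hU
  have hy' := hy
  rw [mem_erase] at hy'
  have h0U : (0 : G) ∈ U := mem_image.2 ⟨y, hy, sub_self y⟩
  have hUcard : #U = k - 1 := by
    rw [hU, card_image_of_injective _ sub_right_injective, card_erase_of_mem h0Y]
  have hUH' : ∀ u ∈ U, u ∈ H := by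
    intro u hu
    rw [hU, mem_image] at hu
    obtain ⟨z, hz, rfl⟩ := hu
    exact hUH z hz
  have hUHset : (U : Set G) ⊆ H := fun u hu => hUH' u hu
  have hHneg : ∀ g ∈ Hf, -g ∈ Hf := fun g hg => (hHf _).2 (H.neg_mem ((hHf g).1 hg))
  have hHadd : ∀ g ∈ Hf, ∀ g' ∈ Hf, g + g' ∈ Hf := fun g hg g' hg' =>
    (hHf _).2 (H.add_mem ((hHf g).1 hg) ((hHf g').1 hg'))
  have h0H : (0 : G) ∈ Hf := (hHf 0).2 H.zero_mem
  -- the cumulative layers `T i = X + iY`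
  obtain ⟨T, hT0, hTs⟩ : ∃ T : ℕ → Finset G, T 0 = X ∧ ∀ n, T (n + 1) = T n + Y :=
    ⟨fun n => Nat.rec X (fun _ Z => Z + Y) n, rfl, fun _ => rfl⟩
  have hT1 : T 1 = X + Y := by rw [hTs, hT0]
  have hT2 : T 2 = X + Y + Y := by rw [hTs, hT1]
  have hmono : ∀ n, T n ⊆ T (n + 1) := fun n => by rw [hTs]; exact subset_add_left _ h0Y
  have hXsub : ∀ n, X ⊆ T n := by
    intro n
    induction n with
    | zero => rw [hT0]
    | succ n ih => exact ih.trans (hmono n)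
  have hTne : ∀ n, (T n).Nonempty := fun n => ⟨0, hXsub n h0X⟩
  have hgrow : ∀ n, T n ≠ univ → #(T n) + 1 ≤ #(T (n + 1)) := by
    intro n hn
    by_contra hlt
    have heq : T (n + 1) = T n := (eq_of_subset_of_card_le (hmono n) (by omega)).symm
    rw [hTs] at heq
    exact hn (eq_univ_of_add_eq_of_closure_eq_top (hTne n) hgen heq)
  have hbig : ∀ n, T n = univ ∨ #X + n ≤ #(T n) := by
    intro n
    induction n with
    | zero => right; rw [hT0]; simp
    | succ n ih =>
      by_cases hn : T n = univ
      · left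
        exact eq_univ_of_forall fun x => hmono n (hn ▸ mem_univ x)
      · rcases ih with h | h
        · exact absurd h hn
        · right; have := hgrow n hn; omega
  have hX1 : 1 ≤ #X := card_pos.2 ⟨0, h0X⟩
  have hTu : T (Fintype.card G) = univ := by
    rcases hbig (Fintype.card G) with h | h
    · exact h
    · have := card_le_univ (T (Fintype.card G)); omega
  -- `X + Hf = G`: the chain `R i = X + i(Y − y) = X + iU ⊆ X + Hf` exhausts `G`
  set Yy : Finset G := -y +ᵥ Y with hYy
  have h0Yy : (0 : G) ∈ Yy := mem_vadd_finset.2 ⟨y, hy'.2, by rw [vadd_eq_add, neg_add_cancel]⟩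
  have hgenYy : AddSubgroup.closure (Yy : Set G) = ⊤ := by
    have hyc : -y ∈ AddSubgroup.closure (Yy : Set G) := by
      apply AddSubgroup.subset_closure
      rw [mem_coe, hYy]
      exact mem_vadd_finset.2 ⟨0, h0Y, by rw [vadd_eq_add, add_zero]⟩
    rw [eq_top_iff, ← hgen, AddSubgroup.closure_le]
    intro z hz
    rw [mem_coe] at hz
    have hzc : -y + z ∈ AddSubgroup.closure (Yy : Set G) := by
      apply AddSubgroup.subset_closure
      rw [mem_coe, hYy]
      exact mem_vadd_finset.2 ⟨z, hz, rfl⟩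
    have h3 := AddSubgroup.sub_mem _ hzc hyc
    have e3 : -y + z - -y = z := by abel
    rw [e3] at h3
    exact h3
  have hXYy : X + Yy = X + (-y +ᵥ Y.erase 0) := by
    rw [hYy, ← singleton_add, ← singleton_add, add_left_comm, hii, ← add_left_comm]
  have hUeq : -y +ᵥ Y.erase 0 = -U := by
    ext g
    simp only [mem_vadd_finset, vadd_eq_add, hU, mem_neg', mem_image]
    constructor
    · rintro ⟨z, hz, rfl⟩; exact ⟨z, hz, by abel⟩
    · rintro ⟨z, hz, hzg⟩; exact ⟨z, hz, by rw [← neg_neg g, ← hzg]; abel⟩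
  obtain ⟨R, hR0, hRs⟩ : ∃ R : ℕ → Finset G, R 0 = X ∧ ∀ n, R (n + 1) = R n + Yy :=
    ⟨fun n => Nat.rec X (fun _ Z => Z + Yy) n, rfl, fun _ => rfl⟩
  have hRs' : ∀ n, R (n + 1) = R n + (-U) := by
    intro n
    induction n with
    | zero => rw [hRs, hR0, hXYy, hUeq]
    | succ n ih => rw [hRs, ih, add_right_comm, ← hRs, ih]
  have hRsub : ∀ n, R n ⊆ X + Hf := by
    intro n
    induction n with
    | zero => rw [hR0]; exact subset_add_left _ h0H
    | succ n ih =>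
      rw [hRs']
      intro g hg
      obtain ⟨r, hr, u, hu, rfl⟩ := mem_add.1 hg
      obtain ⟨x, hx, h, hh, rfl⟩ := mem_add.1 (ih hr)
      rw [mem_neg'] at hu
      refine mem_add.2 ⟨x, hx, h + u, hHadd h hh u ?_, by abel⟩
      have := hHneg (-u) ((hHf _).2 (hUH' (-u) hu))
      rwa [neg_neg] at this
  have hRne : ∀ n, (R n).Nonempty := by
    intro n
    induction n with
    | zero => rw [hR0]; exact ⟨0, h0X⟩
    | succ n ih => rw [hRs]; exact ih.add ⟨0, h0Yy⟩
  have hRmono : ∀ n, R n ⊆ R (n + 1) := fun n => by rw [hRs]; exact subset_add_left _ h0Yy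
  have hRbig : ∀ n, R n = univ ∨ n ≤ #(R n) := by
    intro n
    induction n with
    | zero => right; simp
    | succ n ih =>
      by_cases hn : R n = univ
      · left; exact eq_univ_of_forall fun x => hRmono n (hn ▸ mem_univ x)
      · rcases ih with h | h
        · exact absurd h hn
        · right
          by_contra hlt
          have heq : R (n + 1) = R n := (eq_of_subset_of_card_le (hRmono n) (by omega)).symm
          rw [hRs] at heq
          exact hn (eq_univ_of_add_eq_of_closure_eq_top (hRne n) hgenYy heq)
  have hXH : X + Hf = univ := by
    apply eq_univ_of_forall
    intro g
    rcases hRbig (Fintype.card G + 1) with h | h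
    · exact hRsub _ (h ▸ mem_univ g)
    · have := card_le_univ (R (Fintype.card G + 1)); omega
  -- (1) the layer inclusion for all `i ≥ 1`
  have hP : ∀ i, 1 ≤ i → ∀ z ∈ T (i + 1) \ T i, ∀ h ∈ Y.erase 0, z + -h ∈ T i := by
    intro i hi
    induction i with
    | zero => omega
    | succ i ih =>
      rcases Nat.eq_zero_or_pos i with rfl | hipos
      · intro z hz h hh
        have e1 : T (0 + 1) = X + Y := hT1
        have e2 : T (0 + 1 + 1) = X + Y + Y := hT2
        rw [e1, e2] at hz
        rw [e1]
        exact hN z hz h hh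
      · have ih' := ih hipos
        rw [hTs i] at ih'
        intro z hz h hh
        rw [hTs (i + 1), hTs i] at hz
        rw [hTs i]
        exact layer_step ih' z hz h hh
  -- (2) the decrease `|N_{i+2}| + (k − 2) ≤ |N_{i+1}|` while `N_{i+2} ≠ ∅`
  obtain ⟨e, he⟩ : ∃ e : ℕ → ℕ, ∀ i, e i = #(T (i + 1)) - #(T i) := ⟨_, fun _ => rfl⟩
  have hecard : ∀ i, e i = #(T (i + 1) \ T i) := fun i => by
    rw [he, card_sdiff_of_subset (hmono i)]
  have hdec : ∀ i, e (i + 1) ≠ 0 → e (i + 1) + (k - 2) ≤ e i := by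
    intro i hne
    rw [hecard] at hne
    set N := T (i + 1 + 1) \ T (i + 1) with hNdef
    have hNne : N.Nonempty := card_pos.1 (Nat.pos_of_ne_zero hne)
    have hback : ∀ z ∈ N, ∀ h ∈ Y.erase 0, z + -h ∈ T (i + 1) \ T i := by
      intro z hz h hh
      have h1 := hP (i + 1) (by omega) z hz h hh
      refine mem_sdiff.2 ⟨h1, fun h2 => ?_⟩
      rw [hNdef, mem_sdiff] at hz
      apply hz.2
      rw [hTs]
      have ee : z = (z + -h) + h := by abel
      rw [ee]
      exact add_mem_add h2 (mem_erase.1 hh).2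
    -- `M = N + U ⊆ y + N_i`
    set M := N + U with hMdef
    have hM : M ⊆ y +ᵥ (T (i + 1) \ T i) := by
      intro g hg
      obtain ⟨z, hz, u, hu, rfl⟩ := mem_add.1 hg
      rw [hU, mem_image] at hu
      obtain ⟨h, hh, rfl⟩ := hu
      exact mem_vadd_finset.2 ⟨z + -h, hback z hz h hh, by rw [vadd_eq_add]; abel⟩
    have hMcard : #M ≤ e i := by
      have := card_le_card hM
      rwa [card_vadd_finset, ← hecard] at this
    -- coset decomposition of `N` modulo `H`
    have hMsum : #M = ∑ c ∈ N.image (fun s : G => (s : G ⧸ H)),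
        #(N.filter (fun s : G => (s : G ⧸ H) = c) + U) :=
      card_add_eq_sum_card_filter_add H N U hUHset
    have hNsum : #N = ∑ c ∈ N.image (fun s : G => (s : G ⧸ H)),
        #(N.filter (fun s : G => (s : G ⧸ H) = c)) :=
      card_eq_sum_card_fiberwise fun s hs => mem_image_of_mem _ hs
    have hpiece : ∀ c ∈ N.image (fun s : G => (s : G ⧸ H)),
        min #Hf (#(N.filter (fun s : G => (s : G ⧸ H) = c)) + k - 2) ≤
          #(N.filter (fun s : G => (s : G ⧸ H) = c) + U) := by
      intro c hc
      obtain ⟨s₀, hs₀, rfl⟩ := mem_image.1 hc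
      apply hi
      · exact ⟨s₀, mem_filter.2 ⟨hs₀, rfl⟩⟩
      · intro z hz z' hz'
        rw [mem_filter] at hz hz'
        have := QuotientAddGroup.eq.1 (hz'.2.trans hz.2.symm)
        rwa [← sub_eq_neg_add] at this
    have hpiece0 : ∀ c, #(N.filter (fun s : G => (s : G ⧸ H) = c)) ≤
        #(N.filter (fun s : G => (s : G ⧸ H) = c) + U) := fun c => card_le_card_add h0U _
    have hNM : #N + (k - 2) ≤ #M := by
      by_cases hsome : ∃ c ∈ N.image (fun s : G => (s : G ⧸ H)),
          #(N.filter (fun s : G => (s : G ⧸ H) = c)) + k - 2 ≤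
            #(N.filter (fun s : G => (s : G ⧸ H) = c) + U)
      · obtain ⟨c, hc, hcle⟩ := hsome
        rw [hMsum, hNsum, ← add_sum_erase _ _ hc, ← add_sum_erase _ _ hc]
        have := sum_le_sum (s := (N.image fun s : G => (s : G ⧸ H)).erase c)
          (fun c' _ => hpiece0 c')
        omega
      · -- every piece of `M` is a whole coset: `N_i` contains a coset, off `X`
        exfalso
        push Not at hsome
        obtain ⟨n₀, hn₀⟩ := hNne
        have hc₀ : ((n₀ : G ⧸ H)) ∈ N.image (fun s : G => (s : G ⧸ H)) := mem_image_of_mem _ hn₀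
        have hfull : #Hf ≤ #(N.filter (fun s : G => (s : G ⧸ H) = (n₀ : G ⧸ H)) + U) := by
          have h1 := hpiece _ hc₀
          have h2 := hsome _ hc₀
          rw [min_le_iff] at h1
          rcases h1 with h1 | h1
          · exact h1
          · omega
        have hsub : N.filter (fun s : G => (s : G ⧸ H) = (n₀ : G ⧸ H)) + U ⊆ n₀ +ᵥ Hf :=
          filter_add_subset_vadd H Hf hHf N U hUHset rfl
        have heq : N.filter (fun s : G => (s : G ⧸ H) = (n₀ : G ⧸ H)) + U = n₀ +ᵥ Hf :=
          eq_of_subset_of_card_le hsub (by rw [card_vadd_finset]; exact hfull)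
        -- the coset `n₀ - y + Hf ⊆ N_i` meets `X`
        have hx : n₀ + -y ∈ X + Hf := by rw [hXH]; exact mem_univ _
        obtain ⟨x, hxX, h, hh, hxh⟩ := mem_add.1 hx
        have hmem : x + y ∈ n₀ +ᵥ Hf := by
          refine mem_vadd_finset.2 ⟨-h, hHneg h hh, ?_⟩
          rw [vadd_eq_add]
          have : n₀ = x + h + y := by rw [hxh]; abel
          rw [this]; abel
        rw [← heq] at hmem
        have hxy : x + y ∈ M := by
          rw [hMdef]
          exact add_subset_add_right (filter_subset _ _) hmem
        have := hM hxy
        rw [mem_vadd_finset] at this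
        obtain ⟨w, hw, hwx⟩ := this
        rw [vadd_eq_add] at hwx
        have : w = x := by
          have := hwx; rw [add_comm x y] at this; exact add_left_cancel this
        rw [this, mem_sdiff] at hw
        exact hw.2 (hXsub i hxX)
    have hN' : e (i + 1) = #N := by rw [hecard]
    omega
  -- (3) counting
  have htel : ∀ L, #(T L) = #X + ∑ i ∈ range L, e i := by
    intro L
    induction L with
    | zero => rw [hT0]; simp
    | succ L ih =>
      rw [sum_range_succ, ← add_assoc, ← ih, he]
      have := card_le_card (hmono L)
      omega
  have he0 : e 0 = k + m := by
    rw [he, show (0 : ℕ) + 1 = 1 from rfl, hT1, hT0, hm]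
    omega
  have he1 : e 1 ≤ m + 2 := by
    by_cases h : e 1 = 0
    · omega
    · have := hdec 0 h
      rw [show (0 : ℕ) + 1 = 1 from rfl] at this
      omega
  have he2' : e 2 = 0 ∨ e 2 + k ≤ m + 4 := by
    by_cases h : e 2 = 0
    · exact Or.inl h
    · have := hdec 1 h
      rw [show (1 : ℕ) + 1 = 2 from rfl] at this
      right; omega
  have he2 : e 2 ≤ m + 1 := by omega
  have hebound : ∀ i, 2 ≤ i → e i ≤ m + 3 - i := by
    intro i hi
    induction i with
    | zero => omega
    | succ i ih =>
      rcases Nat.eq_or_lt_of_le hi with h2 | h2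
      · rw [← h2]; exact he2
      · by_cases h : e (i + 1) = 0
        · omega
        · have := hdec i h
          have := ih (by omega)
          omega
  have hn3 : 3 ≤ Fintype.card G := le_trans hY3 (card_le_univ Y)
  have hsum : ∑ i ∈ range (Fintype.card G), e i ≤ ∑ i ∈ range (Fintype.card G), (m + 3 - i) := by
    obtain ⟨L, hL⟩ : ∃ L, Fintype.card G = 3 + L := ⟨Fintype.card G - 3, by omega⟩
    rw [hL, sum_range_add, sum_range_add]
    have h1 : ∑ i ∈ range 3, e i ≤ ∑ i ∈ range 3, (m + 3 - i) := by
      simp only [sum_range_succ, sum_range_zero, zero_add]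
      omega
    have h2 : ∑ i ∈ range L, e (3 + i) ≤ ∑ i ∈ range L, (m + 3 - (3 + i)) :=
      sum_le_sum fun i _ => hebound (3 + i) (by omega)
    omega
  have htail := two_mul_sum_range_tsub_le (m + 3) (Fintype.card G)
  rw [show m + 3 + 1 = m + 4 by ring] at htail
  have hfin := htel (Fintype.card G)
  rw [hTu, card_univ] at hfin
  have heven : (m + 3) * (m + 4) / 2 * 2 = (m + 3) * (m + 4) :=
    Nat.div_mul_cancel (Nat.even_mul_succ_self (m + 3)).two_dvd
  have := Nat.zero_le ((m + 3 - Fintype.card G) * (m + 3 - Fintype.card G + 1))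
  omega

/-! ### Lemma 20 and the transports needed by Theorem 21 for general `m` -/

omit [Fintype G] in
/-- **[HamidouneSerraZemor2008, Lemma 20]:** "Let `A` and `S` be subsets of a finite abelian group
`Q`.  Assume that `|A| = 3` and that for each `a ∈ A` we have `S + A = S + (A ∖ {a})`.  Then
`3|S| ≥ 2|S + A|`."  Proof as printed (`A = {x, y, z}`, `S + A = (x + S) ∪ (y + S)`, the symmetric
difference lies in `z + S`). [cite: HamidouneSerraZemor2008, §4, Lemma 20] -/
theorem two_mul_card_add_le_three_mul_card {S A : Finset G} (hA3 : #A = 3)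
    (h : ∀ a ∈ A, S + A = S + A.erase a) : 2 * #(S + A) ≤ 3 * #S := by
  classical
  obtain ⟨x, y, z, hxy, hxz, hyz, hA⟩ := card_eq_three.1 hA3
  have hx : x ∈ A := by rw [hA]; simp
  have hy : y ∈ A := by rw [hA]; simp
  have hz : z ∈ A := by rw [hA]; simp
  -- `S + (A ∖ {c}) = (u + S) ∪ (v + S)` for `{u, v} = A ∖ {c}`
  have key : ∀ u v c : G, A.erase c = {u, v} → S + A = (u +ᵥ S) ∪ (v +ᵥ S) := by
    intro u v c he
    rw [h c (by
      have : c ∈ ({u, v} : Finset G) ∪ {c} → c ∈ A := fun _ => by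
        by_contra hc
        rw [erase_eq_of_notMem hc] at he
        rw [he] at hA3
        have := Finset.card_le_two (a := u) (b := v)
        omega
      by_contra hc
      rw [erase_eq_of_notMem hc] at he
      rw [he] at hA3
      have := Finset.card_le_two (a := u) (b := v)
      omega), he, add_comm, insert_eq, union_add, singleton_add, singleton_add]
  have hez : A.erase z = {x, y} := by
    rw [hA]; ext w; simp only [mem_erase, mem_insert, mem_singleton]
    constructor
    · rintro ⟨hw, h1 | h1 | h1⟩
      · exact Or.inl h1
      · exact Or.inr h1
      · exact absurd h1 hw
    · rintro (rfl | rfl)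
      · exact ⟨hxz, Or.inl rfl⟩
      · exact ⟨hyz, Or.inr (Or.inl rfl)⟩
  have hex : A.erase x = {y, z} := by
    rw [hA]; ext w; simp only [mem_erase, mem_insert, mem_singleton]
    constructor
    · rintro ⟨hw, h1 | h1 | h1⟩
      · exact absurd h1 hw
      · exact Or.inl h1
      · exact Or.inr h1
    · rintro (rfl | rfl)
      · exact ⟨fun e => hxy e.symm, Or.inr (Or.inl rfl)⟩
      · exact ⟨fun e => hxz e.symm, Or.inr (Or.inr rfl)⟩
  have hey : A.erase y = {x, z} := by
    rw [hA]; ext w; simp only [mem_erase, mem_insert, mem_singleton]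
    constructor
    · rintro ⟨hw, h1 | h1 | h1⟩
      · exact Or.inl h1
      · exact absurd h1 hw
      · exact Or.inr h1
    · rintro (rfl | rfl)
      · exact ⟨hxy, Or.inl rfl⟩
      · exact ⟨fun e => hyz e.symm, Or.inr (Or.inr rfl)⟩
  have hSz := key x y z hez
  have hSx := key y z x hex
  have hSy := key x z y hey
  -- the two differences `(x+S) ∖ (y+S)` and `(y+S) ∖ (x+S)` lie in `z + S`, disjointly
  have h1 : (x +ᵥ S) \ (y +ᵥ S) ⊆ z +ᵥ S := by
    intro w hw
    rw [mem_sdiff] at hw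
    have : w ∈ S + A := by rw [hSz]; exact mem_union_left _ hw.1
    rw [hSx, mem_union] at this
    exact this.resolve_left hw.2
  have h2 : (y +ᵥ S) \ (x +ᵥ S) ⊆ z +ᵥ S := by
    intro w hw
    rw [mem_sdiff] at hw
    have : w ∈ S + A := by rw [hSz]; exact mem_union_right _ hw.1
    rw [hSy, mem_union] at this
    exact this.resolve_left hw.2
  have hdisj : Disjoint ((x +ᵥ S) \ (y +ᵥ S)) ((y +ᵥ S) \ (x +ᵥ S)) :=
    disjoint_sdiff.mono_left sdiff_subset
  have h3 := card_le_card (union_subset h1 h2)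
  rw [card_union_of_disjoint hdisj] at h3
  have h4 := card_sdiff_add_card_inter (x +ᵥ S) (y +ᵥ S)
  have h5 := card_sdiff_add_card_inter (y +ᵥ S) (x +ᵥ S)
  have h6 := card_union_add_card_inter (x +ᵥ S) (y +ᵥ S)
  rw [inter_comm] at h5
  simp only [card_vadd_finset] at h3 h4 h5 h6
  rw [hSz]
  omega

omit [Fintype G] in
/-- The pull-back of a finset to a subgroup meets its translates no more than the set does.
[folklore] -/
private theorem card_inter_vadd_filter_subtype_le (Q : AddSubgroup G) [Fintype ↥Q]
    (A : Finset G) (x : ↥Q) :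
    #((univ : Finset ↥Q).filter (fun y : ↥Q => (y : G) ∈ A) ∩
      (x +ᵥ (univ : Finset ↥Q).filter (fun y : ↥Q => (y : G) ∈ A))) ≤ #(A ∩ ((x : G) +ᵥ A)) := by
  rw [← card_image_of_injective _ Q.subtype_injective]
  refine card_le_card fun g hg => ?_
  simp only [mem_image, mem_inter, mem_filter, mem_univ, true_and, mem_vadd_finset,
    AddSubgroup.coe_subtype] at hg
  obtain ⟨y, ⟨hyA, z, hzA, rfl⟩, rfl⟩ := hg
  rw [mem_inter]
  exact ⟨hyA, mem_vadd_finset.2 ⟨(z : G), hzA, by simp [vadd_eq_add]⟩⟩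

omit [Fintype G] in
/-- The pull-back commutes with removing `0`. [folklore] -/
private theorem filter_subtype_erase_zero (Q : AddSubgroup G) [Fintype ↥Q] (A : Finset G) :
    ((univ : Finset ↥Q).filter (fun x : ↥Q => (x : G) ∈ A)).erase 0 =
      (univ : Finset ↥Q).filter (fun x : ↥Q => (x : G) ∈ A.erase 0) := by
  ext x
  simp only [mem_erase, mem_filter, mem_univ, true_and, ne_eq, Subtype.ext_iff]
  rfl

/-- **Lemma 10 inside the subgroup `⟨A⟩`:** for a weakly-Sidon `A ∋ 0` (`|A ∩ (g + A)| ≤ 2` for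
`g ≠ 0`) with `|A| ≥ 3` and a nonempty `P ⊆ ⟨A⟩` with `|P + A| ≤ |⟨A⟩| − 1`, one has
`|P + A| ≥ |P| + |A| − 1` (`κ₁(A) = |A| − 1` computed in `⟨A⟩`, transported to the ambient group).
[cite: HamidouneSerraZemor2008, §2, Lemma 10; §5 (proof of Theorem 21: "|S_i + A| − |S_i| ≥
|A| − 1 for i ∈ V")] -/
theorem card_add_card_le_succ_of_subset_closure {A P : Finset G} (h0A : (0 : G) ∈ A)
    (hA3 : 3 ≤ #A) (hsid2 : ∀ g : G, g ≠ 0 → #(A ∩ (g +ᵥ A)) ≤ 2)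
    (hP : ∀ g ∈ P, g ∈ AddSubgroup.closure (A : Set G)) (hPne : P.Nonempty)
    (hPA : #(P + A) + 1 ≤ Nat.card (AddSubgroup.closure (A : Set G))) :
    #P + #A ≤ #(P + A) + 1 := by
  classical
  haveI : Fintype ↥(AddSubgroup.closure (A : Set G)) := Fintype.ofFinite _
  have hAQ : ∀ g ∈ A, g ∈ AddSubgroup.closure (A : Set G) :=
    fun g hg => AddSubgroup.subset_closure hg
  have hPAQ : ∀ g ∈ P + A, g ∈ AddSubgroup.closure (A : Set G) := by
    intro g hg
    obtain ⟨x, hx, y, hy, rfl⟩ := mem_add.1 hg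
    exact AddSubgroup.add_mem _ (hP x hx) (hAQ y hy)
  set Q := AddSubgroup.closure (A : Set G) with hQ
  set A' : Finset ↥Q := univ.filter (fun x : ↥Q => (x : G) ∈ A) with hA'
  set P' : Finset ↥Q := univ.filter (fun x : ↥Q => (x : G) ∈ P) with hP'
  have h0A' : (0 : ↥Q) ∈ A' := by rw [hA', mem_filter]; exact ⟨mem_univ _, h0A⟩
  have hA3' : 3 ≤ #A' := by rw [hA', card_filter_subtype_eq Q A hAQ]; exact hA3
  have hsid' : ∀ x : ↥Q, x ≠ 0 → #(A' ∩ (x +ᵥ A')) ≤ 2 := fun x hx =>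
    le_trans (card_inter_vadd_filter_subtype_le Q A x)
      (hsid2 (x : G) fun h => hx (Subtype.ext h))
  have hgen' : AddSubgroup.closure (A' : Set ↥Q) = ⊤ := by
    have e : (A' : Set ↥Q) = Subtype.val ⁻¹' (A : Set G) := by ext x; simp [hA']
    rw [e]
    exact AddSubgroup.closure_closure_coe_preimage
  have hPne' : P'.Nonempty := by
    obtain ⟨p, hp⟩ := hPne
    exact ⟨⟨p, hP p hp⟩, by rw [hP', mem_filter]; exact ⟨mem_univ _, hp⟩⟩
  have hcardQ : Fintype.card ↥Q = Nat.card ↥Q := (Nat.card_eq_fintype_card).symm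
  have hsum : P' + A' = univ.filter (fun x : ↥Q => (x : G) ∈ P + A) := by
    rw [hP', hA', filter_subtype_add Q P A hP hAQ]
  have hPA' : #(P' + A') + 1 ≤ Fintype.card ↥Q := by
    rw [hsum, card_filter_subtype_eq Q _ hPAQ, hcardQ]; exact hPA
  have := card_add_card_le_card_add_succ_of_weakSidon h0A' hA3' hsid' hgen' hPne' hPA'
  rwa [hsum, card_filter_subtype_eq Q _ hPAQ, hP', card_filter_subtype_eq Q P hP, hA',
    card_filter_subtype_eq Q A hAQ] at this

/-- **Lemma 11 (any `|A| ≥ 3`) inside the subgroup `⟨A⟩`:** for a Sidon-like `A ∋ 0` with `|A| ≥ 3`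
and `P ⊆ ⟨A⟩` with `|P| ≥ 2`, `|P + A| ≤ |⟨A⟩| − 2`, one has `|P + A| ≥ |P| + 2|A| − 3`.
[cite: HamidouneSerraZemor2008, §2, Lemma 11; §5 (proof of Theorem 21: "|S_i + A| − |S_i| ≥
2|A| − 3 for i ∈ W")] -/
theorem card_add_two_mul_le_card_add_of_subset_closure {A P : Finset G} (h0A : (0 : G) ∈ A)
    (hA3 : 3 ≤ #A) (hsid : ∀ x : G, x ≠ 0 → #(A ∩ (x +ᵥ A)) ≤ 1)
    (hP : ∀ g ∈ P, g ∈ AddSubgroup.closure (A : Set G)) (hP2 : 2 ≤ #P)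
    (hPA : #(P + A) + 2 ≤ Nat.card (AddSubgroup.closure (A : Set G))) :
    #P + 2 * #A ≤ #(P + A) + 3 := by
  classical
  haveI : Fintype ↥(AddSubgroup.closure (A : Set G)) := Fintype.ofFinite _
  have hAQ : ∀ g ∈ A, g ∈ AddSubgroup.closure (A : Set G) :=
    fun g hg => AddSubgroup.subset_closure hg
  have hPAQ : ∀ g ∈ P + A, g ∈ AddSubgroup.closure (A : Set G) := by
    intro g hg
    obtain ⟨x, hx, y, hy, rfl⟩ := mem_add.1 hg
    exact AddSubgroup.add_mem _ (hP x hx) (hAQ y hy)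
  set Q := AddSubgroup.closure (A : Set G) with hQ
  set A' : Finset ↥Q := univ.filter (fun x : ↥Q => (x : G) ∈ A) with hA'
  set P' : Finset ↥Q := univ.filter (fun x : ↥Q => (x : G) ∈ P) with hP'
  have h0A' : (0 : ↥Q) ∈ A' := by rw [hA', mem_filter]; exact ⟨mem_univ _, h0A⟩
  have hA3' : 3 ≤ #A' := by rw [hA', card_filter_subtype_eq Q A hAQ]; exact hA3
  have hsid' : ∀ x : ↥Q, x ≠ 0 → #(A' ∩ (x +ᵥ A')) ≤ 1 := fun x hx =>
    le_trans (card_inter_vadd_filter_subtype_le Q A x)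
      (hsid (x : G) fun h => hx (Subtype.ext h))
  have hgen' : AddSubgroup.closure (A' : Set ↥Q) = ⊤ := by
    have e : (A' : Set ↥Q) = Subtype.val ⁻¹' (A : Set G) := by ext x; simp [hA']
    rw [e]
    exact AddSubgroup.closure_closure_coe_preimage
  have hP2' : 2 ≤ #P' := by rw [hP', card_filter_subtype_eq Q P hP]; exact hP2
  have hcardQ : Fintype.card ↥Q = Nat.card ↥Q := (Nat.card_eq_fintype_card).symm
  have hsum : P' + A' = univ.filter (fun x : ↥Q => (x : G) ∈ P + A) := by
    rw [hP', hA', filter_subtype_add Q P A hP hAQ]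
  have hPA' : #(P' + A') + 2 ≤ Fintype.card ↥Q := by
    rw [hsum, card_filter_subtype_eq Q _ hPAQ, hcardQ]; exact hPA
  have := card_add_two_mul_le_card_add_of_sidonLike h0A' hA3' hsid' hgen' hP2' hPA'
  rwa [hsum, card_filter_subtype_eq Q _ hPAQ, hP', card_filter_subtype_eq Q P hP, hA',
    card_filter_subtype_eq Q A hAQ] at this

omit [Fintype G] in
/-- The negative of a Sidon-like set is Sidon-like. [folklore] -/
private theorem sidonLike_neg {A : Finset G} (hsid : ∀ x : G, x ≠ 0 → #(A ∩ (x +ᵥ A)) ≤ 1)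
    (x : G) (hx : x ≠ 0) : #((-A) ∩ (x +ᵥ (-A))) ≤ 1 := by
  have e : (-A) ∩ (x +ᵥ (-A)) = -(A ∩ (-x +ᵥ A)) := by
    ext y
    simp only [mem_inter, mem_neg', mem_vadd_finset, vadd_eq_add]
    constructor
    · rintro ⟨hy, z, hz, rfl⟩
      exact ⟨hy, -z, hz, by abel⟩
    · rintro ⟨hy, z, hz, hzy⟩
      refine ⟨hy, -z, by rw [neg_neg]; exact hz, ?_⟩
      rw [← neg_neg y, ← hzy]; abel
  rw [e, card_neg]
  exact hsid (-x) (neg_ne_zero.2 hx)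

/-- **Hypothesis (i) of the Fainting Lemma from Lemma 10:** for a Sidon-like `A ∋ 0` with
`|A| ≥ 4` and `a ∈ A*`, `U = a − A*` is a weakly-Sidon (indeed Sidon-like) generating set of
`H = ⟨U⟩` with `|U| ≥ 3`, so `κ₁(U) = |U| − 1` in `H` (Lemma 10): every nonempty `Z` inside one
`H`-coset has `|Z + U| ≥ min(|H|, |Z| + |A| − 2)`. [cite: HamidouneSerraZemor2008, §5 (proof of
Theorem 21: "A* − a is also a Sidon set, and Lemma 10 implies that A satisfies condition (i) of
the Fainting Lemma")] -/
theorem fainting_hyp_of_sidonLike {A : Finset G} (h0A : (0 : G) ∈ A)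
    (hsid : ∀ x : G, x ≠ 0 → #(A ∩ (x +ᵥ A)) ≤ 1) (hA4 : 4 ≤ #A) {a : G} (ha : a ∈ A.erase 0)
    (Hf : Finset G)
    (hHf : ∀ g, g ∈ Hf ↔ g ∈ AddSubgroup.closure (((A.erase 0).image (a - ·) : Finset G) : Set G))
    (Z : Finset G) (hZ : Z.Nonempty)
    (hZH : ∀ z ∈ Z, ∀ z' ∈ Z,
      z - z' ∈ AddSubgroup.closure (((A.erase 0).image (a - ·) : Finset G) : Set G)) :
    min #Hf (#Z + #A - 2) ≤ #(Z + (A.erase 0).image (a - ·)) := by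
  classical
  set U : Finset G := (A.erase 0).image (a - ·) with hU
  set H := AddSubgroup.closure (U : Set G) with hH
  have h0U : (0 : G) ∈ U := mem_image.2 ⟨a, ha, sub_self a⟩
  have hUcard : #U = #A - 1 := by
    rw [hU, card_image_of_injective _ sub_right_injective, card_erase_of_mem h0A]
  have hU3 : 3 ≤ #U := by rw [hUcard]; omega
  have hUsub : U ⊆ a +ᵥ (-A) := by
    intro u hu
    rw [hU, mem_image] at hu
    obtain ⟨z, hz, rfl⟩ := hu
    exact mem_vadd_finset.2 ⟨-z, by rw [mem_neg', neg_neg]; exact mem_of_mem_erase hz,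
      by rw [vadd_eq_add, sub_eq_add_neg]⟩
  have hsidU : ∀ g : G, g ≠ 0 → #(U ∩ (g +ᵥ U)) ≤ 2 := by
    intro g hg
    have h1 : U ∩ (g +ᵥ U) ⊆ (a +ᵥ (-A)) ∩ ((g + a) +ᵥ (-A)) := by
      refine inter_subset_inter hUsub ?_
      rw [← vadd_vadd]
      exact vadd_finset_subset_vadd_finset hUsub
    have h2 := card_inter_vadd_vadd_le_one (sidonLike_neg hsid) (show a ≠ g + a from
      fun e => hg (by have := e; rw [eq_comm, add_eq_right] at this; exact this))
    have := card_le_card h1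
    omega
  have hHfcard : #Hf = Nat.card ↥H := by
    have e : Hf = univ.filter (fun g : G => g ∈ H) := by
      ext g; simp only [mem_filter, mem_univ, true_and]; exact hHf g
    rw [e, ← Fintype.card_subtype, Nat.card_eq_fintype_card]
  obtain ⟨z₀, hz₀⟩ := hZ
  set P := -z₀ +ᵥ Z with hP
  have hPH : ∀ g ∈ P, g ∈ H := by
    intro g hg
    obtain ⟨z, hz, rfl⟩ := mem_vadd_finset.1 hg
    have := hZH z hz z₀ hz₀
    rwa [vadd_eq_add, neg_add_eq_sub]
  have hPne : P.Nonempty := ⟨-z₀ +ᵥ z₀, mem_vadd_finset.2 ⟨z₀, hz₀, rfl⟩⟩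
  have hPc : #P = #Z := card_vadd_finset _ _
  have hPUc : #(P + U) = #(Z + U) := by
    rw [hP, ← singleton_add, add_assoc, singleton_add, card_vadd_finset]
  by_cases hle : #(P + U) + 1 ≤ Nat.card ↥H
  · have := card_add_card_le_succ_of_subset_closure h0U hU3 hsidU hPH hPne hle
    rw [hPc, hPUc, hUcard] at this
    apply min_le_of_right_le
    omega
  · apply min_le_of_left_le
    rw [hHfcard]
    omega

/-- **The Fainting Lemma inside the subgroup `⟨A⟩`, general `|A| ≥ 4`:** for a Sidon-like `A ∋ 0`
with `4 ≤ |A| ≤ m + 3` and `0 ∈ P ⊆ ⟨A⟩` with `|P + A| = |P| + |A| + m`, `P + A = P + A*` and the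
layer inclusion `N₂(P, A) − A* ⊆ P + A`, one has `|⟨A⟩| ≤ |P| + C(m+4, 2)` (`fainting` in `⟨A⟩`,
with hypothesis (i) supplied by `fainting_hyp_of_sidonLike`, transported to the ambient group;
the case `|A| = 3` is `fainting_three_of_subset_closure`). [cite: HamidouneSerraZemor2008, §4,
Lemma 19; §5 (proof of Theorem 21)] -/
theorem fainting_of_subset_closure {A P : Finset G} (h0A : (0 : G) ∈ A)
    (hsid : ∀ x : G, x ≠ 0 → #(A ∩ (x +ᵥ A)) ≤ 1) (hA4 : 4 ≤ #A) {m : ℕ} (hAm : #A ≤ m + 3)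
    (h0P : (0 : G) ∈ P) (hP : ∀ g ∈ P, g ∈ AddSubgroup.closure (A : Set G))
    (hm : #(P + A) = #P + #A + m) (hii : P + A = P + A.erase 0)
    (hN : ∀ z ∈ (P + A + A) \ (P + A), ∀ h ∈ A.erase 0, z + -h ∈ P + A) :
    Nat.card (AddSubgroup.closure (A : Set G)) ≤ #P + (m + 3) * (m + 4) / 2 := by
  classical
  haveI : Fintype ↥(AddSubgroup.closure (A : Set G)) := Fintype.ofFinite _
  have hAQ : ∀ g ∈ A, g ∈ AddSubgroup.closure (A : Set G) :=
    fun g hg => AddSubgroup.subset_closure hg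
  have hAeQ : ∀ g ∈ A.erase 0, g ∈ AddSubgroup.closure (A : Set G) :=
    fun g hg => hAQ g (mem_of_mem_erase hg)
  have hPAQ : ∀ g ∈ P + A, g ∈ AddSubgroup.closure (A : Set G) := by
    intro g hg
    obtain ⟨x, hx, y, hy, rfl⟩ := mem_add.1 hg
    exact AddSubgroup.add_mem _ (hP x hx) (hAQ y hy)
  have hPAAQ : ∀ g ∈ P + A + A, g ∈ AddSubgroup.closure (A : Set G) := by
    intro g hg
    obtain ⟨x, hx, y, hy, rfl⟩ := mem_add.1 hg
    exact AddSubgroup.add_mem _ (hPAQ x hx) (hAQ y hy)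
  set Q := AddSubgroup.closure (A : Set G) with hQ
  -- an element `a ∈ A*`
  obtain ⟨a, ha⟩ : (A.erase 0).Nonempty := card_pos.1 (by rw [card_erase_of_mem h0A]; omega)
  have ha' := ha
  rw [mem_erase] at ha'
  have haQ : a ∈ Q := hAQ a ha'.2
  set a' : ↥Q := ⟨a, haQ⟩ with hadef
  have ha'0 : a' ≠ 0 := fun h => ha'.1 (by rw [Subtype.ext_iff] at h; exact h)
  set A' : Finset ↥Q := univ.filter (fun x : ↥Q => (x : G) ∈ A) with hA'
  set P' : Finset ↥Q := univ.filter (fun x : ↥Q => (x : G) ∈ P) with hP'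
  have h0A' : (0 : ↥Q) ∈ A' := by rw [hA', mem_filter]; exact ⟨mem_univ _, h0A⟩
  have h0P' : (0 : ↥Q) ∈ P' := by rw [hP', mem_filter]; exact ⟨mem_univ _, h0P⟩
  have hA'c : #A' = #A := by rw [hA', card_filter_subtype_eq Q A hAQ]
  have hsid' : ∀ x : ↥Q, x ≠ 0 → #(A' ∩ (x +ᵥ A')) ≤ 1 := fun x hx =>
    le_trans (card_inter_vadd_filter_subtype_le Q A x)
      (hsid (x : G) fun h => hx (Subtype.ext h))
  have hgen' : AddSubgroup.closure (A' : Set ↥Q) = ⊤ := by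
    have e : (A' : Set ↥Q) = Subtype.val ⁻¹' (A : Set G) := by ext x; simp [hA']
    rw [e]
    exact AddSubgroup.closure_closure_coe_preimage
  have hA'e : A'.erase 0 = univ.filter (fun x : ↥Q => (x : G) ∈ A.erase 0) :=
    filter_subtype_erase_zero Q A
  have ha'mem : a' ∈ A'.erase 0 := by
    rw [hA'e, mem_filter]; exact ⟨mem_univ _, ha⟩
  set U' : Finset ↥Q := (A'.erase 0).image (a' - ·) with hU'
  set H' := AddSubgroup.closure (U' : Set ↥Q) with hH'
  set Hf' : Finset ↥Q := univ.filter (fun x : ↥Q => x ∈ H') with hHf'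
  have hHf'' : ∀ g : ↥Q, g ∈ Hf' ↔ g ∈ H' := fun g => by rw [hHf', mem_filter]; simp
  have hUH' : ∀ z ∈ A'.erase 0, a' - z ∈ H' := fun z hz =>
    AddSubgroup.subset_closure (mem_coe.2 (mem_image.2 ⟨z, hz, rfl⟩))
  have hi' : ∀ Z : Finset ↥Q, Z.Nonempty → (∀ z ∈ Z, ∀ z' ∈ Z, z - z' ∈ H') →
      min #Hf' (#Z + #A' - 2) ≤ #(Z + (A'.erase 0).image (a' - ·)) := fun Z hZ hZH =>
    fainting_hyp_of_sidonLike h0A' hsid' (by rw [hA'c]; exact hA4) ha'mem Hf' hHf'' Z hZ hZH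
  have hcardQ : Fintype.card ↥Q = Nat.card ↥Q := (Nat.card_eq_fintype_card).symm
  have hsum : P' + A' = univ.filter (fun x : ↥Q => (x : G) ∈ P + A) := by
    rw [hP', hA', filter_subtype_add Q P A hP hAQ]
  have hsum2 : P' + A' + A' = univ.filter (fun x : ↥Q => (x : G) ∈ P + A + A) := by
    rw [hsum, hA', filter_subtype_add Q (P + A) A hPAQ hAQ]
  have hm' : #(P' + A') = #P' + #A' + m := by
    rw [hsum, card_filter_subtype_eq Q _ hPAQ, hP', card_filter_subtype_eq Q P hP, hA'c, hm]
  have hii' : P' + A' = P' + A'.erase 0 := by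
    rw [hsum, hii, hA'e, hP', filter_subtype_add Q P (A.erase 0) hP hAeQ]
  have hN' : ∀ z ∈ (P' + A' + A') \ (P' + A'), ∀ h ∈ A'.erase 0, z + -h ∈ P' + A' := by
    rw [hsum2, hsum, ← filter_subtype_sdiff, hA'e]
    intro z hz h hh
    rw [mem_filter] at hz hh ⊢
    refine ⟨mem_univ _, ?_⟩
    have := hN (z : G) hz.2 (h : G) hh.2
    simpa using this
  have := fainting H' Hf' hHf'' h0P' h0A' hgen' (by rw [hA'c]; omega) (by rw [hA'c]; exact hAm)
    hm' ha'mem hUH' hi' hii' hN'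
  rwa [hP', card_filter_subtype_eq Q P hP, hcardQ] at this

/-! ### Theorem 21 for every defect `m ≤ 4` -/

/-- **[HamidouneSerraZemor2008, Theorem 21], every `m ≤ 4`, in any finite abelian group:**
"Let `G` be a finite abelian group and let `0 ∈ S` be a generating `2`-separable subset of `G`
such that `|S| ≥ 3` and `κ₂(S) − |S| = m ≤ 4`.  Let `A` be a `2`-atom of `S` containing `0`.  If
`|S| < |G| − C(m+4, 2)` then either `|A| = 2` or `A` is a subgroup of `G`."  Here with the
defect carried as an upper bound `κ₂(S) ≤ |S| + m`, `m ≤ 4` (the printed hypothesis for the exact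
defect `m' ≤ m` follows, `C(m'+4,2) ≤ C(m+4,2)`), `|S| + C(m+4,2) < |G|`, and without the
unused hypotheses "`S` generating, `|S| ≥ 3`".  Proof as printed (§5, p0009–0010): defect `−1` is
Corollary 6.3; else `A` not a subgroup with `|A| ≥ 3` is Sidon-like (Corollary 9), `|A| ≤ m + 3`
(Corollary 12), and the Fainting Lemma settles a generating `A`; otherwise decompose `S` modulo
`Q = ⟨A⟩` into pieces `S_c` (`|S_c| ≥ 2`, Lemma 4) with excess `f(c) = |S_c + A| − |S_c|`
(`Σ f = |A| + m`) and defect `δ(c) = |Q| − |S_c + A|`; `δ = 1 ⇒ f ≥ |A| − 1` (Lemma 10 in `Q`),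
`δ ≥ 2 ⇒ f ≥ 2|A| − 3` (Lemma 11 in `Q`), `f = 0 ⇒ δ = 0`; hence `w ≤ 2`, `v ≤ 3`; Case 1
(`S + Q ≠ G`): `Σ δ ≥ |Q| − |A| ≥ 4`, some `W`-coset, `δ(W) > δ(i)` (`|S_i| + m_i ≥ 3`, by
Lemma 20 when `|A| = 3`), so `w = 2`, `v = 0`, `|A| = 3`, `m_1 + m_2 ≤ 1`, `δ(i) ≥ 4`, and the
Fainting Lemma for `S_1` (say `m_1 = 0`) gives `6 ≥ 3 + δ(1) ≥ 7`; Case 2 (`S + Q = G`):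
`v + δ(W) ≥ 1 + C(m+4,2) − |A| − m ≥ 4`, `w ≥ 1`; `w = 1` contradicts the Fainting Lemma for
`S_1` (`|Q| − |S_1| ≥ 1 + C(m_1+4,2)`), and `w = 2` forces `|A| = 3`, `v = 0`, `m_1 + m_2 ≤ 1`,
`m ≥ 3` and `2|A| + m_1 + m_2 + δ(1) + δ(2) ≤ 16` against `≥ 22`.
[cite: HamidouneSerraZemor2008, §5, Theorem 21] -/
theorem IsAtom.exists_addSubgroup_or_card_eq_two_of_conn_le_add {S : Finset G} (h0 : (0 : G) ∈ S)
    {m : ℕ} (hm4 : m ≤ 4) (hκ : conn 2 S ≤ #S + m)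
    (hSn : #S + (m + 3) * (m + 4) / 2 + 1 ≤ Fintype.card G) {A : Finset G} (hA : IsAtom 2 S A)
    (h0A : (0 : G) ∈ A) : (∃ K : AddSubgroup G, (K : Set G) = A) ∨ #A = 2 := by
  classical
  -- defect `−1`: Corollary 6.3
  by_cases hneg : conn 2 S + 1 ≤ #S
  · exact hA.exists_addSubgroup_or_card_eq_two h0 h0A hneg
  push Not at hneg
  -- the exact defect `μ ≤ m`
  obtain ⟨μ, hμ⟩ : ∃ μ, conn 2 S = #S + μ := ⟨conn 2 S - #S, by omega⟩
  have hμm : μ ≤ m := by omega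
  have hμ4 : μ ≤ 4 := hμm.trans hm4
  have hevenm : (m + 3) * (m + 4) / 2 * 2 = (m + 3) * (m + 4) :=
    Nat.div_mul_cancel (Nat.even_mul_succ_self (m + 3)).two_dvd
  have hevenμ : (μ + 3) * (μ + 4) / 2 * 2 = (μ + 3) * (μ + 4) :=
    Nat.div_mul_cancel (Nat.even_mul_succ_self (μ + 3)).two_dvd
  have hSnμ : #S + (μ + 3) * (μ + 4) / 2 + 1 ≤ Fintype.card G := by
    have : (μ + 3) * (μ + 4) ≤ (m + 3) * (m + 4) := Nat.mul_le_mul (by omega) (by omega)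
    omega
  clear hSn hκ hμm hm4 hevenm m
  by_contra hcon
  rw [not_or, not_exists] at hcon
  obtain ⟨hnot, hA2⟩ := hcon
  have hAa := hA.1.1
  unfold IsAdm at hAa
  have hAf := hA.1.2
  have hASc : #(A + S) = #S + #A + μ := by
    have := card_le_card_add h0 A
    omega
  have hA3 : 3 ≤ #A := by omega
  -- `|A| ≤ μ + 3` (Corollary 12 / Theorem 6.2)
  have hAμ : #A ≤ μ + 3 := by
    by_contra hlt
    obtain ⟨K, hK⟩ := hA.exists_addSubgroup_of_le h0 h0A (by omega)
    exact hnot K hK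
  -- Sidon-like, `A + S = A* + S`, layer inclusion
  have hsid : ∀ x : G, x ≠ 0 → #(A ∩ (x +ᵥ A)) ≤ 1 := fun x hx =>
    hA.card_inter_vadd_le_one_of_forall_ne h0 h0A hnot hx
  have hsid2 : ∀ x : G, x ≠ 0 → #(A ∩ (x +ᵥ A)) ≤ 2 := fun x hx => (hsid x hx).trans one_le_two
  have hAerase : ∀ a ∈ A, A.erase a + S = A + S := fun a ha => hA.erase_add_eq h0 hA3 ha
  have hSA : S + A = S + A.erase 0 := by rw [add_comm S A, add_comm S, hAerase 0 h0A]
  have hN1 : ∀ z ∈ (A + S + A) \ (A + S), ∀ h ∈ A.erase 0, z + -h ∈ (A + S) \ S :=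
    fun z hz h hh => hA.add_neg_mem_sdiff_of_mem_sdiff h0 h0A hz hh
  set Q := AddSubgroup.closure (A : Set G) with hQ
  have hAQ : (A : Set G) ⊆ Q := AddSubgroup.subset_closure
  have hAQ' : ∀ g ∈ A, g ∈ Q := fun g hg => hAQ hg
  have hAeQ : ∀ a, ((A.erase a : Finset G) : Set G) ⊆ Q := fun a g hg =>
    hAQ (mem_coe.2 (mem_of_mem_erase (mem_coe.1 hg)))
  -- the Fainting Lemma in `Q` for a piece `P ∋ 0` (both `|A| = 3` and `|A| ≥ 4`)
  have hfaint : ∀ P : Finset G, (0 : G) ∈ P → (∀ g ∈ P, g ∈ Q) → ∀ m₁ : ℕ, #A ≤ m₁ + 3 →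
      #(P + A) = #P + #A + m₁ → P + A = P + A.erase 0 →
      (∀ z ∈ (P + A + A) \ (P + A), ∀ h ∈ A.erase 0, z + -h ∈ P + A) →
      Nat.card ↥Q ≤ #P + (m₁ + 3) * (m₁ + 4) / 2 := by
    intro P h0P hPQ m₁ hAm₁ hmP hiiP hNP
    by_cases hA4 : 4 ≤ #A
    · exact fainting_of_subset_closure h0A hsid hA4 hAm₁ h0P hPQ hmP hiiP hNP
    · have hA3' : #A = 3 := by omega
      obtain ⟨a, b, ha, hb, hAeq⟩ : ∃ a b : G, a ≠ 0 ∧ b ≠ 0 ∧ A = {0, a, b} := by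
        obtain ⟨x, y, z, hxy, hxz, hyz, hxyz⟩ := card_eq_three.1 hA3'
        have h0A' := h0A
        rw [hxyz, mem_insert, mem_insert, mem_singleton] at h0A'
        rcases h0A' with h | h | h
        · exact ⟨y, z, fun e => hxy (h.symm.trans e.symm), fun e => hxz (h.symm.trans e.symm),
            by rw [hxyz, h]⟩
        · refine ⟨x, z, fun e => hxy (e.trans h), fun e => hyz (h.symm.trans e.symm), ?_⟩
          rw [hxyz, ← h]
          exact insert_comm _ _ _
        · refine ⟨x, y, fun e => hxz (e.trans h), fun e => hyz (e.trans h), ?_⟩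
          rw [hxyz, ← h]
          ext v; simp only [mem_insert, mem_singleton]; tauto
      have hmP' : #(P + A) = #P + 3 + m₁ := by rw [hmP, hA3']
      exact fainting_three_of_subset_closure ha hb hAeq h0P hPQ hmP' hiiP hNP
  -- Case `A` generates `G`: the Fainting Lemma for `S` itself
  by_cases hQtop : Q = ⊤
  · have hSQ : ∀ g ∈ S, g ∈ Q := fun g _ => by rw [hQtop]; exact AddSubgroup.mem_top g
    have hmS : #(S + A) = #S + #A + μ := by rw [add_comm]; exact hASc
    have hNS : ∀ z ∈ (S + A + A) \ (S + A), ∀ h ∈ A.erase 0, z + -h ∈ S + A := by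
      intro z hz h hh
      rw [add_comm S A] at hz ⊢
      exact (mem_sdiff.1 (hN1 z hz h hh)).1
    have := hfaint S h0 hSQ μ hAμ hmS hSA hNS
    rw [hQtop, AddSubgroup.card_top, Nat.card_eq_fintype_card] at this
    omega
  -- `Q ≠ G`: decomposition modulo `Q`
  haveI : Fintype ↥Q := Fintype.ofFinite _
  set Qf : Finset G := (univ : Finset ↥Q).image (fun x : ↥Q => (x : G)) with hQfdef
  have hQf : ∀ g, g ∈ Qf ↔ g ∈ Q := fun g => by
    rw [hQfdef, mem_image]
    constructor
    · rintro ⟨x, -, rfl⟩; exact x.2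
    · intro hg; exact ⟨⟨g, hg⟩, mem_univ _, rfl⟩
  have hQfcard : #Qf = Nat.card ↥Q := by
    rw [hQfdef, card_image_of_injective _ Subtype.val_injective, card_univ,
      Nat.card_eq_fintype_card]
  -- `|Q| ≥ |A|(|A| − 1) + 1 ≥ |A| + 4`
  have hqA : #A + 4 ≤ #Qf := by
    have h1 := card_mul_card_sub_one_lt_card_of_forall_sub_mem hsid
      (fun α hα β hβ => (hQf _).2 (Q.sub_mem (hAQ' α hα) (hAQ' β hβ))) ⟨0, h0A⟩
    have h2 : #A + 3 ≤ #A * (#A - 1) := by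
      obtain ⟨k, hk⟩ : ∃ k, #A = k + 3 := ⟨#A - 3, by omega⟩
      rw [hk, show k + 3 - 1 = k + 2 by omega]
      nlinarith
    omega
  set I : Finset (G ⧸ Q) := S.image (fun s : G => (s : G ⧸ Q)) with hI
  set pc : G ⧸ Q → Finset G := fun c => S.filter (fun s : G => (s : G ⧸ Q) = c) with hpc
  have hpc_ne : ∀ c ∈ I, ∃ s₀ ∈ S, (s₀ : G ⧸ Q) = c ∧ s₀ ∈ pc c := by
    intro c hc
    obtain ⟨s₀, hs₀, rfl⟩ := mem_image.1 hc
    exact ⟨s₀, hs₀, rfl, mem_filter.2 ⟨hs₀, rfl⟩⟩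
  have hpcS : ∀ c, pc c ⊆ S := fun c => filter_subset _ _
  have hsumA : #(S + A) = ∑ c ∈ I, #(pc c + A) := card_add_eq_sum_card_filter_add Q S A hAQ
  have hsumS : #S = ∑ c ∈ I, #(pc c) :=
    card_eq_sum_card_fiberwise fun s hs => mem_image_of_mem _ hs
  have hpc_le : ∀ c, #(pc c) ≤ #(pc c + A) := fun c => card_le_card_add h0A _
  have hle_q : ∀ c ∈ I, #(pc c + A) ≤ #Qf := by
    intro c hc
    obtain ⟨s₀, -, hs₀, -⟩ := hpc_ne c hc
    have := card_le_card (filter_add_subset_vadd Q Qf hQf S A hAQ hs₀)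
    rwa [card_vadd_finset] at this
  have hSQc : #(S + Qf) = #I * #Qf := card_add_eq_card_image_mul Q Qf hQf S
  have hSA' : #(S + A) = #S + #A + μ := by rw [add_comm]; exact hASc
  have hsum_f : ∑ c ∈ I, (#(pc c + A) - #(pc c)) = #A + μ := by
    have e : ∑ c ∈ I, #(pc c + A) = ∑ c ∈ I, #(pc c) + ∑ c ∈ I, (#(pc c + A) - #(pc c)) := by
      rw [← sum_add_distrib]
      exact sum_congr rfl fun c _ => by have := hpc_le c; omega
    omega
  have hsum_δ : ∑ c ∈ I, (#Qf - #(pc c + A)) + #(S + A) = #(S + Qf) := by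
    rw [hSQc, hsumA]
    have e : ∑ c ∈ I, (#Qf - #(pc c + A)) + ∑ c ∈ I, #(pc c + A) = ∑ c ∈ I, #Qf := by
      rw [← sum_add_distrib]
      exact sum_congr rfl fun c hc => by have := hle_q c hc; omega
    rw [e, sum_const, smul_eq_mul]
  -- pieces: coset-wise identities
  have hpcA : ∀ c, pc c + A = (S + A).filter (fun x : G => (x : G ⧸ Q) = c) := fun c => by
    rw [hpc, filter_add_eq_filter_add Q S A hAQ c]
  have hpcAe : ∀ c, ∀ a ∈ A, pc c + A = pc c + A.erase a := by
    intro c a ha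
    rw [hpcA, hpc, ← filter_add_eq_filter_add Q S (A.erase a) (hAeQ a) c, add_comm S (A.erase a),
      hAerase a ha, add_comm]
  -- `|S_c| ≥ 2`
  have hpc2 : ∀ c ∈ I, 2 ≤ #(pc c) := by
    intro c hc
    obtain ⟨s₀, hs₀S, hs₀, hs₀pc⟩ := hpc_ne c hc
    by_contra hlt
    have h1 : #(pc c) = 1 := by have := card_pos.2 ⟨s₀, hs₀pc⟩; omega
    obtain ⟨s, hs⟩ := card_eq_one.1 h1
    have e1 := hpcAe c 0 h0A
    rw [hs] at e1
    have : s ∈ ({s} : Finset G) + A := mem_add.2 ⟨s, mem_singleton_self s, 0, h0A, add_zero s⟩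
    rw [e1, singleton_add, mem_vadd_finset] at this
    obtain ⟨y, hy, hsy⟩ := this
    rw [mem_erase] at hy
    rw [vadd_eq_add] at hsy
    exact hy.1 (add_eq_left.1 hsy)
  -- translating a piece into `Q`
  have hpiece : ∀ c ∈ I, ∃ P : Finset G, (0 : G) ∈ P ∧ (∀ g ∈ P, g ∈ Q) ∧ #P = #(pc c) ∧
      #(P + A) = #(pc c + A) ∧ P + A = P + A.erase 0 ∧
      (∀ a ∈ A, P + A = P + A.erase a) ∧
      (∀ z ∈ (P + A + A) \ (P + A), ∀ h ∈ A.erase 0, z + -h ∈ P + A) := by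
    intro c hc
    obtain ⟨s₀, hs₀S, hs₀, hs₀pc⟩ := hpc_ne c hc
    have hva : ∀ (X Y : Finset G), (-s₀ +ᵥ X) + Y = -s₀ +ᵥ (X + Y) := fun X Y => by
      rw [← singleton_add, ← singleton_add, add_assoc]
    refine ⟨-s₀ +ᵥ pc c, mem_vadd_finset.2 ⟨s₀, hs₀pc, by rw [vadd_eq_add, neg_add_cancel]⟩,
      ?_, card_vadd_finset _ _, ?_, ?_, ?_, ?_⟩
    · intro g hg
      obtain ⟨s, hs, rfl⟩ := mem_vadd_finset.1 hg
      rw [hpc, mem_filter] at hs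
      exact QuotientAddGroup.eq.1 (hs₀.trans hs.2.symm)
    · rw [hva, card_vadd_finset]
    · rw [hva, hva, ← hpcAe c 0 h0A]
    · intro a ha
      rw [hva, hva, ← hpcAe c a ha]
    · intro z hz h hh
      have hPA : (-s₀ +ᵥ pc c) + A = -s₀ +ᵥ (pc c + A) := hva _ _
      have hPAA : (-s₀ +ᵥ pc c) + A + A = -s₀ +ᵥ (pc c + A + A) := by rw [hPA, hva]
      rw [hPAA, hPA, ← vadd_finset_sdiff, mem_vadd_finset] at hz
      obtain ⟨w, hw, rfl⟩ := hz
      rw [mem_sdiff] at hw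
      have hhQ : h ∈ Q := hAeQ 0 hh
      have hwQ : (w : G ⧸ Q) = c := by
        obtain ⟨u, hu, α, hα, rfl⟩ := mem_add.1 hw.1
        rw [hpcA, mem_filter] at hu
        rw [QuotientAddGroup.mk_add, (QuotientAddGroup.eq_zero_iff α).2 (hAQ' α hα), add_zero]
        exact hu.2
      have hw' : w ∈ (A + S + A) \ (A + S) := by
        rw [mem_sdiff]
        refine ⟨?_, fun hwAS => hw.2 ?_⟩
        · have : pc c + A + A ⊆ A + S + A := by
            rw [add_comm A S]
            exact add_subset_add_right (add_subset_add_right (hpcS c))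
          exact this hw.1
        · rw [hpcA, mem_filter]
          exact ⟨by rwa [add_comm] at hwAS, hwQ⟩
      have h1 := hN1 w hw' h hh
      rw [mem_sdiff] at h1
      have h2 : w + -h ∈ pc c + A := by
        rw [hpcA, mem_filter]
        refine ⟨by rw [add_comm S A]; exact h1.1, ?_⟩
        rw [QuotientAddGroup.mk_add, QuotientAddGroup.mk_neg,
          (QuotientAddGroup.eq_zero_iff h).2 hhQ, neg_zero, add_zero, hwQ]
      rw [hPA]
      exact mem_vadd_finset.2 ⟨w + -h, h2, by rw [vadd_eq_add, vadd_eq_add]; abel⟩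
  -- the three bounds on the excess of a piece
  have hfull : ∀ c ∈ I, #(pc c + A) - #(pc c) = 0 → #Qf - #(pc c + A) = 0 := by
    intro c hc hf
    obtain ⟨s₀, hs₀S, hs₀, hs₀pc⟩ := hpc_ne c hc
    have hsub := filter_add_subset_vadd Q Qf hQf S A hAQ hs₀
    have heq : pc c + A = pc c :=
      (eq_of_subset_of_card_le (subset_add_left _ h0A) (by have := hpc_le c; omega)).symm
    have hP : pc c ⊆ s₀ +ᵥ Qf := (subset_add_left _ h0A).trans hsub
    have := card_eq_of_add_eq_of_closure_eq Q Qf hQf rfl hs₀pc hP heq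
    rw [heq, this]; simp
  have hV : ∀ c ∈ I, #(pc c + A) + 1 ≤ #Qf → #(pc c) + #A ≤ #(pc c + A) + 1 := by
    intro c hc hδ
    obtain ⟨P, -, hPQ, hPc, hPAc, -, -, -⟩ := hpiece c hc
    have := card_add_card_le_succ_of_subset_closure h0A hA3 hsid2 hPQ
      (card_pos.1 (by rw [hPc]; have := hpc2 c hc; omega)) (by rw [hPAc, ← hQfcard]; exact hδ)
    rwa [hPc, hPAc] at this
  have hW : ∀ c ∈ I, #(pc c + A) + 2 ≤ #Qf → #(pc c) + 2 * #A ≤ #(pc c + A) + 3 := by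
    intro c hc hδ
    obtain ⟨P, -, hPQ, hPc, hPAc, -, -, -⟩ := hpiece c hc
    have := card_add_two_mul_le_card_add_of_subset_closure h0A hA3 hsid hPQ
      (by rw [hPc]; exact hpc2 c hc) (by rw [hPAc, ← hQfcard]; exact hδ)
    rwa [hPc, hPAc] at this
  -- the Fainting Lemma for a piece, and Lemma 20 for a piece
  have hFpc : ∀ c ∈ I, ∀ m₁ : ℕ, #A ≤ m₁ + 3 → #(pc c + A) = #(pc c) + #A + m₁ →
      #Qf ≤ #(pc c) + (m₁ + 3) * (m₁ + 4) / 2 := by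
    intro c hc m₁ hAm₁ hmc
    obtain ⟨P, h0P, hPQ, hPc, hPAc, hiiP, -, hNP⟩ := hpiece c hc
    have := hfaint P h0P hPQ m₁ hAm₁ (by rw [hPAc, hPc, hmc]) hiiP hNP
    rwa [hPc, ← hQfcard] at this
  have hBigS : ∀ c ∈ I, #A = 3 → 2 * #(pc c + A) ≤ 3 * #(pc c) := by
    intro c hc hA3'
    obtain ⟨P, -, -, hPc, hPAc, -, hPe, -⟩ := hpiece c hc
    have := two_mul_card_add_le_three_mul_card hA3' hPe
    rwa [hPc, hPAc] at this
  clear_value pc I Qf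
  clear hAf hneg
  -- names for excess and defect
  obtain ⟨f, hf⟩ : ∃ f : G ⧸ Q → ℕ, ∀ c, f c = #(pc c + A) - #(pc c) := ⟨_, fun _ => rfl⟩
  obtain ⟨δ, hδdef⟩ : ∃ δ : G ⧸ Q → ℕ, ∀ c, δ c = #Qf - #(pc c + A) := ⟨_, fun _ => rfl⟩
  have hsum_f' : ∑ c ∈ I, f c = #A + μ := by
    rw [← hsum_f]; exact sum_congr rfl fun c _ => hf c
  have hsum_δ' : ∑ c ∈ I, δ c + #(S + A) = #(S + Qf) := by
    rw [← hsum_δ, sum_congr rfl fun c _ => hδdef c]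
  have hfq : ∀ c ∈ I, #Qf = #(pc c) + f c + δ c := by
    intro c hc
    have := hle_q c hc; have := hpc_le c
    rw [hf, hδdef]; omega
  -- the two cases give `Σ δ`:
  have hcase : (S + Qf = univ ∧ Fintype.card G = ∑ c ∈ I, δ c + #(S + A)) ∨
      (S + Qf ≠ univ ∧ #Qf + #S + μ ≤ #(S + Qf)) := by
    by_cases huniv : S + Qf = univ
    · left
      rw [huniv, card_univ] at hsum_δ'
      exact ⟨huniv, hsum_δ'.symm⟩
    · right
      have hle := card_add_add_card_le_of_ne_univ Q Qf hQf S huniv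
      have hadm : IsAdm 2 S Qf := ⟨by omega, by rw [add_comm Qf S]; omega⟩
      have hκQ := conn_le hadm
      rw [add_comm Qf S] at hκQ
      have := card_le_card_add h0 Qf
      rw [add_comm Qf S] at this
      exact ⟨huniv, by omega⟩
  -- `C(μ+4,2) ≥ 2μ + 6`
  have hC6 : 2 * μ + 6 ≤ (μ + 3) * (μ + 4) / 2 := by
    interval_cases μ <;> norm_num
  -- `V` (defect 1) and `W` (defect ≥ 2)
  set V := I.filter (fun c => δ c = 1) with hV'
  set W := I.filter (fun c => 2 ≤ δ c) with hW'
  have hVsub : V ⊆ I := by rw [hV']; exact filter_subset _ _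
  have hWsub : W ⊆ I := by rw [hW']; exact filter_subset _ _
  have hVW : Disjoint V W := by
    rw [hV', hW', disjoint_filter]; intro c _ h1 h2; omega
  have hfV : ∀ c ∈ V, #A - 1 ≤ f c := by
    intro c hc
    rw [hV', mem_filter] at hc
    have h1 := hδdef c
    have := hV c hc.1 (by omega)
    rw [hf]; omega
  have hfW : ∀ c ∈ W, 2 * #A - 3 ≤ f c := by
    intro c hc
    rw [hW', mem_filter] at hc
    have h1 := hδdef c
    have := hW c hc.1 (by omega)
    rw [hf]; omega
  have hmW : ∀ c ∈ W, #A ≤ f c := fun c hc => by have := hfW c hc; omega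
  have hVf : #V * (#A - 1) ≤ ∑ c ∈ V, f c := by
    have := card_nsmul_le_sum V f (#A - 1) hfV
    rwa [smul_eq_mul] at this
  have hWf : #W * (2 * #A - 3) ≤ ∑ c ∈ W, f c := by
    have := card_nsmul_le_sum W f (2 * #A - 3) hfW
    rwa [smul_eq_mul] at this
  have hsumVW : ∑ c ∈ V, f c + ∑ c ∈ W, f c ≤ #A + μ := by
    rw [← hsum_f']
    rw [← sum_union hVW]
    exact sum_le_sum_of_subset_of_nonneg (union_subset hVsub hWsub) fun _ _ _ => Nat.zero_le _
  -- `Σ_I δ = |V| + Σ_W δ`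
  have hδsplit : ∑ c ∈ I, δ c = #V + ∑ c ∈ W, δ c := by
    rw [← sum_filter_add_sum_filter_not I (fun c => δ c = 1)]
    have h1 : ∑ c ∈ I.filter (fun c => δ c = 1), δ c = #V := by
      rw [card_eq_sum_ones, hV']
      exact sum_congr rfl fun c hc => (mem_filter.1 hc).2
    have h2 : ∑ c ∈ I.filter (fun c => ¬ δ c = 1), δ c = ∑ c ∈ W, δ c := by
      rw [← sum_filter_add_sum_filter_not (I.filter fun c => ¬ δ c = 1) (fun c => 2 ≤ δ c)]
      have h3 : (I.filter fun c => ¬ δ c = 1).filter (fun c => 2 ≤ δ c) = W := by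
        rw [hW', filter_filter]
        exact filter_congr fun c _ => ⟨fun h => h.2, fun h => ⟨by omega, h⟩⟩
      have h4 : ∑ c ∈ (I.filter fun c => ¬ δ c = 1).filter (fun c => ¬ 2 ≤ δ c), δ c = 0 :=
        sum_eq_zero fun c hc => by
          simp only [mem_filter] at hc
          omega
      rw [h3, h4, add_zero]
    rw [h1, h2]
  clear_value V W
  -- `w ≤ 2`, `v ≤ 3`
  have hw2 : #W ≤ 2 := by
    by_contra h
    have : 3 * (2 * #A - 3) ≤ #W * (2 * #A - 3) := Nat.mul_le_mul_right _ (by omega)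
    omega
  have hv3 : #V ≤ 3 := by
    by_contra h
    have : 4 * (#A - 1) ≤ #V * (#A - 1) := Nat.mul_le_mul_right _ (by omega)
    omega
  -- for `i ∈ W`: `|S_i| + m_i ≥ 3` where `f i = |A| + m_i`
  have hWbig : ∀ c ∈ W, #A + 3 ≤ #(pc c) + f c := by
    intro c hc
    have hcI : c ∈ I := hWsub hc
    by_cases hA4 : 4 ≤ #A
    · have := hfW c hc; have := hpc2 c hcI; omega
    · have hA3' : #A = 3 := by omega
      have h1 := hBigS c hcI hA3'
      have h2 := hmW c hc
      have := hpc_le c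
      rw [hf] at h2 ⊢; omega
  -- Σ δ lower bounds
  have hsd4 : 4 ≤ ∑ c ∈ I, δ c := by
    rcases hcase with ⟨-, hn⟩ | ⟨-, hle⟩
    · omega
    · have : ∑ c ∈ I, δ c + #(S + A) = #(S + Qf) := hsum_δ'
      omega
  -- `w ≥ 1`
  have hw1 : 1 ≤ #W := by
    by_contra h
    have hW0 : W = ∅ := by rw [← card_eq_zero]; omega
    rw [hW0, sum_empty, add_zero] at hδsplit
    omega
  -- with `w ≥ 1`: `v ≤ 2`
  have hv2 : #V ≤ 2 := by
    by_contra h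
    have h1 : 3 * (#A - 1) ≤ #V * (#A - 1) := Nat.mul_le_mul_right _ (by omega)
    have h2 : 1 * (2 * #A - 3) ≤ #W * (2 * #A - 3) := Nat.mul_le_mul_right _ hw1
    omega
  rcases hcase with ⟨huniv, hn⟩ | ⟨huniv, hle⟩
  · -- Case 2: `S + Q = G`
    -- `v + δ(W) ≥ C + 1 − |A| − μ`
    have hhyp : #S + (μ + 3) * (μ + 4) / 2 + 1 ≤ #V + ∑ c ∈ W, δ c + (#S + #A + μ) := by
      rw [← hδsplit, ← hSA', ← hn]; exact hSnμ
    rcases Nat.lt_or_ge #W 2 with hw | hw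
    · -- `w = 1`
      have hW1 : #W = 1 := by omega
      obtain ⟨i, hWi⟩ := card_eq_one.1 hW1
      have hiW : i ∈ W := by rw [hWi]; exact mem_singleton_self i
      have hiI : i ∈ I := hWsub hiW
      rw [hWi, sum_singleton] at hhyp hδsplit
      rw [hW1, one_mul, hWi, sum_singleton] at hWf
      -- `m_i = f i − |A|`, Fainting applicable since `|A| ≤ m_i + 3`
      obtain ⟨mi, hmi⟩ : ∃ mi, f i = #A + mi := ⟨f i - #A, by have := hmW i hiW; omega⟩
      have hAmi : #A ≤ mi + 3 := by have := hfW i hiW; omega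
      have hFi := hFpc i hiI mi hAmi (by have := hpc_le i; rw [hf] at hmi; omega)
      have hqi := hfq i hiI
      -- `|Q| − |S_i| = |A| + m_i + δ_i ≥ 1 + C(m_i + 4, 2)`: two sub-cases
      have hmiμ : mi ≤ μ := by
        have := hsumVW; rw [hWi, sum_singleton] at this; omega
      rcases Nat.lt_or_ge mi μ with hlt | hge
      · -- `m_i < μ`: use `v ≤ 3`... (here even `v ≤ 2`)
        have hCC : (mi + 3) * (mi + 4) / 2 + (μ - mi) + 3 ≤ (μ + 3) * (μ + 4) / 2 := by
          have hμ' : μ ≤ 4 := hμ4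
          interval_cases μ <;> interval_cases mi <;> omega
        omega
      · -- `m_i = μ`: then all other excesses vanish, so `v = 0`
        have hmieq : mi = μ := le_antisymm hmiμ hge
        have hV0 : #V = 0 := by
          by_contra hv
          have h1 : 1 * (#A - 1) ≤ #V * (#A - 1) := Nat.mul_le_mul_right _ (by omega)
          have := hsumVW; rw [hWi, sum_singleton] at this
          omega
        subst hmieq
        omega
    · -- `w = 2`: `|A| = 3`, `v = 0`, `m₁ + m₂ ≤ 1`, `μ ≥ 3`
      have hW2 : #W = 2 := by omega
      obtain ⟨i₁, i₂, hne, hWi⟩ := card_eq_two.1 hW2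
      have hi₁W : i₁ ∈ W := by rw [hWi]; simp
      have hi₂W : i₂ ∈ W := by rw [hWi]; simp
      have hi₁I : i₁ ∈ I := hWsub hi₁W
      have hi₂I : i₂ ∈ I := hWsub hi₂W
      have hsum2 : ∑ c ∈ W, f c = f i₁ + f i₂ := by rw [hWi, sum_pair hne]
      have hsumδ2 : ∑ c ∈ W, δ c = δ i₁ + δ i₂ := by rw [hWi, sum_pair hne]
      rw [hsum2] at hsumVW hWf
      rw [hsumδ2] at hhyp hδsplit
      have hf₁ := hfW i₁ hi₁W
      have hf₂ := hfW i₂ hi₂W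
      have hA3' : #A = 3 := by omega
      rw [hA3'] at hVf hf₁ hf₂
      norm_num at hVf hf₁ hf₂
      have hV0 : #V = 0 := by omega
      obtain ⟨m₁, hm₁⟩ : ∃ m₁, f i₁ = 3 + m₁ := ⟨f i₁ - 3, by omega⟩
      obtain ⟨m₂, hm₂⟩ : ∃ m₂, f i₂ = 3 + m₂ := ⟨f i₂ - 3, by omega⟩
      have hm12 : m₁ + m₂ + 3 ≤ μ := by omega
      have hF₁ := hFpc i₁ hi₁I m₁ (by omega) (by have := hpc_le i₁; rw [hf] at hm₁; omega)
      have hF₂ := hFpc i₂ hi₂I m₂ (by omega) (by have := hpc_le i₂; rw [hf] at hm₂; omega)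
      have hq₁ := hfq i₁ hi₁I
      have hq₂ := hfq i₂ hi₂I
      have hμ3 : 3 ≤ μ := by omega
      have hCm : 4 * μ ≤ (μ + 3) * (μ + 4) / 2 := by
        interval_cases μ <;> norm_num
      have hC₁ : (m₁ + 3) * (m₁ + 4) / 2 ≤ 6 + 4 * m₁ := by
        have : m₁ ≤ 1 := by omega
        interval_cases m₁ <;> norm_num
      have hC₂ : (m₂ + 3) * (m₂ + 4) / 2 ≤ 6 + 4 * m₂ := by
        have : m₂ ≤ 1 := by omega
        interval_cases m₂ <;> norm_num
      omega
  · -- Case 1: `S + Q ≠ G`: `Σ δ ≥ |Q| − |A|`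
    have hsdQ : #Qf ≤ ∑ c ∈ I, δ c + #A := by
      have : ∑ c ∈ I, δ c + #(S + A) = #(S + Qf) := hsum_δ'
      omega
    -- every `i ∈ W` has `δ(W) > δ i`, so `w = 2`
    have hWgt : ∀ i ∈ W, δ i + 1 ≤ ∑ c ∈ W, δ c := by
      intro i hiW
      have hiI : i ∈ I := hWsub hiW
      have hq := hfq i hiI
      have hb := hWbig i hiW
      omega
    have hW2 : #W = 2 := by
      rcases Nat.lt_or_ge #W 2 with hw | hw
      · exfalso
        have hW1 : #W = 1 := by omega
        obtain ⟨i, hWi⟩ := card_eq_one.1 hW1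
        have hiW : i ∈ W := by rw [hWi]; exact mem_singleton_self i
        have := hWgt i hiW
        rw [hWi, sum_singleton] at this
        omega
      · omega
    obtain ⟨i₁, i₂, hne, hWi⟩ := card_eq_two.1 hW2
    have hi₁W : i₁ ∈ W := by rw [hWi]; simp
    have hi₂W : i₂ ∈ W := by rw [hWi]; simp
    have hi₁I : i₁ ∈ I := hWsub hi₁W
    have hi₂I : i₂ ∈ I := hWsub hi₂W
    have hsum2 : ∑ c ∈ W, f c = f i₁ + f i₂ := by rw [hWi, sum_pair hne]
    have hsumδ2 : ∑ c ∈ W, δ c = δ i₁ + δ i₂ := by rw [hWi, sum_pair hne]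
    rw [hsum2] at hsumVW hWf
    have hf₁ := hfW i₁ hi₁W
    have hf₂ := hfW i₂ hi₂W
    have hA3' : #A = 3 := by omega
    rw [hA3'] at hVf hf₁ hf₂
    norm_num at hVf hf₁ hf₂
    have hV0 : #V = 0 := by omega
    obtain ⟨m₁, hm₁⟩ : ∃ m₁, f i₁ = 3 + m₁ := ⟨f i₁ - 3, by omega⟩
    obtain ⟨m₂, hm₂⟩ : ∃ m₂, f i₂ = 3 + m₂ := ⟨f i₂ - 3, by omega⟩
    have hm12 : m₁ + m₂ + 3 ≤ μ := by omega
    have hB₁ := hBigS i₁ hi₁I hA3'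
    have hB₂ := hBigS i₂ hi₂I hA3'
    have hq₁ := hfq i₁ hi₁I
    have hq₂ := hfq i₂ hi₂I
    have hg₁ := hWgt i₁ hi₁W
    have hg₂ := hWgt i₂ hi₂W
    rw [hsumδ2] at hg₁ hg₂
    -- one of `m₁, m₂` is `0`; the Fainting Lemma for that piece
    have hp₁ := hpc_le i₁
    have hp₂ := hpc_le i₂
    rw [hf] at hm₁ hm₂
    rw [hV0, zero_add, hsumδ2] at hδsplit
    rcases Nat.eq_zero_or_pos m₁ with h0 | hpos
    · have hF₁ := hFpc i₁ hi₁I 0 (by omega) (by omega)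
      norm_num at hF₁
      omega
    · have hm₂0 : m₂ = 0 := by omega
      have hF₂ := hFpc i₂ hi₂I 0 (by omega) (by omega)
      norm_num at hF₂
      omega

/-- **Pairs at most `m ≤ 4` above the Cauchy–Davenport count, composite order (Theorem 21 in
pair form):** if `A, B ⊆ G` (finite abelian), `|A| ≥ 2`, `|B| ≥ 1`, `|A + B| ≤ |A| + |B| + m` with
`m ≤ 4`, `|A + B| ≤ |G| − 2` and `|B| + C(m+4, 2) < |G|`, then EITHER some subgroup `K` (with its
finset `H`, `|H| ≥ 2`) has `|H + B| ≤ |H| + |B| + m` and `|H + B| ≤ |G| − 2`, OR some `d ≠ 0` has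
`|(d + B) ∖ B| ≤ m + 2` — so that (Lemma 6.1, `eq_filter_union_biUnion_apFinset`) `B` is its
`⟨d⟩`-periodic part plus at most `m + 2` arithmetic progressions of difference `d`.  (Translate `0`
into `B`; `κ₂(B) ≤ |A + B| − |A| ≤ |B| + m`; a `2`-atom `H ∋ 0` is a subgroup or a pair by
`IsAtom.exists_addSubgroup_or_card_eq_two_of_conn_le_add`, and a pair atom `{0, d}` has
`|(d + B) ∖ B| + |B| = κ₂(B) + 2`.)  This is the composite-order counterpart of
`exists_card_vadd_sdiff_le_of_card_add_le` (`ℤ/pℤ`, every `m`).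
[cite: HamidouneSerraZemor2008, §5, Theorem 21] -/
theorem exists_addSubgroup_or_exists_card_vadd_sdiff_le {A B : Finset G} (hB : B.Nonempty)
    {m : ℕ} (hm4 : m ≤ 4) (hA2 : 2 ≤ #A) (hAB : #(A + B) ≤ #A + #B + m)
    (hABn : #(A + B) + 2 ≤ Fintype.card G)
    (hBn : #B + (m + 3) * (m + 4) / 2 + 1 ≤ Fintype.card G) :
    (∃ K : AddSubgroup G, ∃ H : Finset G, (K : Set G) = H ∧ 2 ≤ #H ∧
        #(H + B) + 2 ≤ Fintype.card G ∧ #(H + B) ≤ #H + #B + m) ∨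
    (∃ d : G, d ≠ 0 ∧ #((d +ᵥ B) \ B) ≤ m + 2) := by
  classical
  obtain ⟨b₀, hb₀⟩ := hB
  set B' := -b₀ +ᵥ B with hB'
  have h0 : (0 : G) ∈ B' := mem_vadd_finset.2 ⟨b₀, hb₀, by rw [vadd_eq_add, neg_add_cancel]⟩
  have hcB : #B' = #B := card_vadd_finset _ _
  have hvB : ∀ X : Finset G, #(X + B') = #(X + B) := fun X => by
    rw [hB', ← singleton_add, add_left_comm, singleton_add, card_vadd_finset]
  have hadm : IsAdm 2 B' A := ⟨hA2, by rw [hvB]; exact hABn⟩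
  have hκ : conn 2 B' ≤ #B' + m := by
    have := conn_le hadm
    have := card_le_card_add h0 A
    rw [hvB] at *
    omega
  obtain ⟨H₀, hH₀⟩ := exists_isAtom ⟨A, hadm⟩
  have hH₀a := hH₀.1.1
  unfold IsAdm at hH₀a
  obtain ⟨h₀, hh₀⟩ : H₀.Nonempty := card_pos.1 (by omega)
  obtain ⟨H, hH, h0H⟩ : ∃ H : Finset G, IsAtom 2 B' H ∧ (0 : G) ∈ H :=
    ⟨-h₀ +ᵥ H₀, hH₀.vadd (-h₀), mem_vadd_finset.2 ⟨h₀, hh₀, by rw [vadd_eq_add, neg_add_cancel]⟩⟩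
  have hHa := hH.1.1
  unfold IsAdm at hHa
  have hHf := hH.1.2
  rcases hH.exists_addSubgroup_or_card_eq_two_of_conn_le_add h0 hm4 hκ (by rw [hcB]; exact hBn)
    h0H with ⟨K, hK⟩ | hH2
  · refine Or.inl ⟨K, H, hK, hHa.1, ?_, ?_⟩
    · have := hHa.2
      rwa [hvB] at this
    · have h1 := card_le_card_add h0 H
      have h2 : #(H + B') = #(H + B) := hvB H
      omega
  · obtain ⟨d, hd, -, hcount⟩ := hH.exists_eq_pair_of_card_eq_two h0 h0H hH2
    refine Or.inr ⟨d, hd, ?_⟩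
    have e : (d +ᵥ B') \ B' = -b₀ +ᵥ ((d +ᵥ B) \ B) := by
      rw [hB', vadd_finset_sdiff, vadd_vadd, vadd_vadd, add_comm]
    rw [e, card_vadd_finset] at hcount
    omega

/-! ### Lemma 13 and Corollary 22 -/

/-- **[HamidouneSerraZemor2008, §3, Lemma 13]:** "Let `0 ∈ S` be a `2`-separable subset of a
finite abelian group `G`.  Suppose `A` is a `2`-atom of `S` which is a subgroup of cardinality
at least `3`.  Then there exists `s ∈ S`, `s ≠ 0`, such that the order of `s` is not more than
`κ₂(S)`."  As printed the proof uses `|A| ≤ κ₂(S)` ("`κ₂(S)` is a multiple of `|A|`"), which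
needs `κ₂(S) ≥ 1`; we carry this as the hypothesis `1 ≤ κ₂(S)` (automatic for a generating `S`,
see `IsAtom.card_eq_two_of_forall_le_addOrderOf`).  Proof as printed: `A + S = A* + S`
(Lemma 4) puts some `−s`, `s ∈ S*`, in `A*`, and `ord(s) ≤ |A| ≤ κ₂(S)`.
[cite: HamidouneSerraZemor2008, §3, Lemma 13] -/
theorem IsAtom.exists_addOrderOf_le_conn {S : Finset G} (h0 : (0 : G) ∈ S) {A : Finset G}
    (hA : IsAtom 2 S A) (K : AddSubgroup G) (hK : (K : Set G) = A) (hA3 : 3 ≤ #A)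
    (hpos : 1 ≤ conn 2 S) : ∃ s ∈ S, s ≠ 0 ∧ addOrderOf s ≤ conn 2 S := by
  classical
  have hKA : ∀ g, g ∈ A ↔ g ∈ K := fun g => by
    rw [← mem_coe, ← hK, SetLike.mem_coe]
  have h0A : (0 : G) ∈ A := (hKA 0).2 K.zero_mem
  have hAf := hA.1.2
  -- `A + S = A* + S`: `0 = a + s` with `a ∈ A*`, `s ∈ S`
  have he := hA.erase_add_eq h0 hA3 h0A
  have h0AS : (0 : G) ∈ A.erase 0 + S := by
    rw [he]; exact mem_add.2 ⟨0, h0A, 0, h0, add_zero 0⟩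
  obtain ⟨a, ha, s, hs, has⟩ := mem_add.1 h0AS
  rw [mem_erase] at ha
  have hsa : s = -a := eq_neg_of_add_eq_zero_right has
  refine ⟨s, hs, fun hs0 => ha.1 (by rw [hs0, eq_comm, neg_eq_zero] at hsa; exact hsa), ?_⟩
  have hsK : s ∈ K := by rw [hsa]; exact K.neg_mem ((hKA a).1 ha.2)
  -- `ord(s) ≤ |K| = |A|`
  haveI : Fintype ↥K := Fintype.ofFinite _
  have hKcard : Nat.card ↥K = #A := by
    rw [Nat.card_eq_fintype_card, ← Fintype.card_coe A]
    refine Fintype.card_congr (Equiv.subtypeEquiv (Equiv.refl G) fun g => ?_)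
    simp only [Equiv.refl_apply]
    exact ⟨fun h => (hKA g).2 h, fun h => (hKA g).1 h⟩
  have hord : addOrderOf s ≤ #A := by
    rw [← hKcard]
    exact Nat.le_of_dvd Nat.card_pos (AddSubgroup.addOrderOf_dvd_natCard K hsK)
  -- `|A| ≤ κ₂(S)`: `|S + A| = t |A|` with `t ≥ 2`
  have hmul := card_add_eq_card_image_mul K A hKA S
  have hκ : conn 2 S = #(A + S) - #A := hAf.symm
  rw [add_comm] at hκ
  rw [hκ, hmul] at hpos ⊢
  set t := #(S.image fun s : G => (s : G ⧸ K))
  have ht : 2 ≤ t := by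
    by_contra hlt
    interval_cases t <;> omega
  calc addOrderOf s ≤ #A := hord
    _ = 2 * #A - #A := by omega
    _ ≤ t * #A - #A := Nat.sub_le_sub_right (Nat.mul_le_mul_right _ ht) _

/-- **[HamidouneSerraZemor2008, §5, Corollary 22]:** "Let `G` be a finite abelian group and let
`0 ∈ S` be a generating `2`-separable subset of `G` such that `|S| ≥ 3` and `−1 ≤ κ₂(S) − |S| =
m ≤ 4`.  Also assume that every non zero element of `S` has order at least `|S| + m + 1`.  If
`|S| < |G| − C(m+4, 2)` then the `2`-atoms of `S` have cardinality `2`."  Here for `0 ≤ m ≤ 4`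
carried as an upper bound `κ₂(S) ≤ |S| + m` (the case `m = −1` is covered by `m = 0` at the cost
of the stronger size bound `|S| + 7 ≤ |G|`), without the unused `|S| ≥ 3`.  Proof as printed:
translate the atom to contain `0`; by Theorem 21 it is a subgroup or a pair; a subgroup atom of
size `≥ 3` gives by Lemma 13 an `s ∈ S*` of order `≤ κ₂(S) ≤ |S| + m`.
[cite: HamidouneSerraZemor2008, §5, Corollary 22] -/
theorem IsAtom.card_eq_two_of_forall_le_addOrderOf {S : Finset G} (h0 : (0 : G) ∈ S)
    (hgen : AddSubgroup.closure (S : Set G) = ⊤) {m : ℕ} (hm4 : m ≤ 4)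
    (hκ : conn 2 S ≤ #S + m) (hSn : #S + (m + 3) * (m + 4) / 2 + 1 ≤ Fintype.card G)
    (hord : ∀ s ∈ S, s ≠ 0 → #S + m + 1 ≤ addOrderOf s) {A : Finset G} (hA : IsAtom 2 S A) :
    #A = 2 := by
  classical
  have hAa := hA.1.1
  unfold IsAdm at hAa
  obtain ⟨a, ha⟩ : A.Nonempty := card_pos.1 (by omega)
  have hA' : IsAtom 2 S (-a +ᵥ A) := hA.vadd (-a)
  have h0A' : (0 : G) ∈ -a +ᵥ A := mem_vadd_finset.2 ⟨a, ha, by rw [vadd_eq_add, neg_add_cancel]⟩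
  have hcard : #(-a +ᵥ A) = #A := card_vadd_finset _ _
  rcases hA'.exists_addSubgroup_or_card_eq_two_of_conn_le_add h0 hm4 hκ hSn h0A' with
    ⟨K, hK⟩ | h2
  · by_contra hA2
    have hA3 : 3 ≤ #(-a +ᵥ A) := by rw [hcard]; omega
    -- `κ₂(S) ≥ 1` since `S` generates `G`
    have hA'f := hA'.1.2
    have hA'a := hA'.1.1
    unfold IsAdm at hA'a
    have hpos : 1 ≤ conn 2 S := by
      by_contra hlt
      have h1 : #((-a +ᵥ A) + S) = #(-a +ᵥ A) := by
        have := card_le_card_add h0 (-a +ᵥ A); omega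
      have h2 : (-a +ᵥ A) + S = -a +ᵥ A :=
        (eq_of_subset_of_card_le (subset_add_left _ h0) h1.le).symm
      have h3 := eq_univ_of_add_eq_of_closure_eq_top ⟨0, h0A'⟩ hgen h2
      rw [h2, h3, card_univ] at hA'a
      omega
    obtain ⟨s, hs, hs0, hsord⟩ := hA'.exists_addOrderOf_le_conn h0 K hK hA3 hpos
    have := hord s hs hs0
    omega
  · rw [← hcard, h2]

/-! ### Theorem 14 (Kemperman, isoperimetric version) and Corollary 8 (Chowla) -/

/-- `|{0, d, …, (o−1)d}| = o`, `o` the order of `d`. [folklore] -/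
private theorem card_apFinset_zero_addOrderOf (d : G) :
    #(apFinset (0 : G) d (addOrderOf d)) = addOrderOf d := by
  have h1 : Nat.card ↥(AddSubgroup.zmultiples d) = addOrderOf d := Nat.card_zmultiples d
  have h2 : Nat.card ↥(AddSubgroup.zmultiples d) = #(apFinset (0 : G) d (addOrderOf d)) := by
    rw [← SetLike.coe_sort_coe, coe_zmultiples_eq_coe_apFinset d, Nat.card_coe_set_eq,
      Set.ncard_coe_finset]
  rw [← h2, h1]

omit [Fintype G] in
/-- A `d`-invariant finset is invariant under every multiple of `d`. [folklore] -/
private theorem nsmul_vadd_eq_of_vadd_eq {P : Finset G} {d : G} (h : d +ᵥ P = P) (n : ℕ) :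
    n • d +ᵥ P = P := by
  induction n with
  | zero => rw [zero_nsmul, zero_vadd]
  | succ n ih => rw [succ_nsmul, add_comm, ← vadd_vadd, ih, h]

omit [Fintype G] in
/-- A `d`-invariant finset containing `x` contains `x + ⟨d⟩`. [folklore] -/
private theorem vadd_apFinset_subset_of_vadd_eq {P : Finset G} {d : G} (h : d +ᵥ P = P) {x : G}
    (hx : x ∈ P) : x +ᵥ apFinset (0 : G) d (addOrderOf d) ⊆ P := by
  intro y hy
  obtain ⟨z, hz, rfl⟩ := mem_vadd_finset.1 hy
  obtain ⟨i, -, rfl⟩ := mem_apFinset.1 hz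
  rw [zero_add, vadd_eq_add]
  exact (mem_iff_add_nsmul_mem_of_vadd_eq h x i).1 hx

/-- **[HamidouneSerraZemor2008, §3, Theorem 14] (Kemperman's structure theorem, isoperimetric
version, under the weak Chowla condition):** "Let `0 ∈ S` be a generating `2`-separable subset
of a finite abelian group `G` such that `κ₂(S) ≤ |S| − 1`.  Also assume that every element of
`S ∖ {0}` has order at least `|S|`.  Then either `S` is an arithmetic progression or `S ∖ {0}` is
periodic."  Periodicity is rendered as invariance of `S ∖ {0}` under a non-zero element `d` (hence
under the non-null subgroup `⟨d⟩`).  Proof (p0007, re-routed through Lemma 6.1 of [Hamidoune2000]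
instead of the coset count): a `2`-atom `A ∋ 0` is a subgroup or a pair (Corollary 6.3); a
subgroup atom of size `≥ 3` is excluded by Lemma 13 and the order condition; so `A = {0, r}` and
`|(r + S) ∖ S| ≤ 1`; `r + S = S` would put `⟨r⟩` inside `S` with `ord r < |S|`; so
`S = P ⊔ (s + {0, r, …, (ℓ−1) r})` with `P` `r`-invariant (`exists_eq_filter_union_apFinset_of_
card_vadd_sdiff_eq_one`); `0 ∈ P` is again excluded by the order of `r`, so the progression lies
in `⟨r⟩`; if `P = ∅` then `S` is an arithmetic progression of difference `r`; otherwise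
`|⟨r⟩| ≤ |P| ≤ |S| − ℓ` and the order condition forces `ℓ = 1`, i.e. `S ∖ {0} = P` is
`r`-periodic. [cite: HamidouneSerraZemor2008, §3, Theorem 14] -/
theorem isAP_or_vadd_erase_eq_of_forall_card_le_addOrderOf {S : Finset G} (h0 : (0 : G) ∈ S)
    (hgen : AddSubgroup.closure (S : Set G) = ⊤) (hsep : IsSeparable 2 S)
    (hκ : conn 2 S + 1 ≤ #S) (hord : ∀ s ∈ S, s ≠ 0 → #S ≤ addOrderOf s) :
    (∃ d : G, d ≠ 0 ∧ IsAP S d) ∨ (∃ d : G, d ≠ 0 ∧ d +ᵥ S.erase 0 = S.erase 0) := by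
  classical
  -- a `2`-atom through `0`
  obtain ⟨A₀, hA₀⟩ := exists_isAtom hsep
  have hA₀a := hA₀.1.1
  unfold IsAdm at hA₀a
  obtain ⟨a, ha⟩ : A₀.Nonempty := card_pos.1 (by omega)
  obtain ⟨A, hA, h0A⟩ : ∃ A : Finset G, IsAtom 2 S A ∧ (0 : G) ∈ A :=
    ⟨-a +ᵥ A₀, hA₀.vadd (-a), mem_vadd_finset.2 ⟨a, ha, by rw [vadd_eq_add, neg_add_cancel]⟩⟩
  have hAa := hA.1.1
  unfold IsAdm at hAa
  have hAf := hA.1.2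
  -- `S ≠ G` (separability) and `κ₂(S) ≥ 1` (`S` generates)
  have hSuniv : S ≠ univ := by
    intro hS
    have : A + S = univ := by
      rw [hS, ← coe_inj, coe_add, coe_univ]
      obtain ⟨x, hx⟩ : A.Nonempty := ⟨0, h0A⟩
      exact Set.eq_univ_of_forall fun y => Set.mem_add.2 ⟨x, hx, -x + y, Set.mem_univ _, by abel⟩
    rw [this, card_univ] at hAa
    omega
  have hpos : 1 ≤ conn 2 S := by
    by_contra hlt
    have h1 : #(A + S) = #A := by have := card_le_card_add h0 A; omega
    have h2 : A + S = A := (eq_of_subset_of_card_le (subset_add_left _ h0) h1.le).symm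
    have h3 := eq_univ_of_add_eq_of_closure_eq_top ⟨0, h0A⟩ hgen h2
    rw [h2, h3, card_univ] at hAa
    omega
  -- the atom is a pair `{0, r}`
  have hA2 : #A = 2 := by
    rcases hA.exists_addSubgroup_or_card_eq_two h0 h0A hκ with ⟨K, hK⟩ | h2
    · by_contra hA2
      obtain ⟨s, hs, hs0, hsord⟩ := hA.exists_addOrderOf_le_conn h0 K hK (by omega) hpos
      have := hord s hs hs0
      omega
    · exact h2
  obtain ⟨r, hr, hAeq, hcount⟩ := hA.exists_eq_pair_of_card_eq_two h0 h0A hA2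
  have hD : #((r +ᵥ S) \ S) ≤ 1 := by omega
  set Hf := apFinset (0 : G) r (addOrderOf r) with hHf
  have hHfcard : #Hf = addOrderOf r := card_apFinset_zero_addOrderOf r
  have h0Hf : (0 : G) ∈ Hf := by simpa using nsmul_mem_apFinset_zero_addOrderOf r 0
  have hrHf : r ∈ Hf := by simpa using nsmul_mem_apFinset_zero_addOrderOf r 1
  -- an `r`-invariant `T ∋ 0` inside `S` contradicts the order condition unless `S ⊆ Hf`…
  -- more precisely: `Hf ⊆ S` is impossible, because `S ⊄ Hf` or `S = Hf` both fail.
  have hnotHS : ¬ Hf ⊆ S := by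
    intro hsub
    have hrS : r ∈ S := hsub hrHf
    have h1 := hord r hrS hr
    -- `|S| ≤ ord r = |Hf|` forces `S = Hf`, a subgroup: then `S` generates `Hf ≠ G`?  No:
    -- `S = Hf` is a subgroup equal to `G` (it generates `G`), contradicting `S ≠ G`.
    have hSH : S = Hf := (eq_of_subset_of_card_le hsub (by rw [hHfcard]; exact h1)).symm
    obtain ⟨K, hK⟩ := exists_addSubgroup_coe_eq_apFinset_zero_addOrderOf r
    have hKtop : K = ⊤ := by
      rw [← hgen, hSH, ← hK, AddSubgroup.closure_eq]
    apply hSuniv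
    rw [hSH, ← coe_inj, ← hK, hKtop, coe_univ]; rfl
  -- Case `r + S = S`: then `Hf ⊆ S`
  rcases Nat.lt_or_ge #((r +ᵥ S) \ S) 1 with hD0 | hD1
  · exfalso
    have hrS : r +ᵥ S = S := by
      have h1 : (r +ᵥ S) \ S = ∅ := by rw [← card_eq_zero]; omega
      exact eq_of_subset_of_card_le (sdiff_eq_empty_iff_subset.1 h1) (by rw [card_vadd_finset])
    exact hnotHS (by simpa using vadd_apFinset_subset_of_vadd_eq hrS h0)
  -- Case `|(r + S) ∖ S| = 1`: Lemma 6.1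
  have hD1' : #((r +ᵥ S) \ S) = 1 := le_antisymm hD hD1
  obtain ⟨s, hsS, ℓ, hℓ1, hSeq, hPinv, hAPcard, hAPdisj⟩ :=
    exists_eq_filter_union_apFinset_of_card_vadd_sdiff_eq_one hD1'
  set P := S.filter fun x => x +ᵥ apFinset (0 : G) r (addOrderOf r) ⊆ S with hP
  have hPS : P ⊆ S := filter_subset _ _
  -- `0 ∉ P`
  have h0P : (0 : G) ∉ P := by
    intro h0P
    have h1 := vadd_apFinset_subset_of_vadd_eq hPinv h0P
    rw [zero_vadd] at h1
    exact hnotHS (h1.trans hPS)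
  -- hence `0` is on the progression, which therefore lies in `Hf`
  have h0AP : (0 : G) ∈ apFinset s r ℓ := by
    have := h0; rw [hSeq, mem_union] at this
    exact this.resolve_left h0P
  have hAPH : apFinset s r ℓ ⊆ Hf := by
    obtain ⟨i₀, -, hi₀⟩ := mem_apFinset.1 h0AP
    intro y hy
    obtain ⟨i, -, rfl⟩ := mem_apFinset.1 hy
    have hs' : s = -(i₀ • r) := eq_neg_of_add_eq_zero_left hi₀
    obtain ⟨K, hK⟩ := exists_addSubgroup_coe_eq_apFinset_zero_addOrderOf r
    have hrK : r ∈ K := by rw [← SetLike.mem_coe, hK]; exact hrHf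
    rw [← mem_coe, ← hK, SetLike.mem_coe, hs']
    exact K.add_mem (K.neg_mem (K.nsmul_mem hrK i₀)) (K.nsmul_mem hrK i)
  -- `P = ∅`: `S` is an arithmetic progression of difference `r`
  rcases P.eq_empty_or_nonempty with hP0 | hPne
  · left
    refine ⟨r, hr, s, ?_⟩
    have hS' : S = apFinset s r ℓ := by rw [hSeq, hP0, empty_union]
    have : #S = ℓ := by rw [hS', hAPcard]
    rw [this]; exact hS'
  -- `P ≠ ∅`: `|Hf| ≤ |P| = |S| − ℓ`, and `ℓ = 1`
  right
  have hHP : #Hf ≤ #P := card_apFinset_zero_addOrderOf_le_card hPinv hPne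
  have hSP : #S = #P + ℓ := by
    rw [hSeq, card_union_of_disjoint (disjoint_right.2 fun x hx hxP => hAPdisj x hx hxP), hAPcard]
  have hℓ : ℓ = 1 := by
    by_contra hℓ
    -- a second point of the progression is a non-zero element of `S ∩ Hf`
    obtain ⟨y, hy, hy0⟩ : ∃ y ∈ apFinset s r ℓ, y ≠ 0 :=
      exists_mem_ne (by rw [hAPcard]; omega) 0
    have hyS : y ∈ S := by rw [hSeq]; exact mem_union_right _ hy
    have h1 := hord y hyS hy0
    -- `ord y ≤ |Hf|`
    obtain ⟨K, hK⟩ := exists_addSubgroup_coe_eq_apFinset_zero_addOrderOf r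
    have hyK : y ∈ K := by rw [← SetLike.mem_coe, hK]; exact hAPH hy
    haveI : Fintype ↥K := Fintype.ofFinite _
    have hKcard : Nat.card ↥K = #Hf := by
      rw [← SetLike.coe_sort_coe, hK, Nat.card_coe_set_eq, Set.ncard_coe_finset]
    have h2 : addOrderOf y ≤ #Hf := by
      rw [← hKcard]
      exact Nat.le_of_dvd Nat.card_pos (AddSubgroup.addOrderOf_dvd_natCard K hyK)
    omega
  -- `S ∖ {0} = P`
  refine ⟨r, hr, ?_⟩
  have hAP0 : apFinset s r ℓ = {0} := by
    symm
    exact eq_of_subset_of_card_le (singleton_subset_iff.2 h0AP) (by rw [hAPcard, hℓ]; simp)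
  have hSe : S.erase 0 = P := by
    rw [hSeq, hAP0, union_comm, ← insert_eq, erase_insert h0P]
  rw [hSe, hPinv]

/-- **[HamidouneSerraZemor2008, §2, Corollary 8] (Chowla's theorem generalized):** "Let `0 ∈ S`
be a generating subset of a finite abelian group `G` such that the order of every element of
`S ∖ {0}` is at least `|S| − 1`.  Then `κ₁(S) = |S| − 1`.  In particular, for every nonempty subset
`X ⊂ G`, we have `|X + S| ≥ min(|G|, |X| + |S| − 1)`."  We prove the displayed inequality.  The
printed proof goes through Corollary 7 ("the `1`-atom `A ∋ 0` is the subgroup generated by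
`S ∩ A`", not formalized); we use only that the `1`-atom `H ∋ 0` is a subgroup
(`exists_addSubgroup_isAtom_one`): `κ₁(S) = |S + H| − |H| = (t − 1)|H|` with `t` the number of
`H`-cosets met by `S`; if `S ∩ H = {0}` then `|S| ≤ 1 + (t − 1)|H| = 1 + κ₁(S)`; otherwise some
`s ∈ S* ∩ H` has `|S| − 1 ≤ ord s ≤ |H| ≤ κ₁(S)` (`t ≥ 2` as `S` generates `G ≠ H`).
[cite: HamidouneSerraZemor2008, §2, Corollary 8] -/
theorem min_le_card_add_of_forall_le_addOrderOf {S : Finset G} (h0 : (0 : G) ∈ S)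
    (hgen : AddSubgroup.closure (S : Set G) = ⊤)
    (hord : ∀ s ∈ S, s ≠ 0 → #S - 1 ≤ addOrderOf s) {X : Finset G} (hX : X.Nonempty) :
    min (Fintype.card G) (#X + #S - 1) ≤ #(X + S) := by
  classical
  by_cases hXS : Fintype.card G ≤ #(X + S)
  · exact min_le_of_left_le hXS
  apply min_le_of_right_le
  have hadm : IsAdm 1 S X := ⟨card_pos.2 hX, by omega⟩
  obtain ⟨H, hH, h0H, K, hK⟩ := exists_addSubgroup_isAtom_one h0 ⟨X, hadm⟩
  have hκX := conn_le hadm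
  have hXle := card_le_card_add h0 X
  have hHf := hH.1.2
  have hHa := hH.1.1
  unfold IsAdm at hHa
  have hHle := card_le_card_add h0 H
  suffices hmain : #S ≤ #(H + S) - #H + 1 by omega
  have hKH : ∀ g, g ∈ H ↔ g ∈ K := fun g => by rw [← mem_coe, ← hK, SetLike.mem_coe]
  have hHK : (H : Set G) ⊆ K := fun g hg => (hKH g).1 hg
  haveI : Fintype ↥K := Fintype.ofFinite _
  have hKcard : Nat.card ↥K = #H := by
    rw [← SetLike.coe_sort_coe, hK, Nat.card_coe_set_eq, Set.ncard_coe_finset]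
  -- `S ⊄ K`
  obtain ⟨s₁, hs₁S, hs₁K⟩ : ∃ s₁ ∈ S, s₁ ∉ K := by
    by_contra hall
    push Not at hall
    have hKtop : K = ⊤ := by
      rw [eq_top_iff, ← hgen]
      exact (AddSubgroup.closure_le K).2 fun s hs => hall s hs
    have hHuniv : H = univ := by
      rw [← coe_inj, ← hK, hKtop, coe_univ]; rfl
    have : H + S = univ := by
      rw [hHuniv, ← coe_inj, coe_add, coe_univ]
      exact Set.eq_univ_of_forall fun y => Set.mem_add.2 ⟨y, Set.mem_univ _, 0, h0, add_zero y⟩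
    rw [this, card_univ] at hHa
    omega
  -- the cosets of `K` met by `S`
  set I : Finset (G ⧸ K) := S.image (fun s : G => (s : G ⧸ K)) with hI
  set pc : G ⧸ K → Finset G := fun c => S.filter (fun s : G => (s : G ⧸ K) = c) with hpc
  have hmul : #(S + H) = #I * #H := card_add_eq_card_image_mul K H hKH S
  have hsumS : #S = ∑ c ∈ I, #(pc c) :=
    card_eq_sum_card_fiberwise fun s hs => mem_image_of_mem _ hs
  have hpc_le : ∀ c ∈ I, #(pc c) ≤ #H := by
    intro c hc
    obtain ⟨s₀, -, hs₀⟩ := mem_image.1 hc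
    have h1 := filter_add_subset_vadd K H hKH S {0} (by simp [K.zero_mem]) hs₀
    rw [Finset.singleton_zero, add_zero] at h1
    have := card_le_card h1
    rwa [card_vadd_finset] at this
  have h0I : ((0 : G) : G ⧸ K) ∈ I := mem_image_of_mem _ h0
  have hs₁I : ((s₁ : G) : G ⧸ K) ∈ I := mem_image_of_mem _ hs₁S
  have hne : ((s₁ : G) : G ⧸ K) ≠ ((0 : G) : G ⧸ K) := fun h =>
    hs₁K (by rw [QuotientAddGroup.mk_zero, QuotientAddGroup.eq_zero_iff] at h; exact h)
  have hI2 : 2 ≤ #I := by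
    calc 2 = #({((s₁ : G) : G ⧸ K), ((0 : G) : G ⧸ K)} : Finset (G ⧸ K)) := (card_pair hne).symm
      _ ≤ #I := card_le_card (insert_subset hs₁I (singleton_subset_iff.2 h0I))
  obtain ⟨k, hk⟩ : ∃ k, #I = k + 2 := ⟨#I - 2, by omega⟩
  have hHS : #(H + S) = k * #H + #H + #H := by rw [add_comm, hmul, hk]; ring
  by_cases hSK : ∀ s ∈ S, s ∈ K → s = 0
  · -- `S ∩ K = {0}`: `|S| ≤ 1 + (t − 1)|H|`
    have hpc0 : pc ((0 : G) : G ⧸ K) = {0} := by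
      ext s
      rw [hpc, mem_filter, mem_singleton, QuotientAddGroup.mk_zero, QuotientAddGroup.eq_zero_iff]
      exact ⟨fun h => hSK s h.1 h.2, fun h => by rw [h]; exact ⟨h0, K.zero_mem⟩⟩
    rw [hsumS, ← add_sum_erase I _ h0I, hpc0, card_singleton]
    have h1 : ∑ c ∈ I.erase ((0 : G) : G ⧸ K), #(pc c) ≤ #(I.erase ((0 : G) : G ⧸ K)) * #H := by
      have := sum_le_card_nsmul (I.erase ((0 : G) : G ⧸ K)) (fun c => #(pc c)) #H
        fun c hc => hpc_le c (mem_of_mem_erase hc)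
      rwa [smul_eq_mul] at this
    rw [card_erase_of_mem h0I, hk, show k + 2 - 1 = k + 1 by omega] at h1
    rw [hHS]
    have : (k + 1) * #H = k * #H + #H := by ring
    omega
  · -- some `s ∈ S* ∩ K`: `|S| − 1 ≤ ord s ≤ |H| ≤ κ₁(S)`
    push Not at hSK
    obtain ⟨s, hsS, hsK, hs0⟩ := hSK
    have h1 := hord s hsS hs0
    have h2 : addOrderOf s ≤ #H := by
      rw [← hKcard]
      exact Nat.le_of_dvd Nat.card_pos (AddSubgroup.addOrderOf_dvd_natCard K hsK)
    rw [hHS]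
    omega

/-! ### Corollary 7 (structure of `1`-atoms) -/

/-- **[HamidouneSerraZemor2008, §2, Corollary 7] ([HCAY] = Hamidoune 1984):** "Let `0 ∈ S ≠ ⟨S⟩`
be a subset of a finite abelian group `G`.  Let `A` be a `1`-atom of `S` such that `0 ∈ A`.  Then
`A` is the subgroup generated by `S ∩ A`.  In particular `κ₁(S)` is a multiple of `|A|`."  (The
hypothesis `S ≠ ⟨S⟩` only guarantees `1`-separability, which is implicit in the existence of
the atom.)  Proof: every `1`-atom through `0` is a subgroup `K` (Mann–Olson–Hamidoune,
`exists_addSubgroup_isAtom_one` and the intersection property); `K' = ⟨S ∩ A⟩ ≤ K` satisfies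
`(K' + S) ∩ K = K'`, so `|K' + S| − |K'| ≤ |K + S| − |K| = κ₁(S)` and `K'` is a `1`-fragment inside
the atom, hence `K' = K`; and `K + S` is a union of `K`-cosets.
[cite: HamidouneSerraZemor2008, §2, Corollary 7] -/
theorem IsAtom.exists_addSubgroup_eq_closure_inter {S : Finset G} (h0 : (0 : G) ∈ S)
    {A : Finset G} (hA : IsAtom 1 S A) (h0A : (0 : G) ∈ A) :
    ∃ K : AddSubgroup G, (K : Set G) = A ∧
      AddSubgroup.closure ((S ∩ A : Finset G) : Set G) = K ∧ #A ∣ conn 1 S := by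
  classical
  -- `A` is a subgroup `K`
  obtain ⟨H, hH, h0H, K, hK⟩ := exists_addSubgroup_isAtom_one h0 ⟨A, hA.1.1⟩
  have hAH : A = H := hA.eq_of_le_card_inter h0 hH (card_pos.2 ⟨0, mem_inter.2 ⟨h0A, h0H⟩⟩)
  subst hAH
  have hKA : ∀ g, g ∈ A ↔ g ∈ K := fun g => by rw [← mem_coe, ← hK, SetLike.mem_coe]
  refine ⟨K, hK, ?_, ?_⟩
  · -- `K' = ⟨S ∩ A⟩`
    set K' := AddSubgroup.closure ((S ∩ A : Finset G) : Set G) with hK'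
    have hK'K : K' ≤ K := by
      rw [hK', AddSubgroup.closure_le, hK]
      exact coe_subset.2 inter_subset_right
    set K'f : Finset G := univ.filter (fun g : G => g ∈ K') with hK'f
    have hK'f : ∀ g, g ∈ K'f ↔ g ∈ K' := fun g => by rw [hK'f, mem_filter]; simp
    have h0K'f : (0 : G) ∈ K'f := (hK'f 0).2 K'.zero_mem
    have hK'fA : K'f ⊆ A := fun g hg => (hKA g).2 (hK'K ((hK'f g).1 hg))
    have hAa := hA.1.1
    unfold IsAdm at hAa
    have hAf := hA.1.2
    -- `(K'f + S) ∩ A = K'f`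
    have hint : (K'f + S) ∩ A = K'f := by
      ext x
      rw [mem_inter]
      constructor
      · rintro ⟨hx, hxA⟩
        obtain ⟨k, hk, s, hs, rfl⟩ := mem_add.1 hx
        have hkK' := (hK'f k).1 hk
        have hsK : s ∈ K := by
          have := K.sub_mem ((hKA _).1 hxA) (hK'K hkK')
          rwa [add_sub_cancel_left] at this
        have hsK' : s ∈ K' :=
          AddSubgroup.subset_closure (mem_coe.2 (mem_inter.2 ⟨hs, (hKA s).2 hsK⟩))
        exact (hK'f _).2 (K'.add_mem hkK' hsK')
      · intro hx
        exact ⟨mem_add.2 ⟨x, hx, 0, h0, add_zero x⟩, hK'fA hx⟩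
    -- `|K'f + S| + |A| − |K'f| ≤ |A + S|`
    have hsub : (K'f + S) ∪ A ⊆ A + S :=
      union_subset (add_subset_add_right hK'fA) (subset_add_left _ h0)
    have h1 := card_le_card hsub
    have h2 := card_union_add_card_inter (K'f + S) A
    rw [hint] at h2
    have h3 := card_le_card_add h0 K'f
    have h5 : #(K'f + S) ≤ #((K'f + S) ∪ A) := card_le_card subset_union_left
    -- `K'f` is a `1`-fragment
    have hadm : IsAdm 1 S K'f := ⟨card_pos.2 ⟨0, h0K'f⟩, by omega⟩
    have hκ := conn_le hadm
    have hfrag : IsFragment 1 S K'f := ⟨hadm, by omega⟩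
    have h4 := hA.2 K'f hfrag
    have hKfA : K'f = A := eq_of_subset_of_card_le hK'fA h4
    apply SetLike.coe_injective
    rw [hK]
    ext g
    rw [SetLike.mem_coe, mem_coe, ← hK'f g, hKfA]
  · -- `κ₁(S) = |S + A| − |A|` is a multiple of `|A|`
    have hmul := card_add_eq_card_image_mul K A hKA S
    rw [← hA.1.2, add_comm, hmul]
    exact Nat.dvd_sub (Dvd.intro_left _ rfl) (dvd_refl _)

/-! ### Explicit structure for small sumsets, and transfer of progressions -/

/-- **Small sumsets in a finite abelian group, explicit structure (Theorem 21 in pair form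
combined with [Hamidoune2000, Lemma 6.1]):** if `|A + B| ≤ |A| + |B| + m` with `m ≤ 4`,
`|A| ≥ 2`, `B ≠ ∅`, `|A + B| ≤ |G| − 2` and `|B| + C(m+4, 2) < |G|`, then EITHER some subgroup
`K` (finset `H`, `|H| ≥ 2`) satisfies `|H + B| ≤ |H| + |B| + m` and `|H + B| ≤ |G| − 2` (so `B`
nearly fills at most `(|B| + m)/|H| + 1` cosets of `K`), OR for some `d ≠ 0` the set `B` is the
disjoint union of its `⟨d⟩`-periodic part `P = {x ∈ B : x + ⟨d⟩ ⊆ B}` (`d + P = P`) and of at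
most `m + 2` arithmetic progressions `{s, s + d, …, s + (ℓ_s − 1)d} ⊆ B` of difference `d`, one
starting at each `s ∈ B` with `s − d ∉ B`.
[cite: HamidouneSerraZemor2008, §5, Theorem 21; Hamidoune2000, §6, Lemma 6.1] -/
theorem exists_addSubgroup_or_eq_periodic_union_apFinset {A B : Finset G} (hB : B.Nonempty)
    {m : ℕ} (hm4 : m ≤ 4) (hA2 : 2 ≤ #A) (hAB : #(A + B) ≤ #A + #B + m)
    (hABn : #(A + B) + 2 ≤ Fintype.card G)
    (hBn : #B + (m + 3) * (m + 4) / 2 + 1 ≤ Fintype.card G) :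
    (∃ K : AddSubgroup G, ∃ H : Finset G, (K : Set G) = H ∧ 2 ≤ #H ∧
        #(H + B) + 2 ≤ Fintype.card G ∧ #(H + B) ≤ #H + #B + m) ∨
    (∃ d : G, d ≠ 0 ∧ ∃ ℓ : G → ℕ,
      B = (B.filter fun x => x +ᵥ apFinset (0 : G) d (addOrderOf d) ⊆ B) ∪
            (B.filter fun s => s - d ∉ B).biUnion (fun s => apFinset s d (ℓ s)) ∧
      d +ᵥ (B.filter fun x => x +ᵥ apFinset (0 : G) d (addOrderOf d) ⊆ B) =
        (B.filter fun x => x +ᵥ apFinset (0 : G) d (addOrderOf d) ⊆ B) ∧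
      #(B.filter fun s => s - d ∉ B) ≤ m + 2 ∧
      (∀ s : G, apFinset s d (ℓ s) ⊆ B) ∧
      (∀ s ∈ B, s - d ∉ B → 1 ≤ ℓ s ∧ #(apFinset s d (ℓ s)) = ℓ s ∧ s + ℓ s • d ∉ B ∧
        ∀ x ∈ apFinset s d (ℓ s), ¬ (x +ᵥ apFinset (0 : G) d (addOrderOf d) ⊆ B))) := by
  rcases exists_addSubgroup_or_exists_card_vadd_sdiff_le hB hm4 hA2 hAB hABn hBn with h | ⟨d, hd, hcount⟩
  · exact Or.inl h
  · obtain ⟨ℓ, h1, h2, h3, h4, h5⟩ := eq_filter_union_biUnion_apFinset B d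
    exact Or.inr ⟨d, hd, ℓ, h1, h2, by rw [h3]; exact hcount, h4, h5⟩

/-- **Progressions are transferred across a small sumset (the "easy" step of [HamidouneSerraZemor2008,
Proposition 15]):** in a finite abelian group generated by `r`, if `S` is an arithmetic
progression of difference `r` with `|S| ≥ 2`, `T ≠ ∅`, `|T + S| ≤ |T| + |S| − 1` and `|T + S| <
|G|`, then `T` is an arithmetic progression of difference `r`.  ("By Theorem 14, `S` is an
arithmetic progression. It follows easily that `T` is an arithmetic progression with the same
difference.")  Proof: with `S = {a, a + r, …}`, each step `T + {a, …, a + jr} ↦ T + {a, …,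
a + (j+1)r}` adds at least one element unless the set is `r`-invariant, i.e. all of `G`; so
`|(r + T) ∖ T| = 1` and [Hamidoune2000, Lemma 6.1] makes `T` a single progression.
[cite: HamidouneSerraZemor2008, §3, Proposition 15 (proof, case `Q = {0}`)] -/
theorem isAP_of_isAP_of_card_add_le {S T : Finset G} {r : G} (hr : AddSubgroup.zmultiples r = ⊤)
    (hS : IsAP S r) (hS2 : 2 ≤ #S) (hT : T.Nonempty) (hTS : #(T + S) + 1 ≤ #T + #S)
    (hTSn : #(T + S) < Fintype.card G) : IsAP T r := by
  classical
  obtain ⟨a, hSa⟩ := hS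
  -- the full group is `{0, r, 2r, …}`
  have hHf : apFinset (0 : G) r (addOrderOf r) = univ := by
    rw [← coe_inj, ← coe_zmultiples_eq_coe_apFinset r, hr, coe_univ]; rfl
  -- an `r`-invariant nonempty set is everything
  have hinv : ∀ P : Finset G, r +ᵥ P = P → P.Nonempty → P = univ := by
    intro P hP ⟨x, hx⟩
    have h1 := vadd_apFinset_subset_of_vadd_eq hP hx
    rw [hHf, ← coe_subset, coe_vadd_finset, coe_univ, Set.vadd_set_univ, Set.univ_subset_iff,
      coe_eq_univ] at h1
    exact h1
  -- the chain `U j = T + {a, …, a + (j−1) r}`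
  set U : ℕ → Finset G := fun j => T + apFinset a r j with hU
  have hUS : ∀ j, j ≤ #S → U j ⊆ T + S := fun j hj => by
    rw [hSa]; exact add_subset_add_left (apFinset_mono a r hj)
  have hstep : ∀ j, 1 ≤ j → j < #S → #(U j) + 1 ≤ #(U (j + 1)) := by
    intro j hj1 hjS
    have hsub : U j ∪ (r +ᵥ U j) ⊆ U (j + 1) := by
      apply union_subset
      · exact add_subset_add_left (apFinset_mono a r (Nat.le_succ j))
      · intro y hy
        obtain ⟨x, hx, rfl⟩ := mem_vadd_finset.1 hy
        obtain ⟨t, ht, z, hz, rfl⟩ := mem_add.1 hx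
        obtain ⟨i, hi, rfl⟩ := mem_apFinset.1 hz
        refine mem_add.2 ⟨t, ht, a + (i + 1) • r, mem_apFinset.2 ⟨i + 1, by omega, rfl⟩, ?_⟩
        rw [vadd_eq_add, succ_nsmul]; abel
    have hne : ¬ r +ᵥ U j ⊆ U j := by
      intro hle
      have heq : r +ᵥ U j = U j := eq_of_subset_of_card_le hle (by rw [card_vadd_finset])
      obtain ⟨t, ht⟩ := hT
      have hUne : (U j).Nonempty :=
        ⟨t + a, mem_add.2 ⟨t, ht, a, mem_apFinset.2 ⟨0, by omega, by rw [zero_nsmul, add_zero]⟩,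
          rfl⟩⟩
      have := hinv (U j) heq hUne
      have h2 := card_le_card (hUS j hjS.le)
      rw [this, card_univ] at h2
      omega
    obtain ⟨y, hy, hyU⟩ := not_subset.1 hne
    calc #(U j) + 1 = #(insert y (U j)) := (card_insert_of_notMem hyU).symm
      _ ≤ #(U (j + 1)) := card_le_card (insert_subset (hsub (mem_union_right _ hy))
          (subset_union_left.trans hsub))
  -- hence `|U 2| ≤ |T| + 1`
  have hchain : ∀ j, 2 ≤ j → j ≤ #S → #(U 2) + (j - 2) ≤ #(U j) := by
    intro j hj2 hjS
    induction j with
    | zero => omega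
    | succ n ih =>
      rcases Nat.lt_or_ge n 2 with hn | hn
      · have : n = 1 := by omega
        subst this; simp
      · have := ih hn (by omega)
        have := hstep n (by omega) (by omega)
        omega
  have hU2 : #(U 2) ≤ #T + 1 := by
    have h1 := hchain #S hS2 le_rfl
    have h2 : U #S = T + S := by rw [hU]; simp only; rw [← hSa]
    rw [h2] at h1
    omega
  -- `U 2 = a + (T ∪ (r + T))`
  have hU2eq : U 2 = a +ᵥ (T ∪ (r +ᵥ T)) := by
    have hap : apFinset a r 2 = {a, a + r} := by
      ext x
      rw [mem_apFinset, mem_insert, mem_singleton]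
      constructor
      · rintro ⟨i, hi, rfl⟩
        interval_cases i
        · left; rw [zero_nsmul, add_zero]
        · right; rw [one_nsmul]
      · rintro (rfl | rfl)
        · exact ⟨0, by omega, by rw [zero_nsmul, add_zero]⟩
        · exact ⟨1, by omega, by rw [one_nsmul]⟩
    rw [hU]; simp only
    rw [hap, add_comm T _, insert_eq, union_add, singleton_add, singleton_add, vadd_finset_union,
      vadd_vadd]
  have hcard1 : #((r +ᵥ T) \ T) ≤ 1 := by
    have h1 : #(T ∪ (r +ᵥ T)) = #T + #((r +ᵥ T) \ T) := by
      rw [← union_sdiff_self_eq_union, card_union_of_disjoint disjoint_sdiff]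
    have h2 : #(U 2) = #(T ∪ (r +ᵥ T)) := by rw [hU2eq, card_vadd_finset]
    omega
  rcases Nat.lt_or_ge #((r +ᵥ T) \ T) 1 with h0 | h1
  · -- `r + T = T`: `T = G`, impossible
    exfalso
    have hrT : r +ᵥ T = T := by
      have : (r +ᵥ T) \ T = ∅ := by rw [← card_eq_zero]; omega
      exact eq_of_subset_of_card_le (sdiff_eq_empty_iff_subset.1 this) (by rw [card_vadd_finset])
    have hTu := hinv T hrT hT
    obtain ⟨s, hs⟩ : S.Nonempty := card_pos.1 (by omega)
    have hle : #T ≤ #(T + S) := by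
      calc #T = #(T + {s}) := by rw [add_singleton, card_vadd_finset]
        _ ≤ #(T + S) := card_le_card (add_subset_add_left (singleton_subset_iff.2 hs))
    have : #T = Fintype.card G := by rw [hTu, card_univ]
    omega
  · obtain ⟨s, -, ℓ, -, hTeq, hPinv, hAPcard, -⟩ :=
      exists_eq_filter_union_apFinset_of_card_vadd_sdiff_eq_one (le_antisymm hcard1 h1)
    set P := T.filter fun x => x +ᵥ apFinset (0 : G) r (addOrderOf r) ⊆ T
    rcases P.eq_empty_or_nonempty with hP0 | hPne
    · refine ⟨s, ?_⟩
      have hT' : T = apFinset s r ℓ := by rw [hTeq, hP0, empty_union]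
      have : #T = ℓ := by rw [hT', hAPcard]
      rw [this]; exact hT'
    · exfalso
      have hPu := hinv P hPinv hPne
      have hTu : T = univ := eq_univ_of_forall fun x => by
        rw [hTeq]; exact mem_union_left _ (by rw [hPu]; exact mem_univ x)
      obtain ⟨s', hs'⟩ : S.Nonempty := card_pos.1 (by omega)
      have hle : #T ≤ #(T + S) := by
        calc #T = #(T + {s'}) := by rw [add_singleton, card_vadd_finset]
          _ ≤ #(T + S) := card_le_card (add_subset_add_left (singleton_subset_iff.2 hs'))
      have : #T = Fintype.card G := by rw [hTu, card_univ]
      omega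

/-! ### Proposition 15, aperiodic case -/

/-- **[HamidouneSerraZemor2008, §3, Proposition 15], aperiodic case `Q = {0}` (Kemperman-type
critical pair theorem under the weak Chowla condition):** "Let `0 ∈ S` be a generating subset of
a finite abelian group `G` and let `0 ∈ T` be a subset of `G`.  Let `Q` denote the stabilizer of
`S ∖ {0}`.  Suppose that `|T + S| ≤ |T| + |S| − 1 < |G| − |Q|`.  Also assume that every element
of `S* = S ∖ {0}` has order `≥ |S|`. … (i) either `T ⊂ Q`, (ii) or `σ(S)` and `σ(T)` are
arithmetic progressions with the same difference …"  Here only the case `Q = {0}` (carried as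
"no non-zero `d` leaves `S ∖ {0}` invariant"), where `σ = id`: then `T = {0}` or `S` and `T` are
arithmetic progressions with a common difference.  Proof as printed: `T ≠ {0}` makes `S`
`2`-separable with `κ₂(S) ≤ |S| − 1`, Theorem 14 makes `S` a progression (periodicity of `S*`
being excluded), its difference generates `G`, and `isAP_of_isAP_of_card_add_le` transfers the
progression to `T`.  The general case (quotient by `Q`) is NOT formalized.
[cite: HamidouneSerraZemor2008, §3, Proposition 15] -/
theorem eq_singleton_or_isAP_of_card_add_le_of_forall_card_le_addOrderOf {S T : Finset G}
    (h0S : (0 : G) ∈ S) (hgen : AddSubgroup.closure (S : Set G) = ⊤) (h0T : (0 : G) ∈ T)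
    (hstab : ∀ d : G, d ≠ 0 → d +ᵥ S.erase 0 ≠ S.erase 0)
    (hTS : #(T + S) + 1 ≤ #T + #S) (hTSn : #(T + S) + 2 ≤ Fintype.card G)
    (hord : ∀ s ∈ S, s ≠ 0 → #S ≤ addOrderOf s) :
    T = {0} ∨ ∃ d : G, d ≠ 0 ∧ IsAP S d ∧ IsAP T d := by
  classical
  by_cases hT1 : #T = 1
  · left
    obtain ⟨x, hx⟩ := card_eq_one.1 hT1
    rw [hx] at h0T ⊢
    rw [mem_singleton.1 h0T]
  right
  have hT2 : 2 ≤ #T := by have := card_pos.2 ⟨0, h0T⟩; omega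
  have hadm : IsAdm 2 S T := ⟨hT2, hTSn⟩
  have hκ : conn 2 S + 1 ≤ #S := by
    have := conn_le hadm
    have := card_le_card_add h0S T
    omega
  rcases isAP_or_vadd_erase_eq_of_forall_card_le_addOrderOf h0S hgen ⟨T, hadm⟩ hκ hord with
    ⟨d, hd, hSd⟩ | ⟨d, hd, hSd⟩
  · refine ⟨d, hd, hSd, ?_⟩
    -- `d` generates `G`: `S ⊆ ⟨d⟩` since `0 ∈ S = a + {0, d, …}`
    obtain ⟨a, hSa⟩ := hSd
    have hSsub : (S : Set G) ⊆ AddSubgroup.zmultiples d := by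
      intro x hx
      rw [mem_coe, hSa, mem_apFinset] at hx
      obtain ⟨i, -, rfl⟩ := hx
      have h0' := h0S
      rw [hSa, mem_apFinset] at h0'
      obtain ⟨i₀, -, hi₀⟩ := h0'
      have ha : a = -(i₀ • d) := eq_neg_of_add_eq_zero_left hi₀
      rw [ha, SetLike.mem_coe]
      exact (AddSubgroup.zmultiples d).add_mem
        ((AddSubgroup.zmultiples d).neg_mem ((AddSubgroup.zmultiples d).nsmul_mem
          (AddSubgroup.mem_zmultiples d) i₀))
        ((AddSubgroup.zmultiples d).nsmul_mem (AddSubgroup.mem_zmultiples d) i)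
    have hzm : AddSubgroup.zmultiples d = ⊤ := by
      rw [eq_top_iff, ← hgen]
      exact (AddSubgroup.closure_le _).2 hSsub
    have hS2 : 2 ≤ #S := by
      by_contra hS1
      have hS' : S = {0} := by
        have : #S = 1 := by have := card_pos.2 ⟨0, h0S⟩; omega
        obtain ⟨x, hx⟩ := card_eq_one.1 this
        rw [hx] at h0S ⊢; rw [mem_singleton.1 h0S]
      have htop : (⊤ : AddSubgroup G) = ⊥ := by
        rw [← hgen, hS', coe_singleton, AddSubgroup.closure_singleton_zero]
      have : d ∈ (⊥ : AddSubgroup G) := htop ▸ AddSubgroup.mem_top d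
      exact hd (AddSubgroup.mem_bot.1 this)
    exact isAP_of_isAP_of_card_add_le hzm ⟨a, hSa⟩ hS2 ⟨0, h0T⟩ hTS (by omega)
  · exact absurd hSd (hstab d hd)

/-! ### Lemma 4 for every `k`, and Theorem 21 for an arbitrary `2`-atom -/

/-- **[HamidouneSerraZemor2008, §2, Lemma 4], every `k`:** "Let `0 ∈ S` be a `k`-separable subset
of a finite abelian group.  Let `A` be a `k`-atom and suppose that `|A| > k`.  Then, for each
`a ∈ A` and `s ∈ S` we have `(A ∖ {a}) + S = A + S = A + (S ∖ {s})`."  First identity (the case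
`k = 2` is `IsAtom.erase_add_eq`).  Proof as printed: otherwise `A ∖ {a}` would be a
`k`-fragment smaller than the atom. [cite: HamidouneSerraZemor2008, §2, Lemma 4] -/
theorem IsAtom.erase_add_eq_of_lt_card {k : ℕ} (h0 : (0 : G) ∈ B) {A : Finset G}
    (hA : IsAtom k B A) (hk : k < #A) {a : G} (ha : a ∈ A) : A.erase a + B = A + B := by
  classical
  have hAa := hA.1.1
  unfold IsAdm at hAa
  have hfrag := hA.1.2
  have hsub : A.erase a + B ⊆ A + B := add_subset_add_right (erase_subset a A)
  by_contra hne
  have hlt : #(A.erase a + B) < #(A + B) := card_lt_card (hsub.ssubset_of_ne hne)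
  have hcardE : #(A.erase a) = #A - 1 := card_erase_of_mem ha
  have hEB := card_le_card hsub
  have hadm : IsAdm k B (A.erase a) := ⟨by rw [hcardE]; omega, by omega⟩
  have hκ := conn_le hadm
  have hXB := card_le_card_add h0 (A.erase a)
  have hAB := card_le_card_add h0 A
  have hfragE : IsFragment k B (A.erase a) := ⟨hadm, by rw [hcardE] at hκ ⊢; omega⟩
  have := hA.2 _ hfragE
  omega

/-- **[HamidouneSerraZemor2008, §2, Lemma 4], every `k`, second identity:** under the same
hypotheses `A + S = A + (S ∖ {s})` for each `s ∈ S` ("no element `x` in `S + A` can be uniquely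
written as `x = s + a`"). [cite: HamidouneSerraZemor2008, §2, Lemma 4] -/
theorem IsAtom.add_erase_eq_of_lt_card {k : ℕ} (h0 : (0 : G) ∈ B) {A : Finset G}
    (hA : IsAtom k B A) (hk : k < #A) (s : G) : A + B.erase s = A + B := by
  classical
  refine Subset.antisymm (add_subset_add_left (erase_subset s B)) fun x hx => ?_
  obtain ⟨a, ha, b, hb, rfl⟩ := mem_add.1 hx
  by_cases hbs : b = s
  · -- a second representation `a' + b'` with `a' ≠ a`; then `b' ≠ s`
    have : a + b ∈ A.erase a + B := by rw [hA.erase_add_eq_of_lt_card h0 hk ha]; exact hx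
    obtain ⟨a', ha', b', hb', he⟩ := mem_add.1 this
    rw [mem_erase] at ha'
    refine mem_add.2 ⟨a', ha'.2, b', mem_erase.2 ⟨fun hb's => ha'.1 ?_, hb'⟩, he⟩
    rw [hb's, ← hbs] at he
    exact add_right_cancel he
  · exact mem_add.2 ⟨a, ha, b, mem_erase.2 ⟨hbs, hb⟩, rfl⟩

/-- **Theorem 21 for an arbitrary `2`-atom (translated form):** under the hypotheses of
`IsAtom.exists_addSubgroup_or_card_eq_two_of_conn_le_add` on `S` (`0 ∈ S`, `κ₂(S) ≤ |S| + m`,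
`m ≤ 4`, `|S| + C(m+4,2) < |G|`), EVERY `2`-atom `A` of `S` is a coset `a + K` of a subgroup or
has exactly two elements (translates of atoms are atoms).
[cite: HamidouneSerraZemor2008, §5, Theorem 21] -/
theorem IsAtom.exists_addSubgroup_vadd_or_card_eq_two {S : Finset G} (h0 : (0 : G) ∈ S)
    {m : ℕ} (hm4 : m ≤ 4) (hκ : conn 2 S ≤ #S + m)
    (hSn : #S + (m + 3) * (m + 4) / 2 + 1 ≤ Fintype.card G) {A : Finset G} (hA : IsAtom 2 S A) :
    (∃ K : AddSubgroup G, ∃ a ∈ A, ∀ g, g ∈ A ↔ g - a ∈ K) ∨ #A = 2 := by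
  classical
  have hAa := hA.1.1
  unfold IsAdm at hAa
  obtain ⟨a, ha⟩ : A.Nonempty := card_pos.1 (by omega)
  have hA' : IsAtom 2 S (-a +ᵥ A) := hA.vadd (-a)
  have h0A' : (0 : G) ∈ -a +ᵥ A := mem_vadd_finset.2 ⟨a, ha, by rw [vadd_eq_add, neg_add_cancel]⟩
  rcases hA'.exists_addSubgroup_or_card_eq_two_of_conn_le_add h0 hm4 hκ hSn h0A' with ⟨K, hK⟩ | h2
  · refine Or.inl ⟨K, a, ha, fun g => ?_⟩
    have hK' : ∀ y, y ∈ -a +ᵥ A ↔ y ∈ K := fun y => by rw [← mem_coe, ← hK, SetLike.mem_coe]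
    rw [← hK' (g - a), mem_vadd_finset]
    constructor
    · intro hg; exact ⟨g, hg, by rw [vadd_eq_add]; abel⟩
    · rintro ⟨x, hx, hxg⟩
      rw [vadd_eq_add] at hxg
      have : g = x := by
        have := congrArg (· + a) hxg
        simp only [sub_add_cancel] at this
        rw [← this]; abel
      rw [this]; exact hx
  · right; rwa [card_vadd_finset] at h2

/-! ### Corollary 9 for every `k` -/

/-- **A periodic `k`-atom through `0` with period of order `≥ k` is a subgroup** (the second half
of the proof of [HamidouneSerraZemor2008, Corollary 9]: "Suppose that there is `x ≠ 0` such that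
`A = A + x`.  Then `A = A + ⟨x⟩`: hence `A ∩ (a + A) ⊇ a + ⟨x⟩` for every `a ∈ A`.  Since `|⟨x⟩| ≥
p ≥ k`, the intersection property implies `A = a + A` for every `a ∈ A` and `A` is a subgroup.")
The case `k = 2` (no order hypothesis needed) is `IsAtom.exists_addSubgroup_of_vadd_eq`.
[cite: HamidouneSerraZemor2008, §2, Corollary 9 (proof)] -/
theorem IsAtom.exists_addSubgroup_of_vadd_eq_of_le_addOrderOf {k : ℕ} (h0 : (0 : G) ∈ B)
    {A : Finset G} (hA : IsAtom k B A) (h0A : (0 : G) ∈ A) {t : G} (hper : t +ᵥ A = A)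
    (hk : k ≤ addOrderOf t) : ∃ K : AddSubgroup G, (K : Set G) = A := by
  classical
  have hsub : ∀ a ∈ A, a +ᵥ apFinset (0 : G) t (addOrderOf t) ⊆ A :=
    fun a ha => vadd_apFinset_subset_of_vadd_eq hper ha
  have hstab : ∀ a ∈ A, a +ᵥ A = A := by
    intro a ha
    symm
    refine hA.eq_of_le_card_inter h0 (hA.vadd a) ?_
    have h1 : a +ᵥ apFinset (0 : G) t (addOrderOf t) ⊆ A ∩ (a +ᵥ A) :=
      subset_inter (hsub a ha) (vadd_finset_subset_vadd_finset (by
        have := hsub 0 h0A; rwa [zero_vadd] at this))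
    have := card_le_card h1
    rw [card_vadd_finset, card_apFinset_zero_addOrderOf] at this
    omega
  exact exists_addSubgroup_of_add_mem h0A fun a ha b hb => by
    rw [← hstab a ha]; exact mem_vadd_finset.2 ⟨b, hb, rfl⟩

/-- **[HamidouneSerraZemor2008, §2, Corollary 9], every `k`:** "Let `0 ∈ S` be a `k`-separable
subset of a finite abelian group `G`.  Let `A` be a `k`-atom of `S` such that `0 ∈ A`, and
suppose that `p ≥ k` where `p` is the smallest prime divisor of `|G|`.  Then either `A` is a
subgroup of `G` or `|A ∩ (x + A)| ≤ k − 1` for every `x ∈ G`, `x ≠ 0`."  The hypothesis on `p`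
is carried in the (equivalent) form "every non-zero element has order `≥ k`".  Proof as printed:
`x + A` is a `k`-atom, so `k ≤ |A ∩ (x + A)| < |A|` is excluded by the intersection property,
and `A = x + A` makes `A` a subgroup by the previous lemma.  (`k = 2`:
`IsAtom.card_inter_vadd_le_one_of_forall_ne`.) [cite: HamidouneSerraZemor2008, §2, Corollary 9] -/
theorem IsAtom.card_inter_vadd_lt_of_forall_ne {k : ℕ} (h0 : (0 : G) ∈ B) {A : Finset G}
    (hA : IsAtom k B A) (h0A : (0 : G) ∈ A) (hnot : ∀ K : AddSubgroup G, (K : Set G) ≠ A)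
    (hord : ∀ x : G, x ≠ 0 → k ≤ addOrderOf x) {x : G} (hx : x ≠ 0) :
    #(A ∩ (x +ᵥ A)) < k := by
  classical
  by_contra hle
  push Not at hle
  have heq : A = x +ᵥ A := hA.eq_of_le_card_inter h0 (hA.vadd x) hle
  obtain ⟨K, hK⟩ := hA.exists_addSubgroup_of_vadd_eq_of_le_addOrderOf h0 h0A heq.symm (hord x hx)
  exact hnot K hK

end Isoperimetric

end Literature.Combinatorics.Additive
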